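import Literature.ComputerArithmetic.RumpOgitaOishi2009.AccSumK
import Literature.ComputerArithmetic.JeannerodRump2013.InnerProduct

/-!
# Rump 2009: ultimately fast accurate summation — the three-flop `ufp` (Algorithm 3.5, Lemmas 3.6–3.7),
# `ExtractVectorNew` with the initial `σ₀` and the bound `T` (Algorithm 4.2, Lemma 4.5), and the
# faithfully rounded summation `FastAccSum` (Algorithm 4.6, Lemmas 4.7–4.10, THEOREM 4.11)

HONEST FRAMING (ENGINES group, unit `eng-quad-4`, kernels lane of the `certquad` engine — shared
numerical engines serving client cells; rigour lives in the verifiers; every published number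
belongs to a client cell's ledger, not to the engines group): this file continues the lane's typed
summation literature (`RumpOgitaOishi2008.ExtractVector`, `RumpOgitaOishi2008.AccSum`) with the
successor paper, at FORMAT LEVEL — over the tree's binary floating-point numbers
`JeannerodRump2018.IsFloat p emin` (precision `p`, gradual underflow from `emin`, NO overflow) and ANY
round-to-nearest map `JeannerodRump2018.IsRoundNearest p emin fl` (no tie rule fixed). Typed and
PROVED: the standard estimations of §2 in the form used ((2.3)–(2.8), (2.17), (2.18)), the recursive
summation facts (3.1)–(3.4), Algorithm 3.5 with Lemma 3.6 and LEMMA 3.7 (`ufp` in three flops in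
rounding to nearest), Algorithm 4.2 `ExtractVectorNew` with LEMMA 4.5 ((4.3)–(4.9)) for the paper's
choice of `σ₀` and `T`, Lemma 4.7, the `FastTwoSum` facts (4.25)–(4.27), the bounds `Φ` (Lemma 4.8,
(4.19)) and `T^(k)`, Algorithm 4.6 `FastAccSum`, Lemma 4.9, Lemma 4.10 and THEOREM 4.11: for `p ∈ Fⁿ`,
`n ≥ 2`,
`(2n² + 4n + 6)eps ≤ 1`, `eps ≤ 1/128`, `res = FastAccSum(p)` is a faithful rounding of `Σ pᵢ`
(`isFaithfulRounding_fastAccSum`). No hardware, vendor, timing, flop-count or IEEE-format claims: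
`p` and `emin` are parameters; the only format side condition is `emin + 2p ≤ 0` (every IEEE 754
format), which makes the paper's tacitly normal constants (`2^m·eps`, `1 − (3n+1)eps`, `2n(n+2)eps`,
…) normal floating-point numbers. NOT typed: Theorem 4.12 / Algorithm 4.13 (the `K`-fold version),
§5 (timings), the flop counts, and the case `n = 1` (trivial) of Theorem 4.11.

Source read at the page: [Rump2009] S. M. Rump, *Ultimately fast accurate summation*, SIAM J. Sci.
Comput. 31(5) (2009) 3466–3502, doi:10.1137/080738490 (journal pagination): p. 3470 (`F`, `U`, `eps`,
`eta`, (2.1)), p. 3471 ((2.2)–(2.9)), p. 3472 ((2.10)–(2.18): the `ufp` rules, (2.17), the error-free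
addition criterion (2.18)), p. 3473 (§3, (3.1)–(3.5), Definition 3.1), p. 3474 (Lemma 3.2 = the
faithful-rounding criterion, Algorithm 3.3 `FastTwoSum`, Lemma 3.4, (3.6)), p. 3475 (Algorithm 3.5,
Lemma 3.6 with proof, (3.7)–(3.10)), p. 3476 (Lemma 3.7 with proof, Algorithm 4.1, (4.1)), p. 3477
(Algorithm 4.2 `ExtractVectorNew`, (4.2)), pp. 3478–3481 (Lemma 4.5, (4.3)–(4.9), with proof,
(4.10)–(4.17); Algorithm 4.6 `FastAccSum` on p. 3481), p. 3483 (Lemma 4.7, (4.18); Lemma 4.8,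
(4.19)–(4.21), with proofs; Lemma 4.9, (4.22)), p. 3484 ((4.23)–(4.27), proof of Lemma 4.9),
pp. 3485–3486 (Lemma 4.10, (4.28)–(4.33), with proof; Theorem 4.11), pp. 3487–3488 (proof of
Theorem 4.11, (4.34)–(4.42); Theorem 4.12).

DICTIONARY (source ↦ here; carriers `ℚ`; the dictionaries of `ExtractVector` / `AccSum` — `F`, `fl`,
`eps ↦ unitRoundoff p = 2^-p`, `eta ↦ 2^emin`, `½eps⁻¹eta ↦ 2^(emin+p-1)`, `eps⁻¹eta ↦ 2^(emin+p)`,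
`ufp`, `gℤ ↦ OnGrid g`, `FastTwoSum ↦ fast2Sum`, faithful rounding ↦ `IsFaithfulRounding p emin f r`,
`fl(Σ pᵢ)` (recursive summation) ↦ `flSum fl`, "any order" ↦ `SumTree.eval` — continue).
* `f ∈ U` ↦ `|f| ≤ 2^(emin+p-1)`; `f ∉ U` ↦ `2^(emin+p-1) < |f|`.
* (2.17) for `|pᵢ| ≤ 2^j`: `abs_fl_add_sub_le_of_abs_le`, `flAcc_bounds_of_abs_le`,
  `flSum_bounds_of_abs_le` (`|fl(Σpᵢ) − Σpᵢ| ≤ ½n(n−1)·eps·2^j`, the sharp constant).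
* `fl(σ + Σ pᵢ)` by recursive summation from `σ` ↦ `flAcc fl σ p` (`= SumTree.eval` of the left
  comb, `flAcc_eq_eval`); (3.1)–(3.4) ↦ `isFloat_flAcc`, `flSum_eq_sum_of_sum_abs_le` /
  `flAcc_eq_of_sum_abs_le` (no rounding error below `eps⁻¹eta`), `abs_sum_sub_flSum_le_of_nonneg`,
  `sum_abs_le_tInit` (`Σ|pᵢ| ≤ fl(fl(Σ|pᵢ|)/(1 − n·eps))`, (3.3)–(3.4)).
* Algorithm 3.5 `S = |fl(q − fl((1−eps)q))|`, `q = fl(ϕx)`, `ϕ = 2^(p−1) + 1` ↦ `ufpFl fl p x`;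
  Lemma 3.6 ↦ `lemma36_pow` (the case `x = 2^K`, `K ≥ emin + p`) and `lemma36_not_pow`; Lemma 3.7 ↦
  `ufpFl_eq_ufp` (`S = ufp(x)` for every `x ∈ F`, `p ≥ 2`, `emin + p ≤ 0`).
* Algorithm 4.2 `[σₙ, p'] = ExtractVectorNew(σ₀, p)` ↦ `extractVectorNew fl σ₀ p : ℚ × List ℚ`;
  the paper's `σ₀ = fl(fl(2T)/fl(1 − (3n+1)eps))` ((4.4)) ↦ `sigmaZero fl p n T`;
  `T' = min(fl((3/2 + 4eps)(n·eps)σ₀), fl(2n·eps·ufp(σ₀)))` ((4.9), with Algorithm 3.5 for `ufp`) ↦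
  `tBound fl p n σ₀`; Lemma 4.5 ↦ `lemma45_setup` (σ₀ ∈ F, σ₀ ≥ 2T, the working invariant),
  `lemma45_sum` ((4.3): `Σ pᵢ = σₙ − σ₀ + Σ p'ᵢ`, lengths, `p'ᵢ ∈ F`), `lemma45_sorted` and
  `lemma45_sigma` ((4.5)–(4.6): `|σₖ − σ₀| ≤ ½σ₀`, `fl(σₙ − σ₀) = σₙ − σ₀`), `lemma45_parts` ((4.7):
  `|p'ᵢ| ≤ 2eps·ufp(σ₀)`), `lemma45_tBound` ((4.8)–(4.9): `T' ∈ F`; `4T' ≤ eps⁻¹eta ⟹ Σ|p'ᵢ| ≤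
  ½eps⁻¹eta` and `fl(Σ p'ᵢ) = Σ p'ᵢ` in any order; `4T' > eps⁻¹eta ⟹ σ₀ ∉ U` and `Σ|p'ᵢ| ≤ T'`).
* Lemma 4.7 ↦ `onGrid_u_ufp_sub`; (4.27) ↦ `onGrid_two_u_ufp_of_onGrid_u_ufp`; (4.26)–(4.28) ↦
  `fast2Sum_facts`.
* `Φ = fl(fl(2n(n+2)eps)·ufp(σ₀)/fl(1 − 5eps))` ↦ `phiBound fl p n σ₀`, Lemma 4.8 ↦ `phiBound_facts`;
  the lower bound on `T^(k)` used by Lemma 4.10 ↦ `tBound_lower`; (4.19) ↦ `sigmaZero_le_half_ufp`.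
* Algorithm 4.6: the `repeat … until` loop with state `(t^(m−1), T^(m−1), p^(m−1))` ↦
  `fastAccSumAux fl p emin n fuel t T p` (structural recursion on a pass counter `fuel`; every
  `continue` halves `σ₀` and keeps it outside `U`, so the counter `⌊log₂ σ₀^(1)⌋ − (emin+p−1) + 2`
  supplied by `fastAccSum` is never exhausted — `fastAccSumAux_faithful` proves the postcondition for
  every sufficient counter); `res = FastAccSum(p)` ↦ `fastAccSum fl p emin xs`; the format constants
  `eps`, `realmin` of the Matlab code ↦ the arguments `p`, `emin`; the loop invariant ((4.23), (4.33))
  ↦ `LoopInv`; Lemma 4.9 ↦ `loop_continue`, Lemma 4.10 ↦ `loop_exit_small`, the main case of the proof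
  of Theorem 4.11 ↦ `loop_exit_main`; THEOREM 4.11 ↦ `isFaithfulRounding_fastAccSum`.

NOTES (findings while typing; each is local and does not affect Theorem 4.11 as stated).
(a) Lemma 3.6 for `x = 2^K` needs `K ≥ emin + p` here: at the boundary `x = ½eps⁻¹eta` (allowed by the
    paper's `p ∉ U` reading) `fl((1−eps)x)` is a midpoint tie and the conclusion can fail
    (`lemma36_pow_boundary_counterexample`); Lemma 3.7 is unaffected (its `q = fl(ϕx)` is never there).
(b) (4.6) in the strict form `|σₖ − σ₀| < ½σ₀` is exported only for `σ₀ ∉ U` (for `σ₀ ∈ U` equality can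
    occur, e.g. `n = 2`, `p = (eta, 0)`); the non-strict form holds always and is all that is used.
(c) In the chain (4.15)–(4.17) for `T' = M̃₁ ∈ U` the printed constants leave a deficit of order
    `eps²·n·eps·σ₀`; we close (4.9) there by an `eta`-grid argument instead (`Σ|p'ᵢ|` and `M̃₁` are
    integral multiples of `eta` and `Σ|p'ᵢ| < M̃₁ + eta`).
(d) Lemma 4.10 uses `T^(k) ≥ n·eps·σ₀`, which ignores a possibly subnormal `M̃ᵢ`; we use the uniform
    `T^(k) ≥ (1−eps)n·eps·σ₀ − ½eta` (`tBound_lower`), which suffices with room.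
(e) (4.19) is proved in the sharper form `σ₀^(m+1) ≤ ½ufp(σ₀^(m))` under `(11n+1)eps ≤ 1`.
(f) Theorem 4.11 is typed for `n ≥ 2` (for `n = 1` the result is trivially `p₁`; `n = 0` is not a
    statement of the paper); its hypotheses `(2n²+4n+6)eps ≤ 1`, `eps ≤ 1/128` are
    `2 * n ^ 2 + 4 * n + 6 ≤ 2 ^ p`, `7 ≤ p`. The final margin `(1−4eps)|τ₁| − 2n(n+2)eps·ufp(σ₀) > 0`
    is exactly as tight as in the paper (it forces the sharp constant in (2.17)).
-/

namespace Literature.ComputerArithmetic.Rump2009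

open Literature.ComputerArithmetic.JeannerodRump2018
open Literature.ComputerArithmetic.JeannerodRump2018.SumTree
open Literature.ComputerArithmetic.BoldoJeannerodMelquiondMuller2023
open Literature.ComputerArithmetic.RumpOgitaOishi2008
open Literature.ComputerArithmetic.JoldesMullerPopescu2017 (isFloat_two_zpow two_zpow_emin_le_abs)
open Literature.ComputerArithmetic.LangeRump2018 (abs_list_sum_le exact_eq_leaves_sum)
open Literature.ComputerArithmetic.JeannerodRump2013 (abs_fl_sub_le_mul_abs abs_fl_sub_le)
open Literature.ComputerArithmetic.RumpOgitaOishi2009 (isFloat_flSum)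

variable {p : ℕ} {emin : ℤ} {fl : ℚ → ℚ}

/-! ### §2: the standard estimations (2.3)–(2.8) in the form used below -/

/-- `½eps⁻¹eta = 2^(emin+p-1)`, the largest element of `U`, is a floating-point number.
[cite: Rump2009, §2 (p. 3470, the underflow range U)] -/
theorem isFloat_threshold (hp : 1 ≤ p) : IsFloat p emin ((2 : ℚ) ^ (emin + p - 1)) :=
  isFloat_two_zpow hp (by omega)

/-- Monotonicity (2.4) at the threshold: `|r| ≥ ½eps⁻¹eta ⟹ |fl(r)| ≥ ½eps⁻¹eta`.
[cite: Rump2009, §2 eq. (2.4)] -/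
theorem threshold_le_abs_fl (hp : 1 ≤ p) (hfl : IsRoundNearest p emin fl) {r : ℚ}
    (hr : (2 : ℚ) ^ (emin + p - 1) ≤ |r|) : (2 : ℚ) ^ (emin + p - 1) ≤ |fl r| := by
  have h := abs_le_abs_fl hfl (isFloat_threshold (emin := emin) hp) (t := r)
    (by rwa [abs_of_pos (two_zpow_pos _)])
  rwa [abs_of_pos (two_zpow_pos _)] at h

/-- Monotonicity (2.4) at the threshold, contrapositive: `fl(r) ∉ U ⟹ |r| > ½eps⁻¹eta`.
[cite: Rump2009, §2 eq. (2.4)] -/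
theorem threshold_lt_abs_of_lt_abs_fl (hp : 1 ≤ p) (hfl : IsRoundNearest p emin fl) {r : ℚ}
    (hr : (2 : ℚ) ^ (emin + p - 1) < |fl r|) : (2 : ℚ) ^ (emin + p - 1) < |r| := by
  by_contra h
  have h := abs_le.mp (not_lt.mp h)
  have hF := isFloat_threshold (emin := emin) hp
  have h1 : fl r ≤ (2 : ℚ) ^ (emin + p - 1) := fl_le_of_le hfl hF h.2
  have h2 : -(2 : ℚ) ^ (emin + p - 1) ≤ fl r := le_fl_of_le hfl hF.neg h.1
  exact absurd (abs_le.mpr ⟨h2, h1⟩) (not_le.mpr hr)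

/-- (2.8), second form: `fl(r) ∉ U` (indeed `|r| ≥ ½eps⁻¹eta`) `⟹ |fl(r) − r| ≤ eps·|fl(r)|`, i.e.
`fl(r) = r/(1 + ε₂)` with `|ε₂| ≤ eps`. [cite: Rump2009, §2 eq. (2.8)] -/
theorem abs_fl_sub_le_u_abs_fl (hp : 1 ≤ p) (hfl : IsRoundNearest p emin fl) {r : ℚ}
    (hr : (2 : ℚ) ^ (emin + p - 1) ≤ |r|) : |fl r - r| ≤ unitRoundoff p * |fl r| := by
  have h0 : fl r ≠ 0 := by
    intro h
    have := threshold_le_abs_fl hp hfl hr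
    rw [h, abs_zero] at this
    exact absurd this (not_le.mpr (two_zpow_pos _))
  exact (abs_fl_sub_le_u_ufp hp hfl hr).trans
    (mul_le_mul_of_nonneg_left ((ufp_le_ufp_fl hp hfl h0).trans (ufp_le_abs _)) u_pos.le)

/-- (2.5) with gradual underflow ("no error occurs in underflow"): for `a, b ∈ F`,
`|fl(a + b)| ≥ (1 − eps)|a + b|`. [cite: Rump2009, §2 eq. (2.5)] -/
theorem one_sub_u_mul_abs_add_le (hp : 1 ≤ p) (hfl : IsRoundNearest p emin fl) {a b : ℚ}
    (ha : IsFloat p emin a) (hb : IsFloat p emin b) :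
    (1 - unitRoundoff p) * |a + b| ≤ |fl (a + b)| := by
  rcases le_or_gt ((2 : ℚ) ^ (emin + p - 1)) |a + b| with h | h
  · have h1 := abs_fl_sub_le_mul_abs hp hfl h
    have h2 : |a + b| - |fl (a + b)| ≤ |fl (a + b) - (a + b)| := by
      have := abs_sub_abs_le_abs_sub (a + b) (fl (a + b))
      rwa [abs_sub_comm] at this
    nlinarith [abs_nonneg (a + b)]
  · have hsmall : |a + b| < (2 : ℚ) ^ (emin + p) :=
      lt_trans h (zpow_lt_zpow_right₀ (by norm_num) (by omega))
    rw [fl_eq_self hfl (isFloat_add_of_small ha hb hsmall)]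
    nlinarith [u_pos (p := p), abs_nonneg (a + b)]

/-- `2^(emin+p) = eps⁻¹eta = 2^p·eta`. [cite: Rump2009, §2 (p. 3470, eps and eta)] -/
theorem two_zpow_emin_add_p : (2 : ℚ) ^ (emin + p) = 2 ^ p * (2 : ℚ) ^ emin := by
  rw [zpow_add₀ (by norm_num : (2 : ℚ) ≠ 0), zpow_natCast]; ring

/-- `F ⊆ etaℤ` has a partial converse: a point of the `eta`-grid of modulus `≤ eps⁻¹eta` is in `F`.
[cite: Rump2009, §2 (p. 3472, "F ⊆ etaℤ") and eq. (2.15)] -/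
theorem isFloat_of_onGrid_eta (hp : 1 ≤ p) {t : ℚ} (hg : OnGrid ((2 : ℚ) ^ emin) t)
    (ht : |t| ≤ (2 : ℚ) ^ (emin + p)) : IsFloat p emin t :=
  isFloat_of_onGrid_two_zpow hp hg (by rwa [two_zpow_emin_add_p] at ht) le_rfl

/-- (2.7) for an argument on the `eta`-grid: then no underflow error occurs at all,
`|fl(t) − t| ≤ eps|t|` (below the threshold `t` is itself in `F`). [cite: Rump2009, §2 eq. (2.7)] -/
theorem abs_fl_sub_le_u_abs_of_onGrid (hp : 1 ≤ p) (hfl : IsRoundNearest p emin fl) {t : ℚ}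
    (hg : OnGrid ((2 : ℚ) ^ emin) t) : |fl t - t| ≤ unitRoundoff p * |t| := by
  rcases le_or_gt ((2 : ℚ) ^ (emin + p - 1)) |t| with h | h
  · exact abs_fl_sub_le_mul_abs hp hfl h
  · rw [fl_eq_self hfl (isFloat_of_onGrid_eta hp hg
      (h.le.trans (zpow_le_zpow_right₀ (by norm_num) (by omega))))]
    simp only [sub_self, abs_zero]
    exact mul_nonneg u_pos.le (abs_nonneg _)

/-- `K·eps ≤ 1` for an integer `K ≤ 2^p = eps⁻¹`. [cite: Rump2009, §3 (p. 3473, "n·eps < 1")] -/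
theorem natCast_mul_u_le_one {K : ℕ} (hK : K ≤ 2 ^ p) : (K : ℚ) * unitRoundoff p ≤ 1 := by
  have h2 : (0 : ℚ) < 2 ^ p := by positivity
  rw [unitRoundoff, mul_one_div, div_le_one h2]
  exact_mod_cast hK

/-- `K·eps < 1` for an integer `K < 2^p`. [cite: Rump2009, §3 (p. 3473, "n·eps < 1")] -/
theorem natCast_mul_u_lt_one {K : ℕ} (hK : K < 2 ^ p) : (K : ℚ) * unitRoundoff p < 1 := by
  have h2 : (0 : ℚ) < 2 ^ p := by positivity
  rw [unitRoundoff, mul_one_div, div_lt_one h2]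
  exact_mod_cast hK

/-- "`fl(n·eps) = n·eps` because `eps` is a power of 2 and `n·eps < 1`": `K·eps ∈ F` for an integer
`0 ≤ K ≤ eps⁻¹` (the format providing `eps² ≥ eta`, as IEEE 754 formats do).
[cite: Rump2009, §3 (p. 3473, proof of (3.3))] -/
theorem isFloat_natCast_mul_u (hp : 1 ≤ p) {K : ℕ} (hK : K ≤ 2 ^ p) (he : emin + p ≤ 0) :
    IsFloat p emin ((K : ℚ) * unitRoundoff p) := by
  have hK' : |((K : ℕ) : ℤ)| ≤ 2 ^ p := by
    rw [abs_of_nonneg (Int.natCast_nonneg K)]; exact_mod_cast hK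
  have h := isFloat_of_abs_le (p := p) (emin := emin) hp hK' (k := -(p : ℤ)) (by omega)
  convert h using 1
  rw [unitRoundoff, zpow_neg, zpow_natCast]; push_cast; ring

/-- "… and therefore also `fl(1 − n·eps) = 1 − n·eps`": `1 − K·eps ∈ F` for `0 ≤ K ≤ eps⁻¹`.
[cite: Rump2009, §3 (p. 3473, proof of (3.3))] -/
theorem isFloat_one_sub_natCast_mul_u (hp : 1 ≤ p) {K : ℕ} (hK : K ≤ 2 ^ p) (he : emin + p ≤ 0) :
    IsFloat p emin (1 - (K : ℚ) * unitRoundoff p) := by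
  have hKz : ((K : ℕ) : ℤ) ≤ 2 ^ p := by exact_mod_cast hK
  have hN : |(2 : ℤ) ^ p - K| ≤ 2 ^ p := by
    rw [abs_of_nonneg (sub_nonneg.mpr hKz)]; linarith [Int.natCast_nonneg K]
  have h := isFloat_of_abs_le (p := p) (emin := emin) hp hN (k := -(p : ℤ)) (by omega)
  convert h using 1
  have h2 : (2 : ℚ) ^ p ≠ 0 := by positivity
  rw [unitRoundoff, zpow_neg, zpow_natCast]; push_cast; field_simp

/-- The constant `3/2 + 4eps = (3·2^(p−3) + 1)·2^(2−p)` of Algorithm 4.6 is in `F` (`p ≥ 3`).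
[cite: Rump2009, Algorithm 4.6 (the constant 3/2 + 4eps)] -/
theorem isFloat_c1 (hp : 3 ≤ p) (he : emin + p ≤ 2) :
    IsFloat p emin (3 / 2 + 4 * unitRoundoff p) := by
  have hpow : (2 : ℤ) ^ p = 2 ^ (p - 3) * 8 := by
    rw [show (8 : ℤ) = 2 ^ 3 by norm_num, ← pow_add]; congr 1; omega
  have hx : (0 : ℤ) < 2 ^ (p - 3) := by positivity
  have hN : |(3 * 2 ^ (p - 3) + 1 : ℤ)| ≤ 2 ^ p := by
    rw [abs_of_nonneg (by positivity), hpow]; linarith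
  have h := isFloat_of_abs_le (p := p) (emin := emin) (by omega) hN (k := 2 - (p : ℤ)) (by omega)
  convert h using 1
  have hq : (2 : ℚ) ^ p = 2 ^ (p - 3) * 8 := by exact_mod_cast hpow
  have h2 : (2 : ℚ) ^ p ≠ 0 := by positivity
  rw [unitRoundoff, zpow_sub₀ (by norm_num : (2 : ℚ) ≠ 0), zpow_natCast]
  push_cast
  rw [hq]; field_simp; norm_num; ring

/-- Scaling the unit in the first place: `ufp(2ʲ·r) = 2ʲ·ufp(r)`. [cite: Rump2009, §2 eq. (2.9)] -/
theorem ufp_two_zpow_mul (j : ℤ) (r : ℚ) : ufp ((2 : ℚ) ^ j * r) = (2 : ℚ) ^ j * ufp r := by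
  rcases eq_or_ne r 0 with rfl | hr
  · simp [ufp_zero]
  obtain ⟨e, he⟩ := exists_ufp_eq_two_zpow hr
  have h1 : (2 : ℚ) ^ e ≤ |r| := he ▸ ufp_le_abs r
  have h2 : |r| < (2 : ℚ) ^ (e + 1) := by
    have := abs_lt_two_mul_ufp hr
    rw [he, mul_comm, ← zpow_add_one₀ (by norm_num : (2 : ℚ) ≠ 0)] at this
    exact this
  have hj : (0 : ℚ) < (2 : ℚ) ^ j := two_zpow_pos j
  rw [he, ufp_eq_two_zpow_of_le_of_lt (e := j + e) ?_ ?_]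
  · rw [zpow_add₀ (by norm_num : (2 : ℚ) ≠ 0)]
  · rw [abs_mul, abs_of_pos hj, zpow_add₀ (by norm_num : (2 : ℚ) ≠ 0)]
    exact mul_le_mul_of_nonneg_left h1 hj.le
  · rw [abs_mul, abs_of_pos hj, show j + e + 1 = j + (e + 1) by ring,
      zpow_add₀ (by norm_num : (2 : ℚ) ≠ 0)]
    exact mul_lt_mul_of_pos_left h2 hj

/-- `ufp(2ᵏ·r) = 2ᵏ·ufp(r)` for a natural exponent. [cite: Rump2009, §2 eq. (2.9)] -/
theorem ufp_two_pow_mul (k : ℕ) (r : ℚ) : ufp ((2 : ℚ) ^ k * r) = (2 : ℚ) ^ k * ufp r := by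
  rw [← zpow_natCast]; exact ufp_two_zpow_mul k r

/-- `ufp(2r) = 2ufp(r)`. [cite: Rump2009, §2 eq. (2.9)] -/
theorem ufp_two_mul (r : ℚ) : ufp (2 * r) = 2 * ufp r := by
  simpa using ufp_two_zpow_mul 1 r

/-- Scaling inside `F` (no overflow in this model): `2ᵏ·x ∈ F` for `x ∈ F`.
[cite: Rump2009, proof of Lemma 3.7 ("p̄ := ½eps⁻¹p ∈ F")] -/
theorem isFloat_two_pow_mul (k : ℕ) {x : ℚ} (hx : IsFloat p emin x) :
    IsFloat p emin ((2 : ℚ) ^ k * x) := by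
  obtain ⟨M, e, hM, he, rfl⟩ := hx
  refine ⟨M, e + k, hM, by omega, ?_⟩
  rw [zpow_add₀ (by norm_num : (2 : ℚ) ≠ 0), zpow_natCast]; ring

/-- `2^(p−1)·2ᵉ = 2^(e+p−1)` (`p ≥ 1`). [cite: Rump2009, proof of Lemma 3.7] -/
theorem two_pow_pred_mul_zpow (hp : 1 ≤ p) (e : ℤ) :
    (2 : ℚ) ^ (p - 1) * (2 : ℚ) ^ e = (2 : ℚ) ^ (e + p - 1) := by
  rw [← zpow_natCast, ← zpow_add₀ (by norm_num : (2 : ℚ) ≠ 0), Nat.cast_sub hp]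
  congr 1; push_cast; ring

/-- `2eps·2^(p−1) = 1`. [cite: Rump2009, proof of Lemma 3.7 ("2eps·ufp(p̄) = ufp(p)")] -/
theorem two_mul_u_mul_two_pow_pred (hp : 1 ≤ p) : 2 * unitRoundoff p * (2 : ℚ) ^ (p - 1) = 1 := by
  have h : (2 : ℚ) * 2 ^ (p - 1) = 2 ^ p := by
    rw [← pow_succ']; congr 1; omega
  have h2 : (2 : ℚ) ^ p ≠ 0 := by positivity
  rw [unitRoundoff]
  calc 2 * (1 / (2 : ℚ) ^ p) * 2 ^ (p - 1) = (2 * 2 ^ (p - 1)) / 2 ^ p := by ring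
    _ = 1 := by rw [h, div_self h2]

/-! ### §3: basic facts (3.1)–(3.4) -/

/-- The accumulation loop `τ = fl(τ + qᵢ)` started at `σ` (`σₖ` of Algorithm 4.2, and `fl(Σ pᵢ)` with
`σ = p₁`): `flAcc fl σ [x₁, …, xₖ] = fl(… fl(fl(σ + x₁) + x₂) … + xₖ)`.
[cite: Rump2009, Algorithm 4.2 (σᵢ = fl(σᵢ₋₁ + pᵢ)) and eq. (4.10)] -/
def flAcc (fl : ℚ → ℚ) (σ : ℚ) (xs : List ℚ) : ℚ := xs.foldl (fun τ q => fl (τ + q)) σ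

/-- `flAcc` on the empty list. [cite: Rump2009, Algorithm 4.2] -/
@[simp] theorem flAcc_nil (fl : ℚ → ℚ) (σ : ℚ) : flAcc fl σ [] = σ := rfl

/-- One step of `flAcc`. [cite: Rump2009, Algorithm 4.2] -/
theorem flAcc_cons (fl : ℚ → ℚ) (σ x : ℚ) (xs : List ℚ) :
    flAcc fl σ (x :: xs) = flAcc fl (fl (σ + x)) xs := rfl

/-- The last step of `flAcc`. [cite: Rump2009, Algorithm 4.2] -/
theorem flAcc_append_singleton (fl : ℚ → ℚ) (σ : ℚ) (xs : List ℚ) (x : ℚ) :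
    flAcc fl σ (xs ++ [x]) = fl (flAcc fl σ xs + x) := by
  simp [flAcc, List.foldl_append]

/-- `fl(Σ pᵢ)` from the left is `flAcc` started at `p₁`. [cite: Rump2009, eq. (3.1)] -/
theorem flSum_cons (fl : ℚ → ℚ) (x : ℚ) (xs : List ℚ) : flSum fl (x :: xs) = flAcc fl x xs := rfl

/-- `flAcc` is the floating-point evaluation of the left comb with leaves `σ, x₁, …, xₖ`.
[cite: Rump2009, eq. (4.10) (σₖ = fl(σ₀ + Σ pᵢ))] -/
theorem flAcc_eq_eval (fl : ℚ → ℚ) (σ : ℚ) (xs : List ℚ) :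
    flAcc fl σ xs = (accTree (SumTree.leaf σ) xs).eval fl := by
  rw [eval_accTree]; rfl

/-- `flAcc` of floats is a float. [cite: Rump2009, Algorithm 4.2] -/
theorem isFloat_flAcc (hfl : IsRoundNearest p emin fl) {σ : ℚ} (hσ : IsFloat p emin σ) :
    ∀ xs : List ℚ, IsFloat p emin (flAcc fl σ xs)
  | [] => hσ
  | x :: xs => by
      rw [flAcc_cons]
      exact isFloat_flAcc (hfl := hfl) (hfl _).1 xs

/-- **(2.6) for `σₖ = fl(σ₀ + Σᵢ≤ₖ pᵢ)`** in the sharper form of the tree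
(`JeannerodRump2018`, Theorem 4.1: `(k·eps/(1+eps))·Σ|·| ≤ γₖ·Σ|·|`):
`|σₖ − (σ₀ + Σᵢ≤ₖ pᵢ)| ≤ k·eps·(|σ₀| + Σᵢ≤ₖ |pᵢ|)`. [cite: Rump2009, §2 eq. (2.6) and eq. (4.10)] -/
theorem abs_flAcc_sub_le (hp : 2 ≤ p) (hfl : IsRoundNearest p emin fl) {σ : ℚ} (hσ : IsFloat p emin σ)
    {xs : List ℚ} (hxs : ∀ x ∈ xs, IsFloat p emin x) :
    |flAcc fl σ xs - (σ + xs.sum)| ≤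
      (xs.length : ℚ) * unitRoundoff p * (|σ| + (xs.map abs).sum) := by
  set t := accTree (SumTree.leaf σ) xs with ht
  have hl : t.leaves = σ :: xs := by rw [ht, leaves_accTree]; rfl
  have hleaves : ∀ a ∈ t.leaves, IsFloat p emin a := by
    intro a ha; rw [hl] at ha
    rcases List.mem_cons.mp ha with rfl | ha
    · exact hσ
    · exact hxs a ha
  have h := sumError_le_holds p emin fl hp hfl t hleaves
  have hev : t.eval fl = flAcc fl σ xs := (flAcc_eq_eval fl σ xs).symm
  have hex : t.exact = σ + xs.sum := by rw [ht, exact_accTree]; rfl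
  rw [hev, hex, hl] at h
  simp only [List.length_cons, Nat.add_sub_cancel, List.map_cons, List.sum_cons] at h
  refine h.trans ?_
  have hu : unitRoundoff p / (1 + unitRoundoff p) ≤ unitRoundoff p :=
    div_le_self u_pos.le (by linarith [u_pos (p := p)])
  have hS : 0 ≤ |σ| + (xs.map abs).sum :=
    add_nonneg (abs_nonneg _) (List.sum_nonneg (by
      intro a ha; obtain ⟨b, -, rfl⟩ := List.mem_map.mp ha; exact abs_nonneg b))
  have hn : (0 : ℚ) ≤ xs.length := by positivity
  nlinarith [mul_nonneg hn hS]

/-- The induction behind (3.1): accumulating nonnegative floats from a nonnegative float `acc` with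
`|A − acc| ≤ k·eps·acc` keeps `acc` in `F`, nondecreasing, and `|A + Σ yᵢ − result| ≤ (k + #y)·eps·result`.
[cite: Rump2009, proof of (3.1)] -/
theorem flAcc_nonneg_aux (hp : 1 ≤ p) (hfl : IsRoundNearest p emin fl) :
    ∀ (ys : List ℚ) (acc A : ℚ) (k : ℕ), (∀ y ∈ ys, IsFloat p emin y ∧ 0 ≤ y) →
      IsFloat p emin acc → 0 ≤ acc → |A - acc| ≤ (k : ℚ) * unitRoundoff p * acc →
      IsFloat p emin (flAcc fl acc ys) ∧ acc ≤ flAcc fl acc ys ∧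
        |A + ys.sum - flAcc fl acc ys| ≤ ((k + ys.length : ℕ) : ℚ) * unitRoundoff p * flAcc fl acc ys
  | [], acc, A, k, _, hacc, _, hA => by
      refine ⟨hacc, le_rfl, ?_⟩
      simpa using hA
  | y :: ys, acc, A, k, hys, hacc, hacc0, hA => by
      obtain ⟨hy, hy0⟩ := hys y (by simp)
      have hys' : ∀ z ∈ ys, IsFloat p emin z ∧ 0 ≤ z := fun z hz => hys z (by simp [hz])
      have hacc'F : IsFloat p emin (fl (acc + y)) := (hfl _).1
      have hmono : acc ≤ fl (acc + y) := le_fl_of_le hfl hacc (by linarith)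
      have hacc'0 : 0 ≤ fl (acc + y) := hacc0.trans hmono
      have herr : |fl (acc + y) - (acc + y)| ≤ unitRoundoff p * fl (acc + y) := by
        have h1 := abs_fl_add_sub_le_u_ufp hp hfl hacc hy
        have h2 := ufp_add_le_ufp_fl_add hp hfl hacc hy
        have h3 := ufp_le_abs (fl (acc + y))
        rw [abs_of_nonneg hacc'0] at h3
        exact h1.trans (mul_le_mul_of_nonneg_left (h2.trans h3) u_pos.le)
      have hA' : |(A + y) - fl (acc + y)| ≤ ((k + 1 : ℕ) : ℚ) * unitRoundoff p * fl (acc + y) := by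
        have e : (A + y) - fl (acc + y) = (A - acc) + ((acc + y) - fl (acc + y)) := by ring
        rw [e]
        refine (abs_add_le _ _).trans ?_
        rw [abs_sub_comm (acc + y)]
        have hk : (k : ℚ) * unitRoundoff p * acc ≤ (k : ℚ) * unitRoundoff p * fl (acc + y) :=
          mul_le_mul_of_nonneg_left hmono (mul_nonneg (by positivity) u_pos.le)
        push_cast
        nlinarith
      have ih := flAcc_nonneg_aux hp hfl ys (fl (acc + y)) (A + y) (k + 1) hys' hacc'F hacc'0 hA'
      obtain ⟨h1, h2, h3⟩ := ih
      rw [flAcc_cons]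
      refine ⟨h1, hmono.trans h2, ?_⟩
      have e1 : A + (y :: ys).sum = A + y + ys.sum := by rw [List.sum_cons]; ring
      have e2 : k + (y :: ys).length = k + 1 + ys.length := by rw [List.length_cons]; omega
      rw [e1, e2]; exact h3

/-- **(3.1)** (nonnegative summands): for `pᵢ ∈ F`, `pᵢ ≥ 0` and `S̃ := fl(Σ pᵢ)` (from the left),
`S̃ ∈ F`, `S̃ ≥ 0` and `|Σ pᵢ − S̃| ≤ (n − 1)eps·S̃`, i.e. `Σ pᵢ = S̃(1 + ε)`, `|ε| ≤ (n−1)eps`. (The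
printed hypothesis `n·eps < 1` is not needed for this.) [cite: Rump2009, §3 eq. (3.1)] -/
theorem abs_sum_sub_flSum_le_of_nonneg (hp : 1 ≤ p) (hfl : IsRoundNearest p emin fl) {xs : List ℚ}
    (hxs : ∀ x ∈ xs, IsFloat p emin x ∧ 0 ≤ x) :
    IsFloat p emin (flSum fl xs) ∧ 0 ≤ flSum fl xs ∧
      |xs.sum - flSum fl xs| ≤ ((xs.length : ℚ) - 1) * unitRoundoff p * flSum fl xs := by
  cases xs with
  | nil =>
      refine ⟨by simpa [flSum] using isFloat_zero p emin, by simp [flSum], ?_⟩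
      simp [flSum]
  | cons x xs =>
      obtain ⟨hx, hx0⟩ := hxs x (by simp)
      have h := flAcc_nonneg_aux hp hfl xs x x 0 (fun y hy => hxs y (by simp [hy])) hx hx0
        (by simp)
      obtain ⟨h1, h2, h3⟩ := h
      rw [flSum_cons]
      refine ⟨h1, hx0.trans h2, ?_⟩
      have e : ((x :: xs).length : ℚ) - 1 = ((0 + xs.length : ℕ) : ℚ) := by
        rw [List.length_cons]; push_cast; ring
      rw [e, List.sum_cons]; exact h3

/-- **(3.2)**, in any order: `pᵢ ∈ F`, `Σ|pᵢ| ≤ eps⁻¹eta ⟹ fl(Σ pᵢ) = Σ pᵢ` for EVERY evaluation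
tree ("a direct consequence of (2.18) with `σ = eps⁻¹eta`"). [cite: Rump2009, §3 eq. (3.2)] -/
theorem eval_eq_exact_of_absSum_le (hp : 1 ≤ p) (hfl : IsRoundNearest p emin fl) (t : SumTree)
    (ht : ∀ a ∈ t.leaves, IsFloat p emin a) (hs : t.absSum ≤ (2 : ℚ) ^ (emin + p)) :
    t.eval fl = t.exact :=
  eval_eq_exact_of_onGrid hp hfl le_rfl t (fun a ha => onGrid_eta_of_isFloat (ht a ha))
    (by rwa [two_zpow_emin_add_p] at hs)

/-- **(3.2)** for `fl(Σ pᵢ)` from the left: `pᵢ ∈ F`, `Σ|pᵢ| ≤ eps⁻¹eta ⟹ fl(Σ pᵢ) = Σ pᵢ`.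
[cite: Rump2009, §3 eq. (3.2)] -/
theorem flSum_eq_sum_of_sum_abs_le (hp : 1 ≤ p) (hfl : IsRoundNearest p emin fl) {xs : List ℚ}
    (hxs : ∀ x ∈ xs, IsFloat p emin x) (hs : (xs.map abs).sum ≤ (2 : ℚ) ^ (emin + p)) :
    flSum fl xs = xs.sum := by
  cases xs with
  | nil => simp [flSum]
  | cons x xs =>
      rw [flSum_cons, flAcc_eq_eval]
      have hl : (accTree (SumTree.leaf x) xs).leaves = x :: xs := by rw [leaves_accTree]; rfl
      have h := eval_eq_exact_of_absSum_le hp hfl (accTree (SumTree.leaf x) xs)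
        (fun a ha => hxs a (by rw [hl] at ha; exact ha)) (by unfold SumTree.absSum; rw [hl]; exact hs)
      rw [h, exact_accTree]; simp [SumTree.exact]

/-- `flAcc` version of (3.2): `σ, pᵢ ∈ F`, `|σ| + Σ|pᵢ| ≤ eps⁻¹eta ⟹ flAcc σ p = σ + Σ pᵢ`.
[cite: Rump2009, §3 eq. (3.2) and proof of Lemma 4.5 (case σ₀ ∈ U)] -/
theorem flAcc_eq_of_sum_abs_le (hp : 1 ≤ p) (hfl : IsRoundNearest p emin fl) {σ : ℚ}
    (hσ : IsFloat p emin σ) {xs : List ℚ} (hxs : ∀ x ∈ xs, IsFloat p emin x)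
    (hs : |σ| + (xs.map abs).sum ≤ (2 : ℚ) ^ (emin + p)) : flAcc fl σ xs = σ + xs.sum := by
  have h := flSum_eq_sum_of_sum_abs_le hp hfl (xs := σ :: xs)
    (by intro a ha; rcases List.mem_cons.mp ha with rfl | ha; exacts [hσ, hxs a ha])
    (by simpa using hs)
  rwa [flSum_cons, List.sum_cons] at h

/-- The sum of absolute values of a list is nonnegative. [cite: Rump2009, §3 eq. (3.1)] -/
theorem sum_map_abs_nonneg (xs : List ℚ) : 0 ≤ (xs.map abs).sum :=
  List.sum_nonneg (by intro a ha; obtain ⟨b, -, rfl⟩ := List.mem_map.mp ha; exact abs_nonneg b)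

/-- **(3.3)**: for `pᵢ ∈ F` and `n·eps < 1`, `T := fl(fl(Σ|pᵢ|)/(1 − n·eps)) ⟹ Σ|pᵢ| ≤ T` (the
constants `n·eps`, `1 − n·eps` evaluated in floating-point, exactly).
[cite: Rump2009, §3 eq. (3.3)] -/
theorem sum_abs_le_tInit (hp : 1 ≤ p) (he : emin + p ≤ 0) (hfl : IsRoundNearest p emin fl)
    {xs : List ℚ} (hxs : ∀ x ∈ xs, IsFloat p emin x) (hn : xs.length < 2 ^ p) :
    (xs.map abs).sum ≤
      fl (flSum fl (xs.map abs) / fl (1 - fl ((xs.length : ℚ) * unitRoundoff p))) := by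
  set n := xs.length with hn_def
  set u := unitRoundoff p with hu
  have hu0 : 0 < u := u_pos
  have hnu : (n : ℚ) * u < 1 := natCast_mul_u_lt_one hn
  -- the constants are exact
  have hc1 : fl ((n : ℚ) * u) = n * u := fl_eq_self hfl (isFloat_natCast_mul_u hp hn.le he)
  have hc2 : fl (1 - (n : ℚ) * u) = 1 - n * u :=
    fl_eq_self hfl (isFloat_one_sub_natCast_mul_u hp hn.le he)
  rw [hc1, hc2]
  -- (3.1) for the |pᵢ|
  have habs : ∀ y ∈ xs.map abs, IsFloat p emin y ∧ 0 ≤ y := by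
    intro y hy; obtain ⟨x, hx, rfl⟩ := List.mem_map.mp hy
    exact ⟨isFloat_abs (hxs x hx), abs_nonneg x⟩
  obtain ⟨hSF, hS0, hS⟩ := abs_sum_sub_flSum_le_of_nonneg hp hfl habs
  rw [List.length_map, ← hn_def] at hS
  set S := flSum fl (xs.map abs) with hS_def
  have hsumabs : ((xs.map abs).map abs).sum = (xs.map abs).sum := by
    rw [List.map_map]; congr 1
    exact List.map_congr_left (fun x _ => by simp)
  have hle1 : (xs.map abs).sum ≤ (1 + ((n : ℚ) - 1) * u) * S := by
    have := (abs_sub_le_iff.mp hS).1; nlinarith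
  have hc0 : 0 < 1 - (n : ℚ) * u := by linarith
  have hcle : 1 - (n : ℚ) * u ≤ 1 := by nlinarith [Nat.cast_nonneg (α := ℚ) n]
  -- T ≥ S
  have hTS : S ≤ fl (S / (1 - (n : ℚ) * u)) :=
    le_fl_of_le hfl hSF (by rw [le_div_iff₀ hc0]; nlinarith)
  rcases le_or_gt (fl (S / (1 - (n : ℚ) * u))) ((2 : ℚ) ^ (emin + p - 1)) with hU | hN
  · -- T ∈ U: then Σ|pᵢ| ≤ 2S ≤ eps⁻¹eta and (3.2) makes S exact
    have h2S : (xs.map abs).sum ≤ (2 : ℚ) ^ (emin + p) := by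
      have hn1 : ((n : ℚ) - 1) * u ≤ 1 := by nlinarith [Nat.cast_nonneg (α := ℚ) n]
      have h22 : (2 : ℚ) ^ (emin + p) = 2 * (2 : ℚ) ^ (emin + p - 1) := by
        rw [show emin + p = (emin + p - 1) + 1 by ring, zpow_add_one₀ (by norm_num : (2:ℚ) ≠ 0)]
        ring
      rw [h22]; nlinarith
    have hex := flSum_eq_sum_of_sum_abs_le hp hfl (xs := xs.map abs) (fun y hy => (habs y hy).1)
      (by rw [hsumabs]; exact h2S)
    rw [← hS_def] at hex
    rw [← hex]; exact hTS
  · -- T ∉ U: (2.8) and (3.1)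
    have hr : (2 : ℚ) ^ (emin + p - 1) < |S / (1 - (n : ℚ) * u)| :=
      threshold_lt_abs_of_lt_abs_fl hp hfl (lt_of_lt_of_le hN (le_abs_self _))
    have h28 := abs_fl_sub_le_u_abs_fl hp hfl hr.le
    set T := fl (S / (1 - (n : ℚ) * u)) with hT_def
    have hT0 : 0 < T := lt_trans (two_zpow_pos _) hN
    rw [abs_of_pos hT0] at h28
    have h1 : S / (1 - (n : ℚ) * u) ≤ (1 + u) * T := by
      have := (abs_sub_le_iff.mp h28).2; linarith
    have h2 : S ≤ (1 + u) * (1 - (n : ℚ) * u) * T := by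
      rw [div_le_iff₀ hc0] at h1; nlinarith
    have hn0 : (0 : ℚ) ≤ n := Nat.cast_nonneg n
    have hnn : (0 : ℚ) ≤ (n : ℚ) * ((n : ℚ) - 1) := by
      rcases Nat.eq_zero_or_pos n with h0 | h0
      · rw [h0]; simp
      · have : (1 : ℚ) ≤ n := by exact_mod_cast h0
        nlinarith
    have key : (1 + ((n : ℚ) - 1) * u) * ((1 + u) * (1 - (n : ℚ) * u)) ≤ 1 := by
      have e : (1 + ((n : ℚ) - 1) * u) * ((1 + u) * (1 - (n : ℚ) * u)) =
          1 - u ^ 2 * ((n : ℚ) ^ 2 - n + 1) - u ^ 3 * ((n : ℚ) * ((n : ℚ) - 1)) := by ring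
      rw [e]
      have h3 : (0 : ℚ) ≤ (n : ℚ) ^ 2 - n + 1 := by nlinarith [sq_nonneg ((n : ℚ) - 1)]
      nlinarith [pow_pos hu0 2, pow_pos hu0 3, mul_nonneg (pow_pos hu0 2).le h3,
        mul_nonneg (pow_pos hu0 3).le hnn]
    have h1n : 0 ≤ 1 + ((n : ℚ) - 1) * u := by
      have hu1 : u ≤ 1 := u_le_one
      nlinarith
    calc (xs.map abs).sum ≤ (1 + ((n : ℚ) - 1) * u) * S := hle1
      _ ≤ (1 + ((n : ℚ) - 1) * u) * ((1 + u) * (1 - (n : ℚ) * u) * T) :=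
          mul_le_mul_of_nonneg_left h2 h1n
      _ = ((1 + ((n : ℚ) - 1) * u) * ((1 + u) * (1 - (n : ℚ) * u))) * T := by ring
      _ ≤ 1 * T := mul_le_mul_of_nonneg_right key hT0.le
      _ = T := one_mul T

/-- **(3.4)**: `0 < f ∈ F ⟹ pred(f) ≤ (1 − eps)·f` (for `f ∉ U` the predecessor is `f − eps·f` or
`f − 2eps·ufp(f)`; for `f ∈ U` it is `f − eta ≤ (1 − eps)f`). [cite: Rump2009, §3 eq. (3.4)] -/
theorem pred_le_one_sub_u_mul (hp : 1 ≤ p) {f g : ℚ} (hf : IsFloat p emin f) (hf0 : 0 < f)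
    (hg : IsPred p emin f g) : g ≤ (1 - unitRoundoff p) * f := by
  have h := (IsPred.le_sub hp hf hg).1
  rw [abs_of_pos hf0] at h; linarith

/-! ### Algorithm 3.5, Lemmas 3.6 and 3.7: the unit in the first place in three flops -/

/-- **Algorithm 3.5** (unit in the first place of a floating-point number, rounding to nearest):
`ϕ := 2^(p−1) + 1`, `q := fl(ϕ·x)`, `S := |fl(q − fl((1 − eps)·q))|` (the absolute value is exact).
[cite: Rump2009, Algorithm 3.5] -/
def ufpFl (fl : ℚ → ℚ) (p : ℕ) (x : ℚ) : ℚ :=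
  |fl (fl ((2 ^ (p - 1) + 1 : ℚ) * x) - fl ((1 - unitRoundoff p) * fl ((2 ^ (p - 1) + 1 : ℚ) * x)))|

/-- For `0 < x ∈ F` outside the open underflow range, `x + 2eps·ufp(x) ∈ F` — including the boundary
`x = ½eps⁻¹eta`, where it is `(2^(p−1) + 1)·eta`.
[cite: Rump2009, proof of Lemma 3.6 ("succ(p) ≤ p + 2eps·ufp(p)")] -/
theorem isFloat_add_two_u_ufp (hp : 1 ≤ p) {x : ℚ} (hx : IsFloat p emin x)
    (hU : (2 : ℚ) ^ (emin + p - 1) ≤ x) : IsFloat p emin (x + 2 * unitRoundoff p * ufp x) := by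
  rcases hU.lt_or_eq with hlt | heq
  · have h := isFloat_add_two_u_ufp_of_not_mem_U hp hx
      (by rwa [abs_of_pos (lt_trans (two_zpow_pos _) hlt)]) 1 (by norm_num)
    simpa using h
  · rw [← heq, ufp_two_zpow, two_mul_u_mul_two_zpow]
    have h2 : (2 : ℤ) ^ p = 2 * 2 ^ (p - 1) := by rw [← pow_succ']; congr 1; omega
    have h1 : (1 : ℤ) ≤ 2 ^ (p - 1) := one_le_pow₀ (by norm_num)
    have hN : |((2 : ℤ) ^ (p - 1) + 1)| ≤ 2 ^ p := by
      rw [abs_of_nonneg (by positivity), h2]; linarith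
    have h := isFloat_of_abs_le (p := p) (emin := emin) hp hN (k := emin) le_rfl
    convert h using 1
    have e : emin + (p : ℤ) - 1 - p + 1 = emin := by ring
    rw [e]; push_cast
    rw [add_mul, one_mul, two_pow_pred_mul_zpow hp]

/-- Rounding to nearest cannot overshoot a power of two `2ᴷ ∈ F` from below the midpoint:
`y < 2ᴷ(1 + eps) ⟹ fl(y) ≤ 2ᴷ` (the floats above `2ᴷ` start at `2ᴷ(1 + 2eps)`).
[cite: Rump2009, proof of Lemma 3.6 ("fl((1+2eps)p) ≤ 2σ")] -/
theorem fl_le_two_zpow_of_lt (hp : 1 ≤ p) (hfl : IsRoundNearest p emin fl) {K : ℤ} (hK : emin ≤ K)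
    {y : ℚ} (hy : y < (2 : ℚ) ^ K * (1 + unitRoundoff p)) : fl y ≤ (2 : ℚ) ^ K := by
  by_contra hcon
  have hcon : (2 : ℚ) ^ K < fl y := lt_of_not_ge hcon
  have hfF : IsFloat p emin (fl y) := (hfl y).1
  have hgF : IsFloat p emin ((2 : ℚ) ^ K) := isFloat_two_zpow hp hK
  have hKpos : (0 : ℚ) < (2 : ℚ) ^ K := two_zpow_pos K
  have hu0 : 0 < unitRoundoff p := u_pos
  -- `fl y` and `2ᴷ` lie on the grid `2^(K−p+1) = 2eps·2ᴷ`, so `fl y ≥ 2ᴷ(1 + 2eps)`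
  have hgridf : OnGrid ((2 : ℚ) ^ (K - p + 1)) (fl y) :=
    onGrid_of_isFloat_of_le_abs hfF (by rw [abs_of_pos (hKpos.trans hcon)]; exact hcon.le)
  have hgridg : OnGrid ((2 : ℚ) ^ (K - p + 1)) ((2 : ℚ) ^ K) := by
    refine ⟨2 ^ (p - 1), ?_⟩
    push_cast
    rw [two_pow_pred_mul_zpow hp]; congr 1; ring
  have hgap : (2 : ℚ) ^ (K - p + 1) ≤ |fl y - (2 : ℚ) ^ K| :=
    two_zpow_le_abs_of_onGrid (hgridf.sub hgridg) (sub_ne_zero.mpr hcon.ne')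
  rw [abs_of_pos (sub_pos.mpr hcon), ← two_mul_u_mul_two_zpow] at hgap
  -- nearest rounding: `|y − fl y| ≤ |y − 2ᴷ|`
  have hnear := (hfl y).2 _ hgF
  have h1 : fl y - y ≤ |y - fl y| := by rw [abs_sub_comm]; exact le_abs_self _
  rcases le_or_gt y ((2 : ℚ) ^ K) with hle | hgt
  · rw [abs_of_nonpos (sub_nonpos.mpr hle)] at hnear
    nlinarith
  · rw [abs_of_pos (sub_pos.mpr hgt)] at hnear
    nlinarith

/-- **Lemma 3.6, (3.8)**: for `0 < x ∈ F` with `x ≥ ½eps⁻¹eta` (that is `x ∉ U`, the boundary point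
allowed), `succ(x) ≤ fl((1 + 2eps)·x) ≤ 2ufp(x)`. [cite: Rump2009, Lemma 3.6 eq. (3.8)] -/
theorem succ_le_fl_one_add_two_u_mul (hp : 1 ≤ p) (hfl : IsRoundNearest p emin fl) {x h : ℚ}
    (hx : IsFloat p emin x) (hU : (2 : ℚ) ^ (emin + p - 1) ≤ x) (hh : IsSucc p emin x h) :
    h ≤ fl ((1 + 2 * unitRoundoff p) * x) ∧ fl ((1 + 2 * unitRoundoff p) * x) ≤ 2 * ufp x := by
  have hx0 : 0 < x := lt_of_lt_of_le (two_zpow_pos _) hU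
  have hu0 : 0 < unitRoundoff p := u_pos
  have hxabs : |x| = x := abs_of_pos hx0
  obtain ⟨k, hk⟩ := exists_ufp_eq_two_zpow hx0.ne'
  have hufp0 : 0 < ufp x := ufp_pos hx0.ne'
  have hufpx : ufp x ≤ x := by have := ufp_le_abs x; rwa [hxabs] at this
  have hx2 : x < 2 * ufp x := by have := abs_lt_two_mul_ufp hx0.ne'; rwa [hxabs] at this
  -- emin + p - 1 ≤ k
  have hk1 : emin + p - 1 ≤ k := by
    have h1 : (2 : ℚ) ^ (emin + p - 1) ≤ (2 : ℚ) ^ k := hk ▸ two_zpow_le_ufp (hxabs.symm ▸ hU)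
    exact (zpow_le_zpow_iff_right₀ (by norm_num : (1 : ℚ) < 2)).mp h1
  constructor
  · -- succ(x) ≤ x + 2eps·ufp(x) ≤ fl((1+2eps)x)
    have hgF := isFloat_add_two_u_ufp hp hx hU
    have hgt : x < x + 2 * unitRoundoff p * ufp x := by nlinarith
    have hle : x + 2 * unitRoundoff p * ufp x ≤ (1 + 2 * unitRoundoff p) * x := by nlinarith
    exact (hh.2.2 _ hgF hgt).trans (le_fl_of_le hfl hgF hle)
  · -- x ≤ (1 − eps)·2ufp(x) = pred(2ufp(x)), so (1+2eps)x < (1+eps)·2ufp(x): no overshoot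
    have h2F : IsFloat p emin ((2 : ℚ) ^ (k + 1)) := isFloat_two_zpow hp (by omega)
    have h2k : (2 : ℚ) ^ (k + 1) = 2 * ufp x := by
      rw [hk, zpow_add_one₀ (by norm_num : (2 : ℚ) ≠ 0)]; ring
    have hsep := u_mul_abs_le_abs_sub hp h2F hx (by rw [h2k]; exact hx2.ne)
    rw [abs_of_pos (two_zpow_pos _), abs_sub_comm, abs_of_pos (by rw [h2k]; linarith), h2k] at hsep
    have hy : (1 + 2 * unitRoundoff p) * x < (2 : ℚ) ^ (k + 1) * (1 + unitRoundoff p) := by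
      rw [h2k]; nlinarith [mul_pos hu0 (mul_pos hu0 hufp0)]
    have := fl_le_two_zpow_of_lt hp hfl (by omega) hy
    rwa [h2k] at this

/-- **Lemma 3.6, (3.9)** (the power-of-two case): for `x = 2ᴷ = ufp(x)` with `K ≥ emin + p`,
`fl(x − fl((1 − eps)x)) = fl(x − (1 − eps)x) = eps·ufp(x)`; both operations are exact.
NOTE. The printed hypothesis `x ≥ ½eps⁻¹eta` admits `K = emin + p − 1`, where (3.9) FAILS:
then `(1 − eps)x` is the midpoint of `pred(x) = (1 − 2eps)x` and `x`, and the result is `0` or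
`eta = 2eps·ufp(x)` depending on the tie — see `lemma36_pow_boundary_counterexample`. Lemma 3.7
applies (3.9) only at `q > p̄ ≥ ½eps⁻¹eta`, so it is unaffected. [cite: Rump2009, Lemma 3.6 eq. (3.9)] -/
theorem lemma36_pow (hp : 1 ≤ p) (hfl : IsRoundNearest p emin fl) {K : ℤ} (hK : emin + p ≤ K) :
    fl ((1 - unitRoundoff p) * (2 : ℚ) ^ K) = (2 : ℚ) ^ K - (2 : ℚ) ^ (K - p) ∧
      fl ((2 : ℚ) ^ K - fl ((1 - unitRoundoff p) * (2 : ℚ) ^ K)) = unitRoundoff p * (2 : ℚ) ^ K := by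
  have hval : (1 - unitRoundoff p) * (2 : ℚ) ^ K = (2 : ℚ) ^ K - (2 : ℚ) ^ (K - p) := by
    rw [sub_mul, one_mul, u_mul_two_zpow]
  have hF1 : IsFloat p emin ((2 : ℚ) ^ K - (2 : ℚ) ^ (K - p)) := by
    have hN : |(2 : ℤ) ^ p - 1| ≤ 2 ^ p := by
      rw [abs_of_nonneg (by linarith [one_le_pow₀ (by norm_num : (1 : ℤ) ≤ 2) (n := p)])]
      linarith
    have h := isFloat_of_abs_le (p := p) (emin := emin) hp hN (k := K - p) (by omega)
    convert h using 1
    push_cast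
    rw [sub_mul, one_mul, ← zpow_natCast, ← zpow_add₀ (by norm_num : (2 : ℚ) ≠ 0)]
    congr 2; ring
  have h1 : fl ((1 - unitRoundoff p) * (2 : ℚ) ^ K) = (2 : ℚ) ^ K - (2 : ℚ) ^ (K - p) := by
    rw [hval]; exact fl_eq_self hfl hF1
  refine ⟨h1, ?_⟩
  rw [h1, sub_sub_cancel, u_mul_two_zpow]
  exact fl_eq_self hfl (isFloat_two_zpow hp (by omega))

/-- **Lemma 3.6, (3.10)**: for `0 < x ∈ F`, `x ≥ ½eps⁻¹eta`, `x ≠ ufp(x)` (not a power of two):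
`fl((1 − eps)x) = pred(x) = x − 2eps·ufp(x)` and `fl(x − fl((1 − eps)x)) = 2eps·ufp(x)` (exact).
[cite: Rump2009, Lemma 3.6 eq. (3.10)] -/
theorem lemma36_not_pow (hp : 1 ≤ p) (hfl : IsRoundNearest p emin fl) {x : ℚ} (hx : IsFloat p emin x)
    (hU : (2 : ℚ) ^ (emin + p - 1) ≤ x) (hne : x ≠ ufp x) :
    fl ((1 - unitRoundoff p) * x) = x - 2 * unitRoundoff p * ufp x ∧
      fl (x - fl ((1 - unitRoundoff p) * x)) = 2 * unitRoundoff p * ufp x := by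
  have hx0 : 0 < x := lt_of_lt_of_le (two_zpow_pos _) hU
  have hu0 : 0 < unitRoundoff p := u_pos
  have hxabs : |x| = x := abs_of_pos hx0
  obtain ⟨k, hk⟩ := exists_ufp_eq_two_zpow hx0.ne'
  have hufp0 : 0 < ufp x := ufp_pos hx0.ne'
  have hufpx : ufp x ≤ x := by have := ufp_le_abs x; rwa [hxabs] at this
  have hx2 : x < 2 * ufp x := by have := abs_lt_two_mul_ufp hx0.ne'; rwa [hxabs] at this
  have hgt : ufp x < x := lt_of_le_of_ne hufpx (Ne.symm hne)
  -- strictly outside U (the boundary point is a power of two)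
  have hUlt : (2 : ℚ) ^ (emin + p - 1) < x := by
    rcases hU.lt_or_eq with h | h
    · exact h
    · exact absurd (by rw [← h, ufp_two_zpow]) hne
  have hk1 : emin + p - 1 ≤ k := by
    have h1 : (2 : ℚ) ^ (emin + p - 1) ≤ (2 : ℚ) ^ k := hk ▸ two_zpow_le_ufp (hxabs.symm ▸ hU)
    exact (zpow_le_zpow_iff_right₀ (by norm_num : (1 : ℚ) < 2)).mp h1
  set pr := x - 2 * unitRoundoff p * ufp x with hpr
  have hprF : IsFloat p emin pr := by
    have h := isFloat_add_two_u_ufp_of_not_mem_U hp hx (by rwa [hxabs]) (-1) (by norm_num)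
    convert h using 1; rw [hpr]; push_cast; ring
  -- the grid 2^(k-p+1) = 2eps·ufp(x) carries x, ufp x and every float ≥ ufp x
  have hstep : (2 : ℚ) ^ (k - p + 1) = 2 * unitRoundoff p * ufp x := by
    rw [hk, two_mul_u_mul_two_zpow]
  have hgridx : OnGrid ((2 : ℚ) ^ (k - p + 1)) x :=
    onGrid_of_isFloat_of_le_abs hx (by rw [hxabs, ← hk]; exact hufpx)
  have hgridu : OnGrid ((2 : ℚ) ^ (k - p + 1)) (ufp x) := by
    refine ⟨2 ^ (p - 1), ?_⟩
    push_cast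
    rw [two_pow_pred_mul_zpow hp, hk]; congr 1; ring
  -- pr ≥ ufp x
  have hpru : ufp x ≤ pr := by
    have h := two_zpow_le_abs_of_onGrid (hgridx.sub hgridu) (sub_ne_zero.mpr hgt.ne')
    rw [abs_of_pos (sub_pos.mpr hgt), hstep] at h
    rw [hpr]; linarith
  have hpr0 : 0 < pr := hufp0.trans_le hpru
  -- y := (1-eps)x satisfies pr < y < x and is closer to pr than to x
  set y := (1 - unitRoundoff p) * x with hy
  have hypr : pr < y := by rw [hpr, hy]; nlinarith
  have hyx : y < x := by rw [hy]; nlinarith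
  have hcloser : y - pr < x - y := by rw [hpr, hy]; nlinarith
  -- fl y = pr
  have hfy : fl y = pr := by
    have hfF : IsFloat p emin (fl y) := (hfl y).1
    have hnear : |y - fl y| ≤ |y - pr| := (hfl y).2 pr hprF
    rw [abs_of_pos (sub_pos.mpr hypr)] at hnear
    by_contra hne'
    rcases lt_or_gt_of_ne hne' with hlt | hgt'
    · -- fl y < pr < y: farther from y than pr
      rw [abs_of_pos (by linarith)] at hnear; linarith
    · -- fl y > pr: then fl y ≥ x (grid), and x is farther from y than pr
      have hfx : x ≤ fl y := by
        have hgridf : OnGrid ((2 : ℚ) ^ (k - p + 1)) (fl y) :=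
          onGrid_of_isFloat_of_le_abs hfF
            (by rw [← hk, abs_of_pos (hpr0.trans hgt')]; exact hpru.trans hgt'.le)
        have hgridpr : OnGrid ((2 : ℚ) ^ (k - p + 1)) pr := by
          have := hgridx.sub hgridu; rw [hpr, ← hstep]
          have e : x - 2 ^ (k - ↑p + 1) = (x - ufp x) - (2 ^ (k - ↑p + 1) - ufp x) := by ring
          rw [e]; refine this.sub (OnGrid.sub ⟨1, by simp⟩ hgridu)
        have h := two_zpow_le_abs_of_onGrid (hgridf.sub hgridpr) (sub_ne_zero.mpr hgt'.ne')
        rw [abs_of_pos (sub_pos.mpr hgt'), hstep] at h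
        rw [hpr] at h; linarith
      rw [abs_of_nonpos (by linarith)] at hnear; linarith
  refine ⟨hfy, ?_⟩
  rw [hfy, show x - pr = 2 * unitRoundoff p * ufp x by rw [hpr]; ring, ← hstep]
  exact fl_eq_self hfl (isFloat_two_zpow hp (by omega))

/-- The boundary case excluded from (3.9): at `x = ½eps⁻¹eta = 2^(emin+p−1)` (a power of two with
`x ≥ ½eps⁻¹eta`) Algorithm 3.5's last two operations do NOT return `eps·ufp(x) = eta/2 ∉ F`: the
result is a float, hence `≠ eta/2`. [cite: Rump2009, Lemma 3.6 eq. (3.9) (boundary case)] -/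
theorem lemma36_pow_boundary_counterexample (hfl : IsRoundNearest p emin fl) :
    fl ((2 : ℚ) ^ (emin + p - 1) - fl ((1 - unitRoundoff p) * (2 : ℚ) ^ (emin + p - 1))) ≠
      unitRoundoff p * (2 : ℚ) ^ (emin + p - 1) := by
  intro h
  have hF : IsFloat p emin (unitRoundoff p * (2 : ℚ) ^ (emin + p - 1)) := h ▸ (hfl _).1
  rw [u_mul_two_zpow] at hF
  have h1 := two_zpow_emin_le_abs hF (two_zpow_pos _).ne'
  rw [abs_of_pos (two_zpow_pos _)] at h1
  have h2 : (2 : ℚ) ^ (emin + ↑p - 1 - ↑p) < (2 : ℚ) ^ emin :=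
    zpow_lt_zpow_right₀ (by norm_num) (by omega)
  exact absurd h1 (not_le.mpr h2)

/-- **Lemma 3.7** for positive arguments: Algorithm 3.5 computes `ufp(x)` for `0 < x ∈ F`
(format: `eps ≤ ¼` and `eps⁻¹·eta ≤ 1`, i.e. `p ≥ 2`, `emin + p ≤ 0`, so that no overflow-free
scaling issue arises in this unbounded-exponent model and `p̄ = 2^(p−1)x ∉ U`).
[cite: Rump2009, Lemma 3.7] -/
theorem ufpFl_eq_ufp_of_pos (hp : 2 ≤ p) (hfl : IsRoundNearest p emin fl) {x : ℚ}
    (hx : IsFloat p emin x) (hx0 : 0 < x) : ufpFl fl p x = ufp x := by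
  have hp1 : 1 ≤ p := by omega
  have hu0 : 0 < unitRoundoff p := u_pos
  -- p̄ := 2^(p-1)·x ∈ F, p̄ ≥ ½eps⁻¹eta, ufp(p̄) = 2^(p-1) ufp(x), ϕx = (1+2eps)p̄
  set pb := (2 : ℚ) ^ (p - 1) * x with hpb
  have hpbF : IsFloat p emin pb := isFloat_two_pow_mul (p - 1) hx
  have hpb0 : 0 < pb := by positivity
  have hpbU : (2 : ℚ) ^ (emin + p - 1) ≤ pb := by
    have h1 := two_zpow_emin_le_abs hx hx0.ne'
    rw [abs_of_pos hx0] at h1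
    rw [hpb, ← two_pow_pred_mul_zpow hp1 emin]
    exact mul_le_mul_of_nonneg_left h1 (by positivity)
  have hufp_pb : ufp pb = (2 : ℚ) ^ (p - 1) * ufp x := ufp_two_pow_mul _ _
  have hphi : (2 ^ (p - 1) + 1 : ℚ) * x = (1 + 2 * unitRoundoff p) * pb := by
    have h := two_mul_u_mul_two_pow_pred hp1
    rw [hpb]; nlinarith [h]
  -- q := fl(ϕx): succ(p̄) ≤ q ≤ 2ufp(p̄)
  obtain ⟨h, hh⟩ := exists_isSucc hp1 hpbF
  obtain ⟨hq1, hq2⟩ := succ_le_fl_one_add_two_u_mul hp1 hfl hpbF hpbU hh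
  rw [← hphi] at hq1 hq2
  set q := fl ((2 ^ (p - 1) + 1 : ℚ) * x) with hq
  have hqF : IsFloat p emin q := (hfl _).1
  have hpbq : pb < q := hh.2.1.trans_le hq1
  have hqU : (2 : ℚ) ^ (emin + p - 1) ≤ q := hpbU.trans hpbq.le
  have hq0 : 0 < q := hpb0.trans hpbq
  obtain ⟨k, hk⟩ := exists_ufp_eq_two_zpow hpb0.ne'
  have hufp0 : 0 < ufp pb := ufp_pos hpb0.ne'
  have hkU : emin + p - 1 ≤ k := by
    have h1 : (2 : ℚ) ^ (emin + p - 1) ≤ (2 : ℚ) ^ k :=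
      hk ▸ two_zpow_le_ufp (by rw [abs_of_pos hpb0]; exact hpbU)
    exact (zpow_le_zpow_iff_right₀ (by norm_num : (1 : ℚ) < 2)).mp h1
  have hgoal : 2 * unitRoundoff p * ufp pb = ufp x := by
    rw [hufp_pb, ← mul_assoc, two_mul_u_mul_two_pow_pred hp1, one_mul]
  show |fl (q - fl ((1 - unitRoundoff p) * q))| = ufp x
  by_cases hpow : q = ufp q
  · -- q is a power of two: then q = 2ufp(p̄) = 2^(k+1) and (3.9) applies
    have hq2k : q = (2 : ℚ) ^ (k + 1) := by
      obtain ⟨kq, hkq⟩ := exists_ufp_eq_two_zpow hq0.ne'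
      have hle : (2 : ℚ) ^ kq ≤ (2 : ℚ) ^ (k + 1) := by
        rw [← hkq, ← hpow, zpow_add_one₀ (by norm_num : (2 : ℚ) ≠ 0), ← hk]; linarith
      have hlt : (2 : ℚ) ^ k < (2 : ℚ) ^ kq := by
        rw [← hkq, ← hpow, ← hk]
        exact lt_of_le_of_lt (by have := ufp_le_abs pb; rwa [abs_of_pos hpb0] at this) hpbq
      have h1 := (zpow_le_zpow_iff_right₀ (by norm_num : (1 : ℚ) < 2)).mp hle
      have h2 := (zpow_lt_zpow_iff_right₀ (by norm_num : (1 : ℚ) < 2)).mp hlt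
      rw [hpow, hkq]; congr 1; omega
    rw [hq2k, (lemma36_pow hp1 hfl (K := k + 1) (by omega)).2, abs_of_pos (mul_pos hu0 (two_zpow_pos _)),
      ← hgoal, hk, zpow_add_one₀ (by norm_num : (2 : ℚ) ≠ 0)]
    ring
  · -- q is not a power of two: (3.10) gives 2eps·ufp(q), and ufp(q) = ufp(p̄)
    have hne : q ≠ ufp q := hpow
    rw [(lemma36_not_pow hp1 hfl hqF hqU hne).2, abs_of_pos (by have := ufp_pos hq0.ne'; positivity)]
    have hufpq : ufp q = ufp pb := by
      rw [hk]
      refine ufp_eq_two_zpow_of_le_of_lt ?_ ?_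
      · rw [abs_of_pos hq0, ← hk]
        exact le_trans (by have := ufp_le_abs pb; rwa [abs_of_pos hpb0] at this) hpbq.le
      · rw [abs_of_pos hq0]
        refine lt_of_le_of_ne ?_ ?_
        · rw [zpow_add_one₀ (by norm_num : (2 : ℚ) ≠ 0), ← hk]; linarith
        · intro h2; exact hne (by rw [h2, ufp_two_zpow])
    rw [hufpq, hgoal]

/-- Algorithm 3.5 is odd-symmetric: running it on `−x` with the mirrored rounding `t ↦ −fl(−t)`
gives the same result. [cite: Rump2009, Lemma 3.7 (proof "for negative p̄")] -/
theorem ufpFl_neg_neg (fl : ℚ → ℚ) (p : ℕ) (x : ℚ) :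
    ufpFl (fun t => -fl (-t)) p (-x) = ufpFl fl p x := by
  simp only [ufpFl, mul_neg, neg_neg, neg_sub_neg, abs_neg, neg_sub]

/-- **Lemma 3.7**: for every `x ∈ F` the result `S` of Algorithm 3.5 is `ufp(x)` (rounding to
nearest, any tie; format `p ≥ 2`, `emin + p ≤ 0` — every IEEE 754 format).
[cite: Rump2009, Lemma 3.7] -/
theorem ufpFl_eq_ufp (hp : 2 ≤ p) (hfl : IsRoundNearest p emin fl) {x : ℚ}
    (hx : IsFloat p emin x) : ufpFl fl p x = ufp x := by
  rcases lt_trichotomy x 0 with hneg | hzero | hpos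
  · have h := ufpFl_eq_ufp_of_pos hp (IsRoundNearest.neg hfl) hx.neg (neg_pos.mpr hneg)
    rwa [ufpFl_neg_neg, ufp_neg] at h
  · subst hzero
    simp [ufpFl, fl_zero hfl, ufp_zero]
  · exact ufpFl_eq_ufp_of_pos hp hfl hx hpos

/-! ### Algorithm 4.2 (`ExtractVectorNew`) and Lemma 4.5 -/

/-- **Algorithm 4.2**, error-free vector transformation `[σₙ, p'] = ExtractVectorNew(σ₀, p)`:
`[σₖ, p'ₖ] = FastTwoSum(σₖ₋₁, pₖ)`, i.e. `σₖ = fl(σₖ₋₁ + pₖ)`, `p'ₖ = fl(pₖ − fl(σₖ − σₖ₋₁))`.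
Returns the pair `(σₙ, [p'₁, …, p'ₙ])`. [cite: Rump2009, Algorithm 4.2] -/
def extractVectorNew (fl : ℚ → ℚ) : ℚ → List ℚ → ℚ × List ℚ
  | σ, [] => (σ, [])
  | σ, x :: xs =>
      ((extractVectorNew fl (fl (σ + x)) xs).1,
        (fast2Sum fl σ x).2 :: (extractVectorNew fl (fl (σ + x)) xs).2)

/-- `ExtractVectorNew` on the empty vector. [cite: Rump2009, Algorithm 4.2] -/
@[simp] theorem extractVectorNew_nil (fl : ℚ → ℚ) (σ : ℚ) : extractVectorNew fl σ [] = (σ, []) := rfl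

/-- One loop iteration of `ExtractVectorNew`. [cite: Rump2009, Algorithm 4.2] -/
theorem extractVectorNew_cons (fl : ℚ → ℚ) (σ x : ℚ) (xs : List ℚ) :
    extractVectorNew fl σ (x :: xs) =
      ((extractVectorNew fl (fl (σ + x)) xs).1,
        (fast2Sum fl σ x).2 :: (extractVectorNew fl (fl (σ + x)) xs).2) := rfl

/-- The returned `σₙ` is the floating-point accumulation `fl(σ₀ + Σ pᵢ)` from the left.
[cite: Rump2009, Algorithm 4.2 and eq. (4.10)] -/
theorem extractVectorNew_fst (fl : ℚ → ℚ) : ∀ (σ : ℚ) (xs : List ℚ),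
    (extractVectorNew fl σ xs).1 = flAcc fl σ xs
  | _, [] => rfl
  | σ, x :: xs => by rw [extractVectorNew_cons, flAcc_cons]; exact extractVectorNew_fst fl _ xs

/-- `ExtractVectorNew` returns a vector of the same length. [cite: Rump2009, Algorithm 4.2] -/
theorem length_extractVectorNew_snd (fl : ℚ → ℚ) : ∀ (σ : ℚ) (xs : List ℚ),
    (extractVectorNew fl σ xs).2.length = xs.length
  | _, [] => rfl
  | σ, x :: xs => by
      rw [extractVectorNew_cons, List.length_cons, List.length_cons, length_extractVectorNew_snd fl _ xs]

/-- The entries `p'ₖ` returned by `ExtractVectorNew` are floating-point numbers.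
[cite: Rump2009, Algorithm 4.2] -/
theorem isFloat_of_mem_extractVectorNew_snd (hfl : IsRoundNearest p emin fl) : ∀ (σ : ℚ) (xs : List ℚ),
    ∀ y ∈ (extractVectorNew fl σ xs).2, IsFloat p emin y
  | _, [], y, hy => by simp at hy
  | σ, x :: xs, y, hy => by
      rw [extractVectorNew_cons] at hy
      rcases List.mem_cons.mp hy with rfl | hy
      · exact (hfl _).1
      · exact isFloat_of_mem_extractVectorNew_snd hfl _ xs y hy

/-- `Σ|yᵢ| ≤ n·c` when every `|yᵢ| ≤ c`. [cite: Rump2009, proof of Lemma 4.5 (summing (4.4), (4.13))] -/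
theorem sum_map_abs_le_length_mul {c : ℚ} : ∀ {l : List ℚ}, (∀ y ∈ l, |y| ≤ c) →
    (l.map abs).sum ≤ (l.length : ℚ) * c
  | [], _ => by simp
  | y :: l, h => by
      rw [List.map_cons, List.sum_cons, List.length_cons]
      have h1 := h y (by simp)
      have h2 := sum_map_abs_le_length_mul (l := l) (fun z hz => h z (by simp [hz]))
      push_cast; linarith

/-- Two points of the grid `2ᵉℤ` less than `2ᵉ` apart in the right order are ordered:
`a, b ∈ 2ᵉℤ`, `a < b + 2ᵉ ⟹ a ≤ b`. [cite: Rump2009, §2 ("F ⊆ etaℤ", eq. (2.11))] -/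
theorem le_of_onGrid_of_lt_add {e : ℤ} {a b : ℚ} (ha : OnGrid ((2 : ℚ) ^ e) a)
    (hb : OnGrid ((2 : ℚ) ^ e) b) (h : a < b + (2 : ℚ) ^ e) : a ≤ b := by
  by_contra hab
  have hab : b < a := lt_of_not_ge hab
  have := two_zpow_le_abs_of_onGrid (ha.sub hb) (sub_ne_zero.mpr hab.ne')
  rw [abs_of_pos (sub_pos.mpr hab)] at this
  linarith

/-- The core of the proof of Lemma 4.5, as an invariant of the loop of Algorithm 4.2 started at
`σ = σₖ = flAcc σ₀ (p₁ … pₖ)`: if every partial sum satisfies `|σₖ − (σ₀ + Σᵢ≤ₖ pᵢ)| ≤ D` ((4.10))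
with `T + D ≤ σ₀/2` ((4.11)/(4.12)), then `|pₖ| ≤ σₖ₋₁` ((4.3)), so every FastTwoSum is error-free
(Lemma 3.4), whence `Σᵢ>ₖ pᵢ = σₙ − σₖ + Σᵢ>ₖ p'ᵢ` ((4.5)) and `|p'ᵢ| ≤ eps·ufp(σᵢ)` ((2.19)).
[cite: Rump2009, proof of Lemma 4.5 (pp. 3479–3480)] -/
theorem lemma45_core (hp : 1 ≤ p) (hfl : IsRoundNearest p emin fl) {σ0 T D : ℚ}
    (hσ0F : IsFloat p emin σ0) {xs : List ℚ} (hxs : ∀ x ∈ xs, IsFloat p emin x)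
    (hT : (xs.map abs).sum ≤ T)
    (hD : ∀ pre, pre <+: xs → |flAcc fl σ0 pre - (σ0 + pre.sum)| ≤ D) (hD1 : T + D ≤ σ0 / 2) :
    ∀ (ys pre : List ℚ), pre ++ ys = xs →
      (ys.sum = (extractVectorNew fl (flAcc fl σ0 pre) ys).1 - flAcc fl σ0 pre
          + ((extractVectorNew fl (flAcc fl σ0 pre) ys).2).sum ∧
        ∀ y ∈ (extractVectorNew fl (flAcc fl σ0 pre) ys).2,
          ∃ pre', pre' <+: xs ∧ |y| ≤ unitRoundoff p * ufp (flAcc fl σ0 pre'))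
  | [], pre, _ => by simp
  | y :: ys, pre, happ => by
      have hD0 : 0 ≤ D := le_trans (abs_nonneg _) (hD [] List.nil_prefix)
      set σ := flAcc fl σ0 pre with hσdef
      have hσF : IsFloat p emin σ := isFloat_flAcc hfl hσ0F pre
      have hyx : y ∈ xs := by rw [← happ]; simp
      have hyF : IsFloat p emin y := hxs y hyx
      have happ' : (pre ++ [y]) ++ ys = xs := by rw [List.append_assoc]; exact happ
      have hσ' : flAcc fl σ0 (pre ++ [y]) = fl (σ + y) := flAcc_append_singleton fl σ0 pre y
      obtain ⟨ih1, ih2⟩ := lemma45_core hp hfl hσ0F hxs hT hD hD1 ys (pre ++ [y]) happ'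
      rw [hσ'] at ih1 ih2
      rw [extractVectorNew_cons]
      -- (4.3): |y| ≤ σ
      have hpreD := hD pre ⟨y :: ys, happ⟩
      have hsplit : (xs.map abs).sum = (pre.map abs).sum + (|y| + (ys.map abs).sum) := by
        rw [← happ]; simp [List.map_append, List.sum_append]
      have hpresum : |pre.sum| ≤ (pre.map abs).sum := abs_list_sum_le pre
      have hys0 : 0 ≤ (ys.map abs).sum := sum_map_abs_nonneg ys
      have hyσ : |y| ≤ σ := by
        have h1 := (abs_sub_le_iff.mp hpreD).2
        rw [← hσdef] at h1
        have h2 := (abs_le.mp hpresum).1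
        linarith [abs_nonneg pre.sum, abs_nonneg y]
      by_cases hy0 : y = 0
      · subst hy0
        have hσσ : fl (σ + 0) = σ := by rw [add_zero]; exact fl_eq_self hfl hσF
        have hp0 : (fast2Sum fl σ 0).2 = 0 := by
          show fl (0 - fl (fl (σ + 0) - σ)) = 0
          rw [hσσ, sub_self, fl_zero hfl, sub_zero, fl_zero hfl]
        rw [hp0]
        rw [hσσ] at ih1 ih2 ⊢
        refine ⟨by rw [List.sum_cons, List.sum_cons, ih1]; ring, ?_⟩
        intro z hz
        rcases List.mem_cons.mp hz with rfl | hz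
        · exact ⟨pre, ⟨0 :: ys, happ⟩, by
            rw [abs_zero]; exact mul_nonneg u_pos.le (ufp_nonneg _)⟩
        · exact ih2 z hz
      · have hab : OnGrid (2 * unitRoundoff p * ufp y) σ :=
          onGrid_two_u_ufp_of_abs_le hσF hy0 (hyσ.trans (le_abs_self σ))
        obtain ⟨h1, h2, -, h4, h5⟩ := fastTwoSum_eft hp hfl hσF hyF hab
        refine ⟨by rw [List.sum_cons, List.sum_cons, h2, h1, ih1]; ring, ?_⟩
        intro z hz
        rcases List.mem_cons.mp hz with rfl | hz
        · exact ⟨pre ++ [y], ⟨ys, happ'⟩, by rw [hσ']; exact h4.trans h5⟩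
        · exact ih2 z hz

/-- `σ₀ = fl(2T/(1 − (3n+1)eps))` of Lemma 4.5 / Algorithm 4.6, the constants `(3n+1)·eps` and
`1 − (3n+1)·eps` being evaluated (exactly, see `lemma45_setup`) in floating-point.
[cite: Rump2009, Lemma 4.5 and Algorithm 4.6] -/
def sigmaZero (fl : ℚ → ℚ) (p n : ℕ) (T : ℚ) : ℚ :=
  fl (fl (2 * T) / fl (1 - fl ((3 * (n : ℚ) + 1) * unitRoundoff p)))

/-- The sum of absolute values of a prefix is at most that of the whole vector.
[cite: Rump2009, proof of Lemma 4.5 (eq. (4.10), Σᵢ≤ₖ|pᵢ| ≤ T)] -/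
theorem sum_map_abs_prefix_le {pre xs : List ℚ} (h : pre <+: xs) :
    (pre.map abs).sum ≤ (xs.map abs).sum := by
  obtain ⟨t, rfl⟩ := h
  rw [List.map_append, List.sum_append]
  linarith [sum_map_abs_nonneg t]

/-- **Lemma 4.5, set-up** ((4.10)–(4.12)): for `pᵢ, T ∈ F`, `Σ|pᵢ| ≤ T`, `(4n+2)eps ≤ 1`, the
quantity `σ₀ = fl(2T/(1 − (3n+1)eps))` is a float with `σ₀ ≥ 2T`, and there is a uniform bound `D`
on the accumulation errors `|σₖ − (σ₀ + Σᵢ≤ₖ pᵢ)|` with `T + D ≤ σ₀/2` — strictly if `σ₀ ∉ U`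
(`D = 0` if `σ₀ ∈ U` by (3.2), `D = n·eps·(σ₀ + T)` otherwise by (2.6)). Format: `p ≥ 2`, `emin + p ≤ 0`.
[cite: Rump2009, proof of Lemma 4.5, eqs. (4.10)–(4.12)] -/
theorem lemma45_setup (hp : 2 ≤ p) (he : emin + p ≤ 0) (hfl : IsRoundNearest p emin fl)
    {xs : List ℚ} (hxs : ∀ x ∈ xs, IsFloat p emin x) {T : ℚ} (hTF : IsFloat p emin T)
    (hT : (xs.map abs).sum ≤ T) (hn : 4 * xs.length + 2 ≤ 2 ^ p) :
    IsFloat p emin (sigmaZero fl p xs.length T) ∧ 0 ≤ T ∧ 2 * T ≤ sigmaZero fl p xs.length T ∧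
      ∃ D : ℚ, (∀ pre, pre <+: xs →
          |flAcc fl (sigmaZero fl p xs.length T) pre - (sigmaZero fl p xs.length T + pre.sum)| ≤ D) ∧
        T + D ≤ sigmaZero fl p xs.length T / 2 ∧
        ((2 : ℚ) ^ (emin + p - 1) < sigmaZero fl p xs.length T →
          T + D < sigmaZero fl p xs.length T / 2) := by
  have hp1 : 1 ≤ p := by omega
  set n := xs.length with hn_def
  set u := unitRoundoff p with hu
  have hu0 : 0 < u := u_pos
  have hT0 : 0 ≤ T := (sum_map_abs_nonneg xs).trans hT
  have hn0 : (0 : ℚ) ≤ n := Nat.cast_nonneg n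
  -- the constants are exact
  have h3n : 3 * n + 1 ≤ 2 ^ p := by omega
  have hcF : IsFloat p emin ((3 * (n : ℚ) + 1) * u) := by
    have := isFloat_natCast_mul_u (p := p) (emin := emin) hp1 (K := 3 * n + 1) h3n he
    push_cast at this; exact this
  have hc3F : IsFloat p emin (1 - (3 * (n : ℚ) + 1) * u) := by
    have := isFloat_one_sub_natCast_mul_u (p := p) (emin := emin) hp1 (K := 3 * n + 1) h3n he
    push_cast at this; exact this
  have hc3lt : (3 * (n : ℚ) + 1) * u < 1 := by
    have := natCast_mul_u_lt_one (p := p) (K := 3 * n + 1) (by omega)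
    push_cast at this; exact this
  have hc3pos : 0 < 1 - (3 * (n : ℚ) + 1) * u := by linarith
  have hc3le : 1 - (3 * (n : ℚ) + 1) * u ≤ 1 := by nlinarith
  have h2TF : IsFloat p emin (2 * T) := isFloat_two_mul hTF
  have hσ0eq : sigmaZero fl p n T = fl (2 * T / (1 - (3 * (n : ℚ) + 1) * u)) := by
    rw [sigmaZero, fl_eq_self hfl hcF, fl_eq_self hfl hc3F, fl_eq_self hfl h2TF]
  rw [hσ0eq]
  set σ0 := fl (2 * T / (1 - (3 * (n : ℚ) + 1) * u)) with hσ0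
  have hσ0F : IsFloat p emin σ0 := (hfl _).1
  have h2T : 2 * T ≤ σ0 := le_fl_of_le hfl h2TF (by rw [le_div_iff₀ hc3pos]; nlinarith)
  have hσ00 : 0 ≤ σ0 := by linarith
  refine ⟨hσ0F, hT0, h2T, ?_⟩
  rcases le_or_gt σ0 ((2 : ℚ) ^ (emin + p - 1)) with hU | hN
  · -- σ₀ ∈ U: everything is exact, D = 0
    refine ⟨0, ?_, by linarith, fun h => absurd hU (not_le.mpr h)⟩
    intro pre hpre
    have hpreF : ∀ x ∈ pre, IsFloat p emin x := fun x hx => hxs x (hpre.subset hx)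
    have hS := sum_map_abs_prefix_le hpre
    have h22 : (2 : ℚ) ^ (emin + p) = 2 * (2 : ℚ) ^ (emin + p - 1) := by
      rw [show emin + p = (emin + p - 1) + 1 by ring, zpow_add_one₀ (by norm_num : (2 : ℚ) ≠ 0)]
      ring
    have hex := flAcc_eq_of_sum_abs_le hp1 hfl hσ0F hpreF
      (by rw [abs_of_nonneg hσ00, h22]; linarith)
    rw [hex, sub_self, abs_zero]
  · -- σ₀ ∉ U: D = n·eps·(σ₀ + T) by (2.6), and 2T ≤ (1+eps)(1−(3n+1)eps)σ₀ < (1 − 3n·eps)σ₀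
    have hσ0pos : 0 < σ0 := lt_trans (two_zpow_pos _) hN
    have hr : (2 : ℚ) ^ (emin + p - 1) < |2 * T / (1 - (3 * (n : ℚ) + 1) * u)| :=
      threshold_lt_abs_of_lt_abs_fl hp1 hfl (lt_of_lt_of_le hN (le_abs_self _))
    have h28 := abs_fl_sub_le_u_abs_fl hp1 hfl hr.le
    rw [← hσ0, abs_of_pos hσ0pos] at h28
    have h1 : 2 * T / (1 - (3 * (n : ℚ) + 1) * u) ≤ (1 + u) * σ0 := by
      have := (abs_sub_le_iff.mp h28).2; linarith
    have h2 : 2 * T ≤ (1 + u) * (1 - (3 * (n : ℚ) + 1) * u) * σ0 := by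
      rw [div_le_iff₀ hc3pos] at h1; nlinarith
    refine ⟨(n : ℚ) * u * (σ0 + T), ?_, ?_, fun _ => ?_⟩
    · intro pre hpre
      have hpreF : ∀ x ∈ pre, IsFloat p emin x := fun x hx => hxs x (hpre.subset hx)
      have hS := sum_map_abs_prefix_le hpre
      have hlen : (pre.length : ℚ) ≤ n := by
        have := hpre.length_le; exact_mod_cast this
      have h := abs_flAcc_sub_le hp hfl hσ0F hpreF
      rw [abs_of_nonneg hσ00] at h
      refine h.trans ?_
      exact mul_le_mul (mul_le_mul_of_nonneg_right hlen hu0.le) (by linarith)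
        (by linarith [sum_map_abs_nonneg pre]) (mul_nonneg hn0 hu0.le)
    · have hB : (n : ℚ) * u * (2 * T) ≤ (n : ℚ) * u * σ0 :=
        mul_le_mul_of_nonneg_left h2T (mul_nonneg hn0 hu0.le)
      have hC : 0 < u * u * σ0 := mul_pos (mul_pos hu0 hu0) hσ0pos
      have hD' : 0 ≤ (n : ℚ) * (u * u * σ0) := mul_nonneg hn0 hC.le
      nlinarith
    · have hB : (n : ℚ) * u * (2 * T) ≤ (n : ℚ) * u * σ0 :=
        mul_le_mul_of_nonneg_left h2T (mul_nonneg hn0 hu0.le)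
      have hC : 0 < u * u * σ0 := mul_pos (mul_pos hu0 hu0) hσ0pos
      have hD' : 0 ≤ (n : ℚ) * (u * u * σ0) := mul_nonneg hn0 hC.le
      nlinarith

/-- **Lemma 4.5, (4.5)** (with the shape of the output): `Σ pᵢ = σₙ − σ₀ + Σ p'ᵢ`, where
`σₙ = fl(σ₀ + Σ pᵢ)` accumulated from the left and the `p'ᵢ` are `n` floating-point numbers.
[cite: Rump2009, Lemma 4.5 eq. (4.5)] -/
theorem lemma45_sum (hp : 2 ≤ p) (he : emin + p ≤ 0) (hfl : IsRoundNearest p emin fl)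
    {xs : List ℚ} (hxs : ∀ x ∈ xs, IsFloat p emin x) {T : ℚ} (hTF : IsFloat p emin T)
    (hT : (xs.map abs).sum ≤ T) (hn : 4 * xs.length + 2 ≤ 2 ^ p)
    {σ0 : ℚ} (hσ0 : σ0 = sigmaZero fl p xs.length T) :
    (extractVectorNew fl σ0 xs).1 = flAcc fl σ0 xs ∧
      (extractVectorNew fl σ0 xs).2.length = xs.length ∧
      (∀ y ∈ (extractVectorNew fl σ0 xs).2, IsFloat p emin y) ∧
      xs.sum = (extractVectorNew fl σ0 xs).1 - σ0 + ((extractVectorNew fl σ0 xs).2).sum := by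
  obtain ⟨hσ0F, -, -, D, hD, hD1, -⟩ := lemma45_setup hp he hfl hxs hTF hT hn
  rw [← hσ0] at hσ0F hD hD1
  refine ⟨extractVectorNew_fst fl σ0 xs, length_extractVectorNew_snd fl σ0 xs,
    isFloat_of_mem_extractVectorNew_snd hfl σ0 xs, ?_⟩
  exact (lemma45_core (by omega) hfl hσ0F hxs hT hD hD1 xs [] rfl).1

/-- **Lemma 4.5, (4.3)** (the FastTwoSum inputs are sorted): `|pₖ| ≤ σₖ₋₁` for `1 ≤ k ≤ n`.
[cite: Rump2009, Lemma 4.5 eq. (4.3)] -/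
theorem lemma45_sorted (hp : 2 ≤ p) (he : emin + p ≤ 0) (hfl : IsRoundNearest p emin fl)
    {xs : List ℚ} (hxs : ∀ x ∈ xs, IsFloat p emin x) {T : ℚ} (hTF : IsFloat p emin T)
    (hT : (xs.map abs).sum ≤ T) (hn : 4 * xs.length + 2 ≤ 2 ^ p)
    {σ0 : ℚ} (hσ0 : σ0 = sigmaZero fl p xs.length T)
    {pre ys : List ℚ} {y : ℚ} (happ : pre ++ y :: ys = xs) : |y| ≤ flAcc fl σ0 pre := by
  obtain ⟨-, -, -, D, hD, hD1, -⟩ := lemma45_setup hp he hfl hxs hTF hT hn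
  rw [← hσ0] at hD hD1
  have hpreD := hD pre ⟨y :: ys, happ⟩
  have hsplit : (xs.map abs).sum = (pre.map abs).sum + (|y| + (ys.map abs).sum) := by
    rw [← happ]; simp [List.map_append, List.sum_append]
  have hpresum : |pre.sum| ≤ (pre.map abs).sum := abs_list_sum_le pre
  have hys0 : 0 ≤ (ys.map abs).sum := sum_map_abs_nonneg ys
  have hD0 : 0 ≤ D := le_trans (abs_nonneg _) (hD [] List.nil_prefix)
  have h1 := (abs_sub_le_iff.mp hpreD).2
  have h2 := (abs_le.mp hpresum).1
  linarith [abs_nonneg pre.sum, abs_nonneg y]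

/-- **Lemma 4.5, (4.6)–(4.7)**: `σ₀ ∈ F`, `σ₀ ≥ 2T`, and for every `0 ≤ k ≤ n`: `σₖ ∈ F`,
`|σₖ − σ₀| ≤ ½σ₀`, `σₖ − σ₀ ∈ F` (Sterbenz), `fl(σₖ − σ₀) = σₖ − σ₀`; and if `σ₀ ∉ U` then
`|σₖ − σ₀| ≤ ½(1 − eps)σ₀ < ½σ₀` as printed. NOTE. The strict / `(1 − eps)` form of (4.6) can fail
for `σ₀ ∈ U` (deep gradual underflow, e.g. `n = 2`, `p = (eta, 0)`, `T = eta`, `σ₀ = 2eta`,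
`σ₁ = 3eta`: `|σ₁ − σ₀| = ½σ₀`); the paper uses it only when `σ₀ ∉ U` ((4.9), Lemma 4.10).
[cite: Rump2009, Lemma 4.5 eqs. (4.6)–(4.7)] -/
theorem lemma45_sigma (hp : 2 ≤ p) (he : emin + p ≤ 0) (hfl : IsRoundNearest p emin fl)
    {xs : List ℚ} (hxs : ∀ x ∈ xs, IsFloat p emin x) {T : ℚ} (hTF : IsFloat p emin T)
    (hT : (xs.map abs).sum ≤ T) (hn : 4 * xs.length + 2 ≤ 2 ^ p)
    {σ0 : ℚ} (hσ0 : σ0 = sigmaZero fl p xs.length T) :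
    IsFloat p emin σ0 ∧ 2 * T ≤ σ0 ∧ ∀ pre, pre <+: xs →
      IsFloat p emin (flAcc fl σ0 pre) ∧ |flAcc fl σ0 pre - σ0| ≤ σ0 / 2 ∧
        IsFloat p emin (flAcc fl σ0 pre - σ0) ∧ fl (flAcc fl σ0 pre - σ0) = flAcc fl σ0 pre - σ0 ∧
        ((2 : ℚ) ^ (emin + p - 1) < σ0 →
          |flAcc fl σ0 pre - σ0| < σ0 / 2 ∧ |flAcc fl σ0 pre - σ0| ≤ (1 - unitRoundoff p) / 2 * σ0) := by
  have hp1 : 1 ≤ p := by omega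
  obtain ⟨hσ0F, hT0, h2T, D, hD, hD1, hD2⟩ := lemma45_setup hp he hfl hxs hTF hT hn
  rw [← hσ0] at hσ0F h2T hD hD1 hD2
  refine ⟨hσ0F, h2T, fun pre hpre => ?_⟩
  have hσ00 : 0 ≤ σ0 := by linarith
  have hσF : IsFloat p emin (flAcc fl σ0 pre) := isFloat_flAcc hfl hσ0F pre
  set σ := flAcc fl σ0 pre with hσ
  have hpreD := hD pre hpre
  have hS := (abs_list_sum_le pre).trans (sum_map_abs_prefix_le hpre)
  have hdist : |σ - σ0| ≤ T + D := by
    rw [abs_le] at hpreD hS ⊢; constructor <;> linarith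
  have h46 : |σ - σ0| ≤ σ0 / 2 := hdist.trans hD1
  have hgF : IsFloat p emin (σ - σ0) := by
    rw [abs_le] at h46
    exact sterbenz hσF hσ0F (by linarith) (by linarith)
  refine ⟨hσF, h46, hgF, fl_eq_self hfl hgF, fun hNU => ?_⟩
  have hlt : |σ - σ0| < σ0 / 2 := lt_of_le_of_lt hdist (hD2 hNU)
  refine ⟨hlt, ?_⟩
  -- 2(σ − σ₀) ∈ F has modulus < σ₀ ∈ F, so it is at most pred(σ₀) ≤ (1 − eps)σ₀ in modulus
  have h2gF : IsFloat p emin (2 * (σ - σ0)) := isFloat_two_mul hgF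
  have hσ0pos : 0 < σ0 := lt_trans (two_zpow_pos _) hNU
  rw [abs_lt] at hlt
  have ha := u_mul_abs_le_abs_sub hp1 hσ0F h2gF (by linarith)
  have hb := u_mul_abs_le_abs_sub hp1 hσ0F h2gF.neg (by linarith)
  rw [abs_of_pos hσ0pos, abs_of_nonpos (by linarith)] at ha
  rw [abs_of_pos hσ0pos, abs_of_nonpos (by linarith)] at hb
  rw [abs_le]; constructor <;> linarith

/-- **Lemma 4.5, (4.4)** and the bounds (4.13) on the extracted parts: every `p'ᵢ ∈ F` with
`|p'ᵢ| ≤ 2eps·ufp(σ₀)`, `|p'ᵢ| ≤ eps·(3/2)σ₀`, and, if `σ₀ ∉ U`, `|p'ᵢ| < eps(σ₀ + ½(1−eps)σ₀)`.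
[cite: Rump2009, Lemma 4.5 eq. (4.4) and proof eq. (4.13)] -/
theorem lemma45_parts (hp : 2 ≤ p) (he : emin + p ≤ 0) (hfl : IsRoundNearest p emin fl)
    {xs : List ℚ} (hxs : ∀ x ∈ xs, IsFloat p emin x) {T : ℚ} (hTF : IsFloat p emin T)
    (hT : (xs.map abs).sum ≤ T) (hn : 4 * xs.length + 2 ≤ 2 ^ p)
    {σ0 : ℚ} (hσ0 : σ0 = sigmaZero fl p xs.length T) :
    ∀ y ∈ (extractVectorNew fl σ0 xs).2, IsFloat p emin y ∧
      |y| ≤ 2 * unitRoundoff p * ufp σ0 ∧ |y| ≤ unitRoundoff p * (3 / 2 * σ0) ∧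
      ((2 : ℚ) ^ (emin + p - 1) < σ0 → |y| ≤ unitRoundoff p * ((3 - unitRoundoff p) / 2 * σ0)) := by
  have hp1 : 1 ≤ p := by omega
  have hu0 : 0 < unitRoundoff p := u_pos
  obtain ⟨hσ0F, hT0, h2T, D, hD, hD1, -⟩ := lemma45_setup hp he hfl hxs hTF hT hn
  rw [← hσ0] at hσ0F h2T hD hD1
  obtain ⟨-, -, hsig⟩ := lemma45_sigma hp he hfl hxs hTF hT hn hσ0
  have hσ00 : 0 ≤ σ0 := by linarith
  intro y hy
  obtain ⟨pre, hpre, hyb⟩ := (lemma45_core hp1 hfl hσ0F hxs hT hD hD1 xs [] rfl).2 y hy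
  obtain ⟨hσF, h46, -, -, href⟩ := hsig pre hpre
  set σ := flAcc fl σ0 pre with hσ
  have hσ0' : 0 ≤ σ := by rw [abs_le] at h46; linarith
  have hufpσ : ufp σ ≤ σ := by have := ufp_le_abs σ; rwa [abs_of_nonneg hσ0'] at this
  have hufp2 : ufp σ ≤ 2 * ufp σ0 := by
    rw [← ufp_two_mul]
    refine ufp_mono ?_
    rw [abs_of_nonneg hσ0', abs_of_nonneg (by linarith)]
    rw [abs_le] at h46; linarith
  refine ⟨isFloat_of_mem_extractVectorNew_snd hfl σ0 xs y hy, ?_, ?_, fun hNU => ?_⟩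
  · calc |y| ≤ unitRoundoff p * ufp σ := hyb
      _ ≤ unitRoundoff p * (2 * ufp σ0) := mul_le_mul_of_nonneg_left hufp2 hu0.le
      _ = 2 * unitRoundoff p * ufp σ0 := by ring
  · refine hyb.trans (mul_le_mul_of_nonneg_left (hufpσ.trans ?_) hu0.le)
    rw [abs_le] at h46; linarith
  · refine hyb.trans (mul_le_mul_of_nonneg_left (hufpσ.trans ?_) hu0.le)
    have := (abs_le.mp (href hNU).2).2; linarith

/-- `T' := min(M̃₁, M̃₂)` of Lemma 4.5 / Algorithm 4.6 with `M̃₁ = fl(fl(fl(3/2 + 4eps)·fl(n·eps))·σ₀)`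
and `M̃₂ = fl(fl(2n·eps)·S)` where `S` is the result of Algorithm 3.5 at `σ₀` (`= ufp(σ₀)`).
[cite: Rump2009, Lemma 4.5 (definition of T') and Algorithm 4.6] -/
def tBound (fl : ℚ → ℚ) (p n : ℕ) (σ0 : ℚ) : ℚ :=
  min (fl (fl (fl (3 / 2 + 4 * unitRoundoff p) * fl ((n : ℚ) * unitRoundoff p)) * σ0))
    (fl (fl (2 * (n : ℚ) * unitRoundoff p) * ufpFl fl p σ0))

/-- If `fl(r) ≤ ¼eps⁻¹eta` for some `r ≥ 0` then `r ≤ ½eps⁻¹eta` (`p ≥ 2`).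
[cite: Rump2009, proof of Lemma 4.5, (4.8) (from 4T' ≤ eps⁻¹eta to Σ|p'ᵢ| ≤ ½eps⁻¹eta)] -/
theorem le_threshold_of_fl_le (hp : 2 ≤ p) (hfl : IsRoundNearest p emin fl) {r : ℚ} (hr0 : 0 ≤ r)
    (h : fl r ≤ (2 : ℚ) ^ (emin + p - 2)) : r ≤ (2 : ℚ) ^ (emin + p - 1) := by
  have hp1 : 1 ≤ p := by omega
  have hu0 : 0 < unitRoundoff p := u_pos
  have hu1 : unitRoundoff p ≤ 1 / 2 := by
    rw [unitRoundoff]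
    have : (2 : ℚ) ≤ 2 ^ p := by
      calc (2 : ℚ) = 2 ^ 1 := by norm_num
        _ ≤ 2 ^ p := pow_le_pow_right₀ (by norm_num) hp1
    exact one_div_le_one_div_of_le (by norm_num) this
  have herr := abs_fl_sub_le hp1 hfl r
  rw [abs_of_nonneg hr0] at herr
  have h1 : r - fl r ≤ unitRoundoff p * r + (2 : ℚ) ^ emin / 2 := by
    have := (abs_sub_le_iff.mp herr).2; linarith
  have hA : (2 : ℚ) ^ (emin + p - 1) = 2 * (2 : ℚ) ^ (emin + p - 2) := by
    rw [show emin + p - 1 = (emin + p - 2) + 1 by ring, zpow_add_one₀ (by norm_num : (2 : ℚ) ≠ 0)]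
    ring
  have hE : (2 : ℚ) ^ emin ≤ (2 : ℚ) ^ (emin + p - 2) := zpow_le_zpow_right₀ (by norm_num) (by omega)
  have huA : unitRoundoff p * (2 : ℚ) ^ (emin + p - 1) = (2 : ℚ) ^ emin / 2 := by
    rw [u_mul_two_zpow, show emin + p - 1 - p = emin - 1 by ring, zpow_sub_one₀ (by norm_num : (2:ℚ) ≠ 0)]
    ring
  -- (1 − eps)·r ≤ A + E/2 ≤ (1 − eps)·2A
  have h2 : (1 - unitRoundoff p) * r ≤ (1 - unitRoundoff p) * (2 : ℚ) ^ (emin + p - 1) := by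
    rw [sub_mul, sub_mul, one_mul, one_mul, huA]; linarith
  exact le_of_mul_le_mul_left h2 (by linarith)

/-- Constant bookkeeping for (4.14): `eps(3−eps)/2 ≤ (1−eps)²(3/2+4eps)eps` (`eps ≤ 1/8`).
[cite: Rump2009, proof of Lemma 4.5 eq. (4.14)] -/
theorem poly414a {u : ℚ} (hu0 : 0 < u) (hu8 : u ≤ 1 / 8) :
    u * ((3 - u) / 2) ≤ (1 - u) * ((1 - u) * ((3 / 2 + 4 * u) * u)) := by
  have hq : 0 ≤ 3 / 2 - 13 / 2 * u + 4 * u ^ 2 := by nlinarith [sq_nonneg u]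
  nlinarith [mul_nonneg (mul_pos hu0 hu0).le hq]

/-- Constant bookkeeping for (4.14)/(4.15): `eps(3−eps)/2 ≤ (1−eps)(3/2+4eps)eps` (`eps ≤ 3/4`).
[cite: Rump2009, proof of Lemma 4.5 eqs. (4.14)–(4.15)] -/
theorem poly414b {u : ℚ} (hu0 : 0 < u) (hu8 : u ≤ 1 / 8) :
    u * ((3 - u) / 2) ≤ (1 - u) * ((3 / 2 + 4 * u) * u) := by
  nlinarith [mul_nonneg (mul_pos hu0 hu0).le (show 0 ≤ 3 - 4 * u by linarith)]

/-- Constant bookkeeping for (4.14): `(3/2)(1−eps)eps ≤ (1−eps)²(3/2+4eps)eps` (`eps ≤ 5/8`).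
[cite: Rump2009, proof of Lemma 4.5 eq. (4.14)] -/
theorem poly414c {u : ℚ} (hu0 : 0 < u) (hu8 : u ≤ 1 / 8) :
    3 / 2 * (1 - u) * u ≤ (1 - u) * ((1 - u) * ((3 / 2 + 4 * u) * u)) := by
  nlinarith [mul_nonneg (mul_nonneg (mul_pos hu0 hu0).le (show 0 ≤ 1 - u by linarith))
    (show 0 ≤ 5 / 2 - 4 * u by linarith)]

/-- Constant bookkeeping for (4.17): `(3/2)(1−eps)eps(1+2eps) ≤ (1−eps)(3/2+4eps)eps`.
[cite: Rump2009, proof of Lemma 4.5 eq. (4.17)] -/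
theorem poly417 {u : ℚ} (hu0 : 0 < u) (hu1 : u ≤ 1) :
    3 / 2 * (1 - u) * u * (1 + 2 * u) ≤ (1 - u) * ((3 / 2 + 4 * u) * u) := by
  nlinarith [mul_nonneg (mul_pos hu0 hu0).le (show 0 ≤ 1 - u by linarith)]

/-- **Lemma 4.5, (4.8)–(4.9)** and the facts about `T'` used later. Format: `p ≥ 3`, `emin + 2p ≤ 0`
(so that all the constants and `(3/2+4eps)·(n·eps)` are in the normal range); `n ≥ 1`;
`(4n+2)eps ≤ 1`. With `T' = min(M̃₁, M̃₂)`: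
* `T' ∈ F`, `T' ≥ 0`; if `σ₀ ∉ U` then `M̃₂ = 2n·eps·ufp(σ₀)` exactly and `T' ≤ 2n·eps·ufp(σ₀)`;
* (4.8) `4T' ≤ eps⁻¹eta ⟹ Σ|p'ᵢ| ≤ ½eps⁻¹eta` and `fl(Σ p'ᵢ) = Σ p'ᵢ` (by (3.2), in any order);
* (4.9) `4T' > eps⁻¹eta ⟹ σ₀ ∉ U`, `Σ|p'ᵢ| ≤ T'`, and moreover `T' ≥ (3/2)(1 − eps)·n·eps·ufp(σ₀)`.
NOTE on (4.15): `fl((3/2+4eps)·(n·eps))` is in general inexact (exact only for `n` a power of 2), so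
two factors `(1 − eps)` appear when `M̃₁ ∉ U`; the margins of (4.14) absorb this. In the case
`M̃₁ ∈ U` the claim `Σ|p'ᵢ| ≤ M̃₁` is obtained from `Σ|p'ᵢ|, M̃₁ ∈ etaℤ` and `Σ|p'ᵢ| < M̃₁ + eta`.
[cite: Rump2009, Lemma 4.5 eqs. (4.8)–(4.9), proof eqs. (4.13)–(4.17)] -/
theorem lemma45_tBound (hp : 3 ≤ p) (he : emin + 2 * p ≤ 0) (hfl : IsRoundNearest p emin fl)
    {xs : List ℚ} (hxs : ∀ x ∈ xs, IsFloat p emin x) {T : ℚ} (hTF : IsFloat p emin T)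
    (hT : (xs.map abs).sum ≤ T) (hn1 : 1 ≤ xs.length) (hn : 4 * xs.length + 2 ≤ 2 ^ p)
    {σ0 : ℚ} (hσ0 : σ0 = sigmaZero fl p xs.length T) {T' : ℚ} (hT' : T' = tBound fl p xs.length σ0) :
    IsFloat p emin T' ∧ 0 ≤ T' ∧
    ((2 : ℚ) ^ (emin + p - 1) < σ0 →
      fl (fl (2 * (xs.length : ℚ) * unitRoundoff p) * ufpFl fl p σ0) =
          2 * (xs.length : ℚ) * unitRoundoff p * ufp σ0 ∧
        T' ≤ 2 * (xs.length : ℚ) * unitRoundoff p * ufp σ0) ∧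
    (4 * T' ≤ (2 : ℚ) ^ (emin + p) →
      ((extractVectorNew fl σ0 xs).2.map abs).sum ≤ (2 : ℚ) ^ (emin + p - 1) ∧
        flSum fl (extractVectorNew fl σ0 xs).2 = ((extractVectorNew fl σ0 xs).2).sum ∧
        ∀ t : SumTree, t.leaves.Perm (extractVectorNew fl σ0 xs).2 → t.eval fl = t.exact) ∧
    ((2 : ℚ) ^ (emin + p) < 4 * T' →
      (2 : ℚ) ^ (emin + p - 1) < σ0 ∧ ((extractVectorNew fl σ0 xs).2.map abs).sum ≤ T' ∧
        3 / 2 * (1 - unitRoundoff p) * ((xs.length : ℚ) * unitRoundoff p) * ufp σ0 ≤ T') := by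
  have hp1 : 1 ≤ p := by omega
  have hp2 : 2 ≤ p := by omega
  have he1 : emin + p ≤ 0 := by omega
  set n := xs.length with hn_def
  set u := unitRoundoff p with hu
  have hu0 : 0 < u := u_pos
  have hu8 : u ≤ 1 / 8 := by
    rw [hu, unitRoundoff]
    have : (8 : ℚ) ≤ 2 ^ p := by
      calc (8 : ℚ) = 2 ^ 3 := by norm_num
        _ ≤ 2 ^ p := pow_le_pow_right₀ (by norm_num) hp
    exact one_div_le_one_div_of_le (by norm_num) this
  have hn0 : (1 : ℚ) ≤ n := by exact_mod_cast hn1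
  have hn00 : (0 : ℚ) ≤ n := Nat.cast_nonneg n
  have hnu0 : 0 ≤ (n : ℚ) * u := mul_nonneg hn00 hu0.le
  have hnu4 : 4 * ((n : ℚ) * u) ≤ 1 := by
    have := natCast_mul_u_le_one (p := p) (K := 4 * n) (by omega)
    push_cast at this; linarith
  -- Lemma 4.5 so far
  obtain ⟨hσ0F, hT0, h2T, -⟩ := lemma45_setup hp2 he1 hfl hxs hTF hT hn
  rw [← hσ0] at hσ0F h2T
  have hσ00 : 0 ≤ σ0 := by linarith
  have hparts := lemma45_parts hp2 he1 hfl hxs hTF hT hn hσ0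
  obtain ⟨-, hlen, hpsF, -⟩ := lemma45_sum hp2 he1 hfl hxs hTF hT hn hσ0
  set ps := (extractVectorNew fl σ0 xs).2 with hps
  set S := (ps.map abs).sum with hS
  have hS0 : 0 ≤ S := sum_map_abs_nonneg ps
  have hS44 : S ≤ (n : ℚ) * (2 * u * ufp σ0) := by
    rw [hS, hn_def, ← hlen]; exact sum_map_abs_le_length_mul (fun y hy => (hparts y hy).2.1)
  have hS13 : S ≤ (n : ℚ) * (u * (3 / 2 * σ0)) := by
    rw [hS, hn_def, ← hlen]; exact sum_map_abs_le_length_mul (fun y hy => (hparts y hy).2.2.1)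
  have hS13' : (2 : ℚ) ^ (emin + p - 1) < σ0 → S ≤ (n : ℚ) * (u * ((3 - u) / 2 * σ0)) := fun h => by
    rw [hS, hn_def, ← hlen]; exact sum_map_abs_le_length_mul (fun y hy => (hparts y hy).2.2.2 h)
  -- the constants
  have hc1F : IsFloat p emin (3 / 2 + 4 * u) := isFloat_c1 hp (by omega)
  have hnuF : IsFloat p emin ((n : ℚ) * u) := isFloat_natCast_mul_u hp1 (by omega) he1
  have h2nuF : IsFloat p emin (2 * (n : ℚ) * u) := by
    have := isFloat_natCast_mul_u (p := p) (emin := emin) hp1 (K := 2 * n) (by omega) he1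
    push_cast at this; exact this
  have hufpS : ufpFl fl p σ0 = ufp σ0 := ufpFl_eq_ufp hp2 hfl hσ0F
  -- ṽ := fl((3/2+4eps)(n·eps)) ≥ (1 − eps)(3/2+4eps)(n·eps)
  set v := (3 / 2 + 4 * u) * ((n : ℚ) * u) with hv
  have hv0 : 0 ≤ v := by positivity
  have hvth : (2 : ℚ) ^ (emin + p - 1) ≤ |v| := by
    rw [abs_of_nonneg hv0, hv]
    have h1 : (2 : ℚ) ^ (emin + p - 1) ≤ u := by
      rw [hu, unitRoundoff, one_div, ← zpow_natCast, ← zpow_neg]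
      exact zpow_le_zpow_right₀ (by norm_num) (by omega)
    have h2 : u ≤ (n : ℚ) * u := le_mul_of_one_le_left hu0.le hn0
    have h3 : (n : ℚ) * u ≤ (3 / 2 + 4 * u) * ((n : ℚ) * u) := le_mul_of_one_le_left hnu0 (by linarith)
    linarith
  have hfv : (1 - u) * v ≤ fl v := by
    have := (abs_sub_le_iff.mp (abs_fl_sub_le_mul_abs hp1 hfl hvth)).2
    rw [abs_of_nonneg hv0] at this; linarith
  have hfvF : IsFloat p emin (fl v) := (hfl v).1
  have hfv0 : 0 ≤ fl v := fl_nonneg hfl hv0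
  -- M̃₁ = fl(ṽ·σ₀), M̃₂ = fl(2n·eps·ufp σ₀)
  set M1 := fl (fl v * σ0) with hM1
  set M2 := 2 * (n : ℚ) * u * ufp σ0 with hM2
  have hM20 : 0 ≤ M2 := by have := ufp_nonneg σ0; positivity
  have hT'eq : T' = min M1 (fl M2) := by
    rw [hT', tBound, ← hu, fl_eq_self hfl hc1F, fl_eq_self hfl hnuF, fl_eq_self hfl h2nuF,
      hufpS]
  have hM1F : IsFloat p emin M1 := (hfl _).1
  have hM10 : 0 ≤ M1 := fl_nonneg hfl (mul_nonneg hfv0 hσ00)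
  have hfM2F : IsFloat p emin (fl M2) := (hfl _).1
  have hfM20 : 0 ≤ fl M2 := fl_nonneg hfl hM20
  have hT'F : IsFloat p emin T' := by
    rw [hT'eq]; rcases min_choice M1 (fl M2) with h | h <;> rw [h]
    exacts [hM1F, hfM2F]
  have hT'0 : 0 ≤ T' := by rw [hT'eq]; exact le_min hM10 hfM20
  have hT'1 : T' ≤ M1 := by rw [hT'eq]; exact min_le_left _ _
  have hT'2 : T' ≤ fl M2 := by rw [hT'eq]; exact min_le_right _ _
  -- σ₀ ∉ U ⟹ M₂ ∈ F
  have hNUfacts : (2 : ℚ) ^ (emin + p - 1) < σ0 → fl M2 = M2 := fun hNU => by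
    have hσ0pos : 0 < σ0 := lt_trans (two_zpow_pos _) hNU
    obtain ⟨k, hk⟩ := exists_ufp_eq_two_zpow hσ0pos.ne'
    have hk1 : emin + p - 1 ≤ k := by
      have h1 : (2 : ℚ) ^ (emin + p - 1) ≤ (2 : ℚ) ^ k :=
        hk ▸ two_zpow_le_ufp (by rw [abs_of_pos hσ0pos]; exact hNU.le)
      exact (zpow_le_zpow_iff_right₀ (by norm_num : (1 : ℚ) < 2)).mp h1
    have hM2F : IsFloat p emin M2 := by
      have hN : |((n : ℕ) : ℤ)| ≤ 2 ^ p := by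
        rw [abs_of_nonneg (Int.natCast_nonneg n)]; exact_mod_cast (show n ≤ 2 ^ p by omega)
      have h := isFloat_of_abs_le (p := p) (emin := emin) hp1 hN (k := k - p + 1) (by omega)
      convert h using 1
      rw [hM2, hk, ← two_mul_u_mul_two_zpow]; push_cast; ring
    exact fl_eq_self hfl hM2F
  refine ⟨hT'F, hT'0, fun hNU => ?_, fun h48 => ?_, fun h49 => ?_⟩
  · -- σ₀ ∉ U
    have h := hNUfacts hNU
    refine ⟨?_, hT'2.trans_eq h⟩
    rw [fl_eq_self hfl h2nuF, hufpS]; exact h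
  · -- (4.8)
    have hA : (2 : ℚ) ^ (emin + p) = 4 * (2 : ℚ) ^ (emin + p - 2) := by
      rw [show emin + p = (emin + p - 2) + 2 by ring, zpow_add₀ (by norm_num : (2 : ℚ) ≠ 0)]; norm_num
      ring
    have hT'4 : T' ≤ (2 : ℚ) ^ (emin + p - 2) := by rw [hA] at h48; linarith
    have hSle : S ≤ (2 : ℚ) ^ (emin + p - 1) := by
      rw [hT'eq] at hT'4
      rcases min_choice M1 (fl M2) with h | h <;> rw [h] at hT'4
      · -- T' = M̃₁: S ≤ (3/2)n·eps·σ₀ ≤ ṽσ₀ ≤ ½eps⁻¹eta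
        have h1 : S ≤ fl v * σ0 := by
          have h15 : 3 / 2 * ((n : ℚ) * u) ≤ (1 - u) * v := by
            rw [hv]
            linarith [mul_nonneg (mul_nonneg hnu0 hu0.le) (show 0 ≤ 5 / 2 - 4 * u by linarith)]
          have h16 := mul_le_mul_of_nonneg_right (h15.trans hfv) hσ00
          linarith
        exact h1.trans (le_threshold_of_fl_le hp2 hfl (mul_nonneg hfv0 hσ00) hT'4)
      · exact hS44.trans (by
          have := le_threshold_of_fl_le hp2 hfl hM20 hT'4; rw [hM2] at this; linarith)
    have hSle' : S ≤ (2 : ℚ) ^ (emin + p) :=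
      hSle.trans (zpow_le_zpow_right₀ (by norm_num) (by omega))
    refine ⟨hSle, flSum_eq_sum_of_sum_abs_le hp1 hfl hpsF hSle', fun t ht => ?_⟩
    refine eval_eq_exact_of_absSum_le hp1 hfl t (fun a ha => hpsF a (ht.subset ha)) ?_
    unfold SumTree.absSum
    rw [(ht.map abs).sum_eq]; exact hSle'
  · -- (4.9)
    have hA : (2 : ℚ) ^ (emin + p) = 4 * (2 : ℚ) ^ (emin + p - 2) := by
      rw [show emin + p = (emin + p - 2) + 2 by ring, zpow_add₀ (by norm_num : (2 : ℚ) ≠ 0)]; norm_num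
      ring
    -- σ₀ ∉ U
    have hNU : (2 : ℚ) ^ (emin + p - 1) < σ0 := by
      by_contra hU
      have hU : σ0 ≤ (2 : ℚ) ^ (emin + p - 1) := not_lt.mp hU
      have hufp : ufp σ0 ≤ (2 : ℚ) ^ (emin + p - 1) :=
        (ufp_le_abs σ0).trans (by rwa [abs_of_nonneg hσ00])
      have hM2le : M2 ≤ (2 : ℚ) ^ (emin + p - 2) := by
        have h22 : (2 : ℚ) ^ (emin + p - 1) = 2 * (2 : ℚ) ^ (emin + p - 2) := by
          rw [show emin + p - 1 = (emin + p - 2) + 1 by ring, zpow_add_one₀ (by norm_num : (2 : ℚ) ≠ 0)]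
          ring
        have hA0 : 0 ≤ (2 : ℚ) ^ (emin + p - 2) := (two_zpow_pos _).le
        calc M2 = 2 * (n : ℚ) * u * ufp σ0 := hM2
          _ ≤ 2 * (n : ℚ) * u * (2 : ℚ) ^ (emin + p - 1) :=
              mul_le_mul_of_nonneg_left hufp (mul_nonneg (mul_nonneg (by norm_num) hn00) hu0.le)
          _ = (4 * ((n : ℚ) * u)) * (2 : ℚ) ^ (emin + p - 2) := by rw [h22]; ring
          _ ≤ 1 * (2 : ℚ) ^ (emin + p - 2) := mul_le_mul_of_nonneg_right hnu4 hA0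
          _ = (2 : ℚ) ^ (emin + p - 2) := one_mul _
      have hfl2 : fl M2 ≤ (2 : ℚ) ^ (emin + p - 2) :=
        fl_le_of_le hfl (isFloat_two_zpow hp1 (by omega)) hM2le
      linarith
    have hσ0pos : 0 < σ0 := lt_trans (two_zpow_pos _) hNU
    have hfM2 := hNUfacts hNU
    have hufp0 : 0 ≤ ufp σ0 := ufp_nonneg σ0
    have hufpσ : ufp σ0 ≤ σ0 := by have := ufp_le_abs σ0; rwa [abs_of_pos hσ0pos] at this
    refine ⟨hNU, ?_, ?_⟩
    · -- Σ|p'ᵢ| ≤ T'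
      rw [hT'eq]
      rcases min_choice M1 (fl M2) with h | h <;> rw [h]
      · -- T' = M̃₁
        have hB := hS13' hNU
        rcases le_or_gt ((2 : ℚ) ^ (emin + p - 1)) (|fl v * σ0|) with hn' | hsub
        · -- M̃₁ in the normal range: M̃₁ ≥ (1−eps)ṽσ₀ ≥ (1−eps)²(3/2+4eps)n·eps·σ₀
          have h1 := (abs_sub_le_iff.mp (abs_fl_sub_le_mul_abs hp1 hfl hn')).2
          rw [abs_of_nonneg (mul_nonneg hfv0 hσ00)] at h1
          have h2 : (1 - u) * ((1 - u) * v) * σ0 ≤ M1 := by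
            have h2a : (1 - u) * (fl v * σ0) ≤ M1 := by rw [hM1]; linarith
            have h2b : (1 - u) * ((1 - u) * v * σ0) ≤ (1 - u) * (fl v * σ0) :=
              mul_le_mul_of_nonneg_left (mul_le_mul_of_nonneg_right hfv hσ00) (by linarith)
            linarith
          have hpoly := poly414a hu0 hu8
          calc S ≤ (n : ℚ) * (u * ((3 - u) / 2 * σ0)) := hB
            _ = (u * ((3 - u) / 2)) * ((n : ℚ) * σ0) := by ring
            _ ≤ (1 - u) * ((1 - u) * ((3 / 2 + 4 * u) * u)) * ((n : ℚ) * σ0) :=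
                mul_le_mul_of_nonneg_right hpoly (by positivity)
            _ = (1 - u) * ((1 - u) * v) * σ0 := by rw [hv]; ring
            _ ≤ M1 := h2
        · -- M̃₁ ∈ U: absolute error ½eta, then the grid argument
          have h1 := abs_sub_fl_le_of_subnormal hp1 hfl hsub
          have h2 : fl v * σ0 - (2 : ℚ) ^ emin / 2 ≤ M1 := by
            have := (abs_sub_le_iff.mp h1).1; rw [hM1]; linarith
          have h3 : (1 - u) * v * σ0 ≤ fl v * σ0 := mul_le_mul_of_nonneg_right hfv hσ00
          have hpoly := poly414b hu0 hu8
          have h4 : S ≤ (1 - u) * v * σ0 := by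
            calc S ≤ (n : ℚ) * (u * ((3 - u) / 2 * σ0)) := hB
              _ = (u * ((3 - u) / 2)) * ((n : ℚ) * σ0) := by ring
              _ ≤ (1 - u) * ((3 / 2 + 4 * u) * u) * ((n : ℚ) * σ0) :=
                  mul_le_mul_of_nonneg_right hpoly (by positivity)
              _ = (1 - u) * v * σ0 := by rw [hv]; ring
          have hlt : S < M1 + (2 : ℚ) ^ emin := by
            have : (0 : ℚ) < (2 : ℚ) ^ emin := two_zpow_pos _
            linarith
          have hgS : OnGrid ((2 : ℚ) ^ emin) S :=
            onGrid_list_sum (fun r hr => by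
              obtain ⟨y, hy, rfl⟩ := List.mem_map.mp hr
              exact onGrid_eta_of_isFloat (isFloat_abs (hpsF y hy)))
          exact le_of_onGrid_of_lt_add hgS (onGrid_eta_of_isFloat hM1F) hlt
      · -- T' = M̃₂ = 2n·eps·ufp(σ₀)
        rw [hfM2, hM2]; linarith
    · -- T' ≥ (3/2)(1−eps)·n·eps·ufp(σ₀)
      rw [hT'eq] at h49 ⊢
      rcases min_choice M1 (fl M2) with h | h <;> rw [h] at h49 ⊢
      · rcases le_or_gt ((2 : ℚ) ^ (emin + p - 1)) (|fl v * σ0|) with hn' | hsub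
        · have h1 := (abs_sub_le_iff.mp (abs_fl_sub_le_mul_abs hp1 hfl hn')).2
          rw [abs_of_nonneg (mul_nonneg hfv0 hσ00)] at h1
          have h2 : (1 - u) * ((1 - u) * v) * σ0 ≤ M1 := by
            have h2a : (1 - u) * (fl v * σ0) ≤ M1 := by rw [hM1]; linarith
            have h2b : (1 - u) * ((1 - u) * v * σ0) ≤ (1 - u) * (fl v * σ0) :=
              mul_le_mul_of_nonneg_left (mul_le_mul_of_nonneg_right hfv hσ00) (by linarith)
            linarith
          have hpoly := poly414c hu0 hu8
          calc 3 / 2 * (1 - u) * ((n : ℚ) * u) * ufp σ0 ≤ 3 / 2 * (1 - u) * ((n : ℚ) * u) * σ0 :=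
                mul_le_mul_of_nonneg_left hufpσ (mul_nonneg (mul_nonneg (by norm_num) (by linarith)) hnu0)
            _ = (3 / 2 * (1 - u) * u) * ((n : ℚ) * σ0) := by ring
            _ ≤ (1 - u) * ((1 - u) * ((3 / 2 + 4 * u) * u)) * ((n : ℚ) * σ0) :=
                mul_le_mul_of_nonneg_right hpoly (by positivity)
            _ = (1 - u) * ((1 - u) * v) * σ0 := by rw [hv]; ring
            _ ≤ M1 := h2
        · -- (4.17): eta/2 < 2eps·T' is absorbed
          have h1 := abs_sub_fl_le_of_subnormal hp1 hfl hsub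
          have h2 : fl v * σ0 - (2 : ℚ) ^ emin / 2 ≤ M1 := by
            have := (abs_sub_le_iff.mp h1).1; rw [hM1]; linarith
          have h3 : (1 - u) * v * σ0 ≤ fl v * σ0 := mul_le_mul_of_nonneg_right hfv hσ00
          have heta : (2 : ℚ) ^ emin / 2 < 2 * u * M1 := by
            have e : (2 : ℚ) ^ emin = 4 * u * (2 : ℚ) ^ (emin + p - 2) := by
              rw [hu, show (4 : ℚ) * unitRoundoff p * (2 : ℚ) ^ (emin + p - 2) =
                2 * (2 * unitRoundoff p * (2 : ℚ) ^ (emin + p - 2)) by ring, two_mul_u_mul_two_zpow,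
                show emin + p - 2 - p + 1 = emin - 1 by ring, zpow_sub_one₀ (by norm_num : (2:ℚ) ≠ 0)]
              ring
            rw [hA] at h49
            have hAM : (2 : ℚ) ^ (emin + p - 2) < M1 := by linarith
            have := mul_lt_mul_of_pos_left hAM (show 0 < 2 * u by linarith)
            rw [e]; linarith
          have hpoly := poly417 hu0 (by linarith)
          have h4 : (1 + 2 * u) * (3 / 2 * (1 - u) * ((n : ℚ) * u) * ufp σ0) ≤ (1 + 2 * u) * M1 := by
            calc (1 + 2 * u) * (3 / 2 * (1 - u) * ((n : ℚ) * u) * ufp σ0)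
                ≤ (1 + 2 * u) * (3 / 2 * (1 - u) * ((n : ℚ) * u) * σ0) :=
                  mul_le_mul_of_nonneg_left (mul_le_mul_of_nonneg_left hufpσ
                    (mul_nonneg (mul_nonneg (by norm_num) (by linarith)) hnu0)) (by linarith)
              _ = (3 / 2 * (1 - u) * u * (1 + 2 * u)) * ((n : ℚ) * σ0) := by ring
              _ ≤ (1 - u) * ((3 / 2 + 4 * u) * u) * ((n : ℚ) * σ0) :=
                  mul_le_mul_of_nonneg_right hpoly (by positivity)
              _ = (1 - u) * v * σ0 := by rw [hv]; ring
              _ ≤ (1 + 2 * u) * M1 := by linarith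
          exact le_of_mul_le_mul_left h4 (by linarith)
      · rw [hfM2, hM2]
        have h0 : 0 ≤ (n : ℚ) * u * ufp σ0 := mul_nonneg hnu0 hufp0
        linarith [mul_nonneg h0 (show 0 ≤ 1 / 2 + 3 / 2 * u by linarith)]

/-! ### §2, eq. (2.17): recursive summation of uniformly small summands -/

/-- One step of (2.17): `σ, x ∈ F`, `|σ| ≤ K·2^j`, `|x| ≤ 2^j`, `1 ≤ K`, `2^j ≥ eta` ⟹
`|fl(σ + x) − (σ + x)| ≤ K·eps·2^j`. (With `2^m ≤ K < 2^(m+1)`: either `|σ + x| < 2^(m+1+j)`, then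
`ufp(σ + x) ≤ 2^(m+j) ≤ K·2^j` and (2.10) applies, or `|σ + x| = 2^(m+1+j)` is a power of two and the
addition is exact.) [cite: Rump2009, §2 eq. (2.17) (via (2.10))] -/
theorem abs_fl_add_sub_le_of_abs_le (hp : 1 ≤ p) (hfl : IsRoundNearest p emin fl) {j : ℤ}
    (hj : emin ≤ j) {K : ℕ} (hK1 : 1 ≤ K) {σ x : ℚ} (hσ : IsFloat p emin σ) (hx : IsFloat p emin x)
    (hσK : |σ| ≤ (K : ℚ) * (2 : ℚ) ^ j) (hxj : |x| ≤ (2 : ℚ) ^ j) :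
    |fl (σ + x) - (σ + x)| ≤ (K : ℚ) * unitRoundoff p * (2 : ℚ) ^ j := by
  set m := Nat.log 2 K with hm
  have hPK : 2 ^ m ≤ K := Nat.pow_log_le_self 2 (by omega)
  have hK2P : K < 2 ^ (m + 1) := Nat.lt_pow_succ_log_self (by norm_num) K
  have hPKq : (2 : ℚ) ^ (m : ℤ) ≤ K := by rw [zpow_natCast]; exact_mod_cast hPK
  have hK1q : (K : ℚ) + 1 ≤ (2 : ℚ) ^ ((m : ℤ) + 1) := by
    rw [show ((m : ℤ) + 1) = ((m + 1 : ℕ) : ℤ) by push_cast; ring, zpow_natCast]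
    exact_mod_cast hK2P
  have hsum : |σ + x| ≤ (2 : ℚ) ^ ((m : ℤ) + 1 + j) := by
    calc |σ + x| ≤ |σ| + |x| := abs_add_le _ _
      _ ≤ ((K : ℚ) + 1) * (2 : ℚ) ^ j := by rw [add_mul, one_mul]; exact add_le_add hσK hxj
      _ ≤ (2 : ℚ) ^ ((m : ℤ) + 1) * (2 : ℚ) ^ j :=
          mul_le_mul_of_nonneg_right hK1q (two_zpow_pos j).le
      _ = (2 : ℚ) ^ ((m : ℤ) + 1 + j) := by rw [← zpow_add₀ (by norm_num : (2 : ℚ) ≠ 0)]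
  rcases hsum.lt_or_eq with hlt | heq
  · calc |fl (σ + x) - (σ + x)| ≤ unitRoundoff p * ufp (σ + x) :=
          abs_fl_add_sub_le_u_ufp hp hfl hσ hx
      _ ≤ unitRoundoff p * (2 : ℚ) ^ ((m : ℤ) + j) :=
          mul_le_mul_of_nonneg_left (ufp_le_two_zpow_of_abs_lt
            (by rwa [show (m : ℤ) + j + 1 = (m : ℤ) + 1 + j by ring])) u_pos.le
      _ = unitRoundoff p * ((2 : ℚ) ^ (m : ℤ) * (2 : ℚ) ^ j) := by
          rw [zpow_add₀ (by norm_num : (2 : ℚ) ≠ 0)]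
      _ ≤ unitRoundoff p * ((K : ℚ) * (2 : ℚ) ^ j) :=
          mul_le_mul_of_nonneg_left (mul_le_mul_of_nonneg_right hPKq (two_zpow_pos j).le) u_pos.le
      _ = (K : ℚ) * unitRoundoff p * (2 : ℚ) ^ j := by ring
  · have hF : IsFloat p emin (σ + x) := by
      rcases (abs_eq (two_zpow_pos _).le).mp heq with h | h
      · rw [h]; exact isFloat_two_zpow hp (by omega)
      · rw [h]; exact (isFloat_two_zpow hp (by omega)).neg
    rw [fl_eq_self hfl hF, sub_self, abs_zero]
    exact mul_nonneg (mul_nonneg (Nat.cast_nonneg K) u_pos.le) (two_zpow_pos j).le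

/-- Eq. (2.17) along recursive summation `flAcc fl σ xs`, with a running bound `|σ| ≤ K·2^j`:
`|fl result| ≤ (K + n)·2^j` and the accumulated error is at most `(K·n + n(n−1)/2)·eps·2^j`
(`n = xs.length`, `(K + n)·eps ≤ 1`). [cite: Rump2009, §2 eq. (2.17)] -/
theorem flAcc_bounds_of_abs_le (hp : 1 ≤ p) (hfl : IsRoundNearest p emin fl) {j : ℤ} (hj : emin ≤ j) :
    ∀ (xs : List ℚ) {K : ℕ} {σ : ℚ}, 1 ≤ K → IsFloat p emin σ →
      (∀ x ∈ xs, IsFloat p emin x ∧ |x| ≤ (2 : ℚ) ^ j) → |σ| ≤ (K : ℚ) * (2 : ℚ) ^ j →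
      K + xs.length ≤ 2 ^ p →
      |flAcc fl σ xs| ≤ ((K : ℚ) + xs.length) * (2 : ℚ) ^ j ∧
        |flAcc fl σ xs - (σ + xs.sum)| ≤
          ((K : ℚ) * xs.length + (xs.length : ℚ) * ((xs.length : ℚ) - 1) / 2) * unitRoundoff p *
            (2 : ℚ) ^ j
  | [], K, σ, _, _, _, hσK, _ => by
      simp only [flAcc_nil, List.length_nil, Nat.cast_zero, add_zero, List.sum_nil, sub_self,
        abs_zero, mul_zero, zero_sub, mul_neg, mul_one, neg_zero, zero_div, zero_mul]
      exact ⟨hσK, le_refl 0⟩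
  | x :: xs, K, σ, hK1, hσ, hxs, hσK, hn => by
      rw [flAcc_cons]
      have hx := hxs x (by simp)
      have hstep := abs_fl_add_sub_le_of_abs_le hp hfl hj hK1 hσ hx.1 hσK hx.2
      have hn' : K + 1 + xs.length ≤ 2 ^ p := by simp only [List.length_cons] at hn; omega
      have hB : IsFloat p emin ((((K + 1 : ℕ) : ℤ) : ℚ) * (2 : ℚ) ^ j) := by
        refine isFloat_of_abs_le hp ?_ hj
        rw [abs_of_nonneg (by positivity)]
        exact_mod_cast (show K + 1 ≤ 2 ^ p by omega)
      have hBq : ((((K + 1 : ℕ) : ℤ) : ℚ) * (2 : ℚ) ^ j) = ((K : ℚ) + 1) * (2 : ℚ) ^ j := by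
        push_cast; ring
      rw [hBq] at hB
      have h1 : |σ + x| ≤ ((K : ℚ) + 1) * (2 : ℚ) ^ j := by
        calc |σ + x| ≤ |σ| + |x| := abs_add_le _ _
          _ ≤ ((K : ℚ) + 1) * (2 : ℚ) ^ j := by rw [add_mul, one_mul]; exact add_le_add hσK hx.2
      have hσ' : |fl (σ + x)| ≤ ((K + 1 : ℕ) : ℚ) * (2 : ℚ) ^ j := by
        push_cast
        obtain ⟨hlo, hhi⟩ := abs_le.mp h1
        have hhi' := fl_le_of_le hfl hB hhi
        have hlo' := le_fl_of_le hfl hB.neg (t := σ + x) (by linarith)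
        rw [abs_le]; constructor <;> linarith
      obtain ⟨IH1, IH2⟩ := flAcc_bounds_of_abs_le hp hfl hj xs (K := K + 1) (by omega) (hfl _).1
        (fun y hy => hxs y (by simp [hy])) hσ' hn'
      constructor
      · simp only [List.length_cons]; push_cast at IH1 ⊢
        calc |flAcc fl (fl (σ + x)) xs| ≤ ((K : ℚ) + 1 + xs.length) * (2 : ℚ) ^ j := IH1
          _ = ((K : ℚ) + (xs.length + 1)) * (2 : ℚ) ^ j := by ring
      · simp only [List.length_cons, List.sum_cons]; push_cast at IH2 ⊢
        calc |flAcc fl (fl (σ + x)) xs - (σ + (x + xs.sum))|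
            ≤ |flAcc fl (fl (σ + x)) xs - (fl (σ + x) + xs.sum)| + |fl (σ + x) - (σ + x)| := by
              rw [show flAcc fl (fl (σ + x)) xs - (σ + (x + xs.sum)) =
                (flAcc fl (fl (σ + x)) xs - (fl (σ + x) + xs.sum)) + (fl (σ + x) - (σ + x)) by ring]
              exact abs_add_le _ _
          _ ≤ (((K : ℚ) + 1) * xs.length + (xs.length : ℚ) * ((xs.length : ℚ) - 1) / 2) *
                unitRoundoff p * (2 : ℚ) ^ j + (K : ℚ) * unitRoundoff p * (2 : ℚ) ^ j :=
              add_le_add IH2 hstep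
          _ = ((K : ℚ) * ((xs.length : ℚ) + 1) + ((xs.length : ℚ) + 1) * ((xs.length : ℚ) + 1 - 1) / 2) *
                unitRoundoff p * (2 : ℚ) ^ j := by ring

/-- Eq. (2.17) for `fl(Σ aᵢ)` computed recursively: `n·eps ≤ 1`, `aᵢ ∈ F`, `|aᵢ| ≤ 2^j` (`2^j ≥ eta`)
⟹ `|fl(Σ aᵢ)| ≤ n·2^j` and `|fl(Σ aᵢ) − Σ aᵢ| ≤ (n(n−1)/2)·eps·2^j`.
[cite: Rump2009, §2 eq. (2.17)] -/
theorem flSum_bounds_of_abs_le (hp : 1 ≤ p) (hfl : IsRoundNearest p emin fl) {j : ℤ} (hj : emin ≤ j)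
    {xs : List ℚ} (hxs : ∀ x ∈ xs, IsFloat p emin x ∧ |x| ≤ (2 : ℚ) ^ j) (hn : xs.length ≤ 2 ^ p) :
    |flSum fl xs| ≤ (xs.length : ℚ) * (2 : ℚ) ^ j ∧
      |flSum fl xs - xs.sum| ≤ (xs.length : ℚ) * ((xs.length : ℚ) - 1) / 2 * unitRoundoff p *
        (2 : ℚ) ^ j := by
  cases xs with
  | nil => simp [flSum]
  | cons x rest =>
      rw [flSum_cons]
      have hx := hxs x (by simp)
      have hn' : 1 + rest.length ≤ 2 ^ p := by simp only [List.length_cons] at hn; omega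
      obtain ⟨h1, h2⟩ := flAcc_bounds_of_abs_le hp hfl hj rest (K := 1) le_rfl hx.1
        (fun y hy => hxs y (by simp [hy])) (by rw [Nat.cast_one, one_mul]; exact hx.2) hn'
      simp only [List.length_cons, List.sum_cons]; push_cast at h1 h2 ⊢
      refine ⟨?_, ?_⟩
      · calc |flAcc fl x rest| ≤ (1 + (rest.length : ℚ)) * (2 : ℚ) ^ j := h1
          _ = ((rest.length : ℚ) + 1) * (2 : ℚ) ^ j := by ring
      · calc |flAcc fl x rest - (x + rest.sum)|
            ≤ (1 * (rest.length : ℚ) + (rest.length : ℚ) * ((rest.length : ℚ) - 1) / 2) *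
                unitRoundoff p * (2 : ℚ) ^ j := h2
          _ = ((rest.length : ℚ) + 1) * ((rest.length : ℚ) + 1 - 1) / 2 * unitRoundoff p *
                (2 : ℚ) ^ j := by ring

/-! ### Lemma 4.7 and the grids used by Lemma 4.9 -/

/-- (2.13)/(2.16) as used in Lemma 4.7: `y, σ₀ ∈ F` with `|y − σ₀| ≤ σ₀/2` ⟹
`y − σ₀ ∈ eps·ufp(σ₀)ℤ` (both `y ≥ σ₀/2 ≥ ½ufp(σ₀)` and `σ₀` lie on the grid `eps·ufp(σ₀)ℤ`).
[cite: Rump2009, Lemma 4.7 eq. (4.18)] -/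
theorem onGrid_u_ufp_sub {σ0 y : ℚ} (hσ0F : IsFloat p emin σ0) (hyF : IsFloat p emin y)
    (h : |y - σ0| ≤ σ0 / 2) : OnGrid (unitRoundoff p * ufp σ0) (y - σ0) := by
  rcases eq_or_ne σ0 0 with h0 | h0
  · subst h0
    have hy : y = 0 := by
      have : |y| ≤ 0 := by simpa using h
      exact abs_nonpos_iff.mp this
    rw [hy, ufp_zero, mul_zero, sub_self]; exact onGrid_zero _
  · have hσ0pos : 0 < σ0 := by
      rcases lt_or_gt_of_ne h0 with hneg | hpos
      · exfalso; have := abs_nonneg (y - σ0); linarith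
      · exact hpos
    obtain ⟨k, hk⟩ := exists_ufp_eq_two_zpow h0
    have hkσ : (2 : ℚ) ^ k ≤ σ0 := by
      have := ufp_le_abs σ0; rwa [hk, abs_of_pos hσ0pos] at this
    have hk1 : (2 : ℚ) ^ (k - 1) = (2 : ℚ) ^ k / 2 := by
      rw [zpow_sub_one₀ (by norm_num : (2 : ℚ) ≠ 0)]; ring
    have hy : (2 : ℚ) ^ (k - 1) ≤ |y| := by
      have h1 : σ0 / 2 ≤ y := by have := (abs_sub_le_iff.mp h).2; linarith
      rw [hk1]; exact le_trans (by linarith) (le_abs_self y)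
    have hgy : OnGrid ((2 : ℚ) ^ (k - 1 - p + 1)) y := onGrid_of_isFloat_of_le_abs hyF hy
    have hgσ : OnGrid ((2 : ℚ) ^ (k - p + 1)) σ0 :=
      onGrid_of_isFloat_of_le_abs hσ0F (by rwa [abs_of_pos hσ0pos])
    rw [hk, u_mul_two_zpow, show k - (p : ℤ) = k - 1 - p + 1 by ring]
    exact hgy.sub (hgσ.of_le (by omega))

/-- (2.13) as used in (4.27): `t ∈ eps·ufp(σ₀)ℤ`, `0 < |τ| ≤ σ₀/2` ⟹ `t ∈ 2eps·ufp(τ)ℤ` (the hypothesis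
of Lemma 3.4 / `FastTwoSum`). [cite: Rump2009, proof of Lemma 4.9, eq. (4.27)] -/
theorem onGrid_two_u_ufp_of_onGrid_u_ufp {t τ σ0 : ℚ} (hσ0 : 0 < σ0) (hτ0 : τ ≠ 0) (hτ : |τ| ≤ σ0 / 2)
    (ht : OnGrid (unitRoundoff p * ufp σ0) t) : OnGrid (2 * unitRoundoff p * ufp τ) t := by
  obtain ⟨b, hb⟩ := exists_ufp_eq_two_zpow hσ0.ne'
  obtain ⟨a, ha⟩ := exists_ufp_eq_two_zpow hτ0
  have hσlt : σ0 < 2 * (2 : ℚ) ^ b := by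
    have := abs_lt_two_mul_ufp hσ0.ne'; rwa [hb, abs_of_pos hσ0] at this
  have hτlt : |τ| < (2 : ℚ) ^ (b - 1 + 1) := by
    rw [show b - 1 + 1 = b by ring]; linarith
  have hab : (2 : ℚ) ^ a ≤ (2 : ℚ) ^ (b - 1) := ha ▸ ufp_le_two_zpow_of_abs_lt hτlt
  have hab' : a ≤ b - 1 := (zpow_le_zpow_iff_right₀ (by norm_num : (1 : ℚ) < 2)).mp hab
  rw [hb, u_mul_two_zpow] at ht
  rw [ha, two_mul_u_mul_two_zpow]
  exact ht.of_le (by omega)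

/-- `FastTwoSum(t, τ)` for `t, τ ∈ F` with `τ = 0` or `t ∈ 2eps·ufp(τ)ℤ` (Lemma 3.4): `τ₁ = fl(t + τ)`,
`τ₁ + τ₂ = t + τ`, `|τ₂| ≤ eps·|t + τ|` and `|τ₂| ≤ eps·ufp(τ₁)`.
[cite: Rump2009, Lemma 3.4 and eqs. (4.25)–(4.26)] -/
theorem fast2Sum_facts (hp : 1 ≤ p) (hfl : IsRoundNearest p emin fl) {t τ : ℚ} (ht : IsFloat p emin t)
    (hτ : IsFloat p emin τ) (hgrid : τ = 0 ∨ OnGrid (2 * unitRoundoff p * ufp τ) t) :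
    (fast2Sum fl t τ).1 = fl (t + τ) ∧ (fast2Sum fl t τ).1 + (fast2Sum fl t τ).2 = t + τ ∧
      |(fast2Sum fl t τ).2| ≤ unitRoundoff p * |t + τ| ∧
      |(fast2Sum fl t τ).2| ≤ unitRoundoff p * ufp ((fast2Sum fl t τ).1) := by
  have h1 : (fast2Sum fl t τ).1 = fl (t + τ) := rfl
  have h2 : (fast2Sum fl t τ).2 = fl (τ - fl (fl (t + τ) - t)) := rfl
  rcases hgrid with h0 | hg
  · subst h0
    have ht0 : fl (t + 0) = t := by rw [add_zero, fl_eq_self hfl ht]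
    have h2' : (fast2Sum fl t 0).2 = 0 := by
      rw [h2, ht0, sub_self, fl_zero hfl, sub_zero, fl_zero hfl]
    refine ⟨h1, by rw [h1, h2', ht0], ?_, ?_⟩
    · rw [h2', abs_zero]; exact mul_nonneg u_pos.le (abs_nonneg _)
    · rw [h2', abs_zero]; exact mul_nonneg u_pos.le (ufp_nonneg _)
  · obtain ⟨-, -, h3, h4, h5⟩ := fastTwoSum_eft hp hfl ht hτ hg
    exact ⟨h1, h3, h4.trans (mul_le_mul_of_nonneg_left (ufp_le_abs _) u_pos.le), h4.trans h5⟩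

/-! ### The bounds `Φ` and `T` of Algorithm 4.6 and Lemma 4.8 -/

/-- `Φ := fl((2n(n+2)eps)·S/(1 − 5eps))` of Algorithm 4.6, `S = ufp(σ₀)` computed by Algorithm 3.5
(the constant `2n(n+2)eps` is computed exactly in any order: all partial products are integers
`≤ eps⁻¹` or such integers scaled by `eps`). [cite: Rump2009, Algorithm 4.6 (definition of Φ)] -/
def phiBound (fl : ℚ → ℚ) (p n : ℕ) (σ0 : ℚ) : ℚ :=
  fl (fl (fl (2 * (n : ℚ) * ((n : ℚ) + 2) * unitRoundoff p) * ufpFl fl p σ0) /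
    fl (1 - fl (5 * unitRoundoff p)))

/-- The quantities in `Φ` for `σ₀ ∉ U`: with `M := 2n(n+2)eps·ufp(σ₀)` (computed exactly) and
`q := M/(1 − 5eps)` we have `Φ = fl(q)`, and `(1 − eps)q ≤ Φ ≤ (1 + eps)q` as soon as `q ≥ ½eps⁻¹eta`.
Format: `p ≥ 3`, `emin ≤ −p`, `n(n+2) ≤ 2^p`. [cite: Rump2009, Lemma 4.8 and proof of Lemma 4.9] -/
theorem phiBound_facts (hp : 3 ≤ p) (he : emin + p ≤ 0) (hfl : IsRoundNearest p emin fl) {n : ℕ}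
    (hN : n * (n + 2) ≤ 2 ^ p) {σ0 : ℚ} (hσ0F : IsFloat p emin σ0)
    (hNU : (2 : ℚ) ^ (emin + p - 1) < σ0) :
    ∃ q : ℚ, phiBound fl p n σ0 = fl q ∧
      q * (1 - 5 * unitRoundoff p) = 2 * (n : ℚ) * ((n : ℚ) + 2) * unitRoundoff p * ufp σ0 ∧
      2 * (n : ℚ) * ((n : ℚ) + 2) * unitRoundoff p * ufp σ0 ≤ q ∧ 0 ≤ q ∧
      ((2 : ℚ) ^ (emin + p - 1) ≤ q →
        (1 - unitRoundoff p) * q ≤ phiBound fl p n σ0 ∧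
          phiBound fl p n σ0 ≤ (1 + unitRoundoff p) * q) := by
  have hp1 : 1 ≤ p := by omega
  have hp2 : 2 ≤ p := by omega
  set u := unitRoundoff p with hu
  have hu0 : 0 < u := u_pos
  have hu8 : u ≤ 1 / 8 := by
    rw [hu, unitRoundoff]
    have : (8 : ℚ) ≤ 2 ^ p := by
      calc (8 : ℚ) = 2 ^ 3 := by norm_num
        _ ≤ 2 ^ p := pow_le_pow_right₀ (by norm_num) hp
    exact one_div_le_one_div_of_le (by norm_num) this
  have hσ0pos : 0 < σ0 := lt_trans (two_zpow_pos _) hNU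
  obtain ⟨k, hk⟩ := exists_ufp_eq_two_zpow hσ0pos.ne'
  have hk1 : emin + p - 1 ≤ k := by
    have h1 : (2 : ℚ) ^ (emin + p - 1) ≤ (2 : ℚ) ^ k :=
      hk ▸ two_zpow_le_ufp (by rw [abs_of_pos hσ0pos]; exact hNU.le)
    exact (zpow_le_zpow_iff_right₀ (by norm_num : (1 : ℚ) < 2)).mp h1
  -- the constant c = 2n(n+2)eps = n(n+2)·2^(1−p) ∈ F
  have h8 : (8 : ℕ) ≤ 2 ^ p := by
    calc (8 : ℕ) = 2 ^ 3 := by norm_num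
      _ ≤ 2 ^ p := Nat.pow_le_pow_right (by norm_num) hp
  have hNabs : |((n * (n + 2) : ℕ) : ℤ)| ≤ 2 ^ p := by
    rw [abs_of_nonneg (by positivity)]; exact_mod_cast hN
  have hcF : IsFloat p emin (2 * (n : ℚ) * ((n : ℚ) + 2) * u) := by
    have h := isFloat_of_abs_le (p := p) (emin := emin) hp1 hNabs (k := 1 - p) (by omega)
    convert h using 1
    rw [hu, unitRoundoff, zpow_sub₀ (by norm_num : (2 : ℚ) ≠ 0), zpow_one, zpow_natCast]
    push_cast; field_simp
  have hMF : IsFloat p emin (2 * (n : ℚ) * ((n : ℚ) + 2) * u * ufp σ0) := by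
    have h := isFloat_of_abs_le (p := p) (emin := emin) hp1 hNabs (k := k + 1 - p) (by omega)
    convert h using 1
    rw [hk, hu, show k + 1 - (p : ℤ) = k - p + 1 by ring, ← two_mul_u_mul_two_zpow]
    push_cast; ring
  have h5F : IsFloat p emin (5 * u) := by
    have := isFloat_natCast_mul_u (p := p) (emin := emin) hp1 (K := 5) (by omega) he
    push_cast at this; exact this
  have h15F : IsFloat p emin (1 - 5 * u) := by
    have := isFloat_one_sub_natCast_mul_u (p := p) (emin := emin) hp1 (K := 5) (by omega) he
    push_cast at this; exact this
  have hd0 : 0 < 1 - 5 * u := by linarith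
  set M := 2 * (n : ℚ) * ((n : ℚ) + 2) * u * ufp σ0 with hM
  have hM0 : 0 ≤ M := by have := ufp_nonneg σ0; positivity
  have hΦ : phiBound fl p n σ0 = fl (M / (1 - 5 * u)) := by
    rw [phiBound, ← hu, fl_eq_self hfl hcF, ufpFl_eq_ufp hp2 hfl hσ0F, fl_eq_self hfl hMF,
      fl_eq_self hfl h5F, fl_eq_self hfl h15F]
  refine ⟨M / (1 - 5 * u), hΦ, div_mul_cancel₀ M hd0.ne', ?_, div_nonneg hM0 hd0.le, fun hq => ?_⟩
  · rw [le_div_iff₀ hd0]; nlinarith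
  · have herr := abs_fl_sub_le_mul_abs hp1 hfl (t := M / (1 - 5 * u))
      (by rwa [abs_of_nonneg (div_nonneg hM0 hd0.le)])
    rw [abs_of_nonneg (div_nonneg hM0 hd0.le), ← hu] at herr
    rw [hΦ]
    obtain ⟨h1, h2⟩ := abs_sub_le_iff.mp herr
    constructor <;> linarith

/-- A uniform lower bound for `T' = min(M̃₁, M̃₂)`: `T' ≥ (1 − eps)·n·eps·σ₀ − ½eta`
(`eta/2 = eps·(eps⁻¹eta)/2` covers a possibly subnormal `M̃ᵢ`). Used in Lemma 4.10 in the form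
"`T ≥ n·eps·σ₀`". [cite: Rump2009, proof of Lemma 4.10 (the bound T ≥ n·eps·σ₀) and (4.14)–(4.17)] -/
theorem tBound_lower (hp : 3 ≤ p) (he : emin + 2 * p ≤ 0) (hfl : IsRoundNearest p emin fl) {n : ℕ}
    (hn1 : 1 ≤ n) (hn : 4 * n + 2 ≤ 2 ^ p) {σ0 : ℚ} (hσ0F : IsFloat p emin σ0) (hσ00 : 0 ≤ σ0) :
    (1 - unitRoundoff p) * ((n : ℚ) * unitRoundoff p) * σ0 - unitRoundoff p * (2 : ℚ) ^ (emin + p) / 2 ≤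
      tBound fl p n σ0 := by
  have hp1 : 1 ≤ p := by omega
  have hp2 : 2 ≤ p := by omega
  have he1 : emin + p ≤ 0 := by omega
  set u := unitRoundoff p with hu
  have hu0 : 0 < u := u_pos
  have hu8 : u ≤ 1 / 8 := by
    rw [hu, unitRoundoff]
    have : (8 : ℚ) ≤ 2 ^ p := by
      calc (8 : ℚ) = 2 ^ 3 := by norm_num
        _ ≤ 2 ^ p := pow_le_pow_right₀ (by norm_num) hp
    exact one_div_le_one_div_of_le (by norm_num) this
  have hn0 : (1 : ℚ) ≤ n := by exact_mod_cast hn1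
  have hn00 : (0 : ℚ) ≤ n := Nat.cast_nonneg n
  have hnu0 : 0 ≤ (n : ℚ) * u := mul_nonneg hn00 hu0.le
  have heta : (2 : ℚ) ^ emin / 2 = u * (2 : ℚ) ^ (emin + p) / 2 := by
    rw [hu, u_mul_two_zpow, show emin + p - p = emin by ring]
  -- constants
  have hc1F : IsFloat p emin (3 / 2 + 4 * u) := isFloat_c1 hp (by omega)
  have hnuF : IsFloat p emin ((n : ℚ) * u) := isFloat_natCast_mul_u hp1 (by omega) he1
  have h2nuF : IsFloat p emin (2 * (n : ℚ) * u) := by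
    have := isFloat_natCast_mul_u (p := p) (emin := emin) hp1 (K := 2 * n) (by omega) he1
    push_cast at this; exact this
  have hufpS : ufpFl fl p σ0 = ufp σ0 := ufpFl_eq_ufp hp2 hfl hσ0F
  set v := (3 / 2 + 4 * u) * ((n : ℚ) * u) with hv
  have hv0 : 0 ≤ v := by positivity
  have hvth : (2 : ℚ) ^ (emin + p - 1) ≤ |v| := by
    rw [abs_of_nonneg hv0, hv]
    have h1 : (2 : ℚ) ^ (emin + p - 1) ≤ u := by
      rw [hu, unitRoundoff, one_div, ← zpow_natCast, ← zpow_neg]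
      exact zpow_le_zpow_right₀ (by norm_num) (by omega)
    have h2 : u ≤ (n : ℚ) * u := le_mul_of_one_le_left hu0.le hn0
    have h3 : (n : ℚ) * u ≤ (3 / 2 + 4 * u) * ((n : ℚ) * u) := le_mul_of_one_le_left hnu0 (by linarith)
    linarith
  have hfv : (1 - u) * v ≤ fl v := by
    have := (abs_sub_le_iff.mp (abs_fl_sub_le_mul_abs hp1 hfl hvth)).2
    rw [abs_of_nonneg hv0] at this; linarith
  have hfv0 : 0 ≤ fl v := fl_nonneg hfl hv0
  have hvn : (n : ℚ) * u ≤ (1 - u) * v := by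
    rw [hv]; nlinarith [mul_nonneg (mul_nonneg hnu0 hu0.le) (show 0 ≤ 5 / 2 - 4 * u by linarith)]
  set M2 := 2 * (n : ℚ) * u * ufp σ0 with hM2
  have hufp0 : 0 ≤ ufp σ0 := ufp_nonneg σ0
  have hM2n : (n : ℚ) * u * σ0 ≤ M2 := by
    rcases eq_or_ne σ0 0 with h0 | h0
    · rw [hM2, h0, ufp_zero]; simp
    · have : σ0 < 2 * ufp σ0 := by
        have := abs_lt_two_mul_ufp h0; rwa [abs_of_nonneg hσ00] at this
      rw [hM2]; nlinarith
  have hT'eq : tBound fl p n σ0 = min (fl (fl v * σ0)) (fl M2) := by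
    rw [tBound, ← hu, fl_eq_self hfl hc1F, fl_eq_self hfl hnuF, fl_eq_self hfl h2nuF, hufpS]
  rw [hT'eq]
  have hL0 : (1 - u) * ((n : ℚ) * u) * σ0 ≤ (n : ℚ) * u * σ0 := by nlinarith [mul_nonneg hnu0 hσ00]
  have hE0 : 0 ≤ u * (2 : ℚ) ^ (emin + p) / 2 := by
    have := two_zpow_pos (emin + p); positivity
  refine le_min ?_ ?_
  · -- M̃₁
    have h3 : (1 - u) * v * σ0 ≤ fl v * σ0 := mul_le_mul_of_nonneg_right hfv hσ00
    have h4 : (n : ℚ) * u * σ0 ≤ (1 - u) * v * σ0 := by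
      have := mul_le_mul_of_nonneg_right hvn hσ00; linarith
    rcases le_or_gt ((2 : ℚ) ^ (emin + p - 1)) (|fl v * σ0|) with hn' | hsub
    · have h1 := (abs_sub_le_iff.mp (abs_fl_sub_le_mul_abs hp1 hfl hn')).2
      rw [abs_of_nonneg (mul_nonneg hfv0 hσ00)] at h1
      have h2 : (1 - u) * (fl v * σ0) ≤ fl (fl v * σ0) := by linarith
      have h5 : (1 - u) * ((n : ℚ) * u * σ0) ≤ (1 - u) * (fl v * σ0) :=
        mul_le_mul_of_nonneg_left (h4.trans h3) (by linarith)
      linarith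
    · have h1 := (abs_sub_le_iff.mp (abs_sub_fl_le_of_subnormal hp1 hfl hsub)).1
      rw [heta] at h1
      linarith
  · -- M̃₂
    rcases le_or_gt ((2 : ℚ) ^ (emin + p - 1)) (|M2|) with hn' | hsub
    · have h1 := (abs_sub_le_iff.mp (abs_fl_sub_le_mul_abs hp1 hfl hn')).2
      rw [abs_of_nonneg (by rw [hM2]; positivity)] at h1
      have h5 : (1 - u) * ((n : ℚ) * u * σ0) ≤ (1 - u) * M2 :=
        mul_le_mul_of_nonneg_left hM2n (by linarith)
      linarith
    · have h1 := (abs_sub_le_iff.mp (abs_sub_fl_le_of_subnormal hp1 hfl hsub)).1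
      rw [heta] at h1
      linarith

/-- **Lemma 4.8, (4.19)** (sharpened to what Lemma 4.9 and termination need): if `σ₀ ∉ U`,
`T' ≤ 2n·eps·ufp(σ₀)` and `(11n+1)eps ≤ 1`, then the next `σ₀' = fl(2T'/(1 − (3n+1)eps))`
satisfies `σ₀' ≤ ½ufp(σ₀)` (the paper states `σ₀' ≤ 5n·eps·ufp(σ₀) ≤ σ₀`).
[cite: Rump2009, Lemma 4.8 eq. (4.19) and (4.21)] -/
theorem sigmaZero_le_half_ufp (hp : 2 ≤ p) (he : emin + p ≤ 0) (hfl : IsRoundNearest p emin fl)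
    {n : ℕ} (hn11 : 11 * n + 1 ≤ 2 ^ p) {σ0 T' : ℚ} (hNU : (2 : ℚ) ^ (emin + p - 1) < σ0)
    (hT'F : IsFloat p emin T') (hT' : T' ≤ 2 * (n : ℚ) * unitRoundoff p * ufp σ0) :
    sigmaZero fl p n T' ≤ ufp σ0 / 2 := by
  have hp1 : 1 ≤ p := by omega
  set u := unitRoundoff p with hu
  have hu0 : 0 < u := u_pos
  have hn00 : (0 : ℚ) ≤ n := Nat.cast_nonneg n
  have h3n : 3 * n + 1 ≤ 2 ^ p := by omega
  have hcF : IsFloat p emin ((3 * (n : ℚ) + 1) * u) := by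
    have := isFloat_natCast_mul_u (p := p) (emin := emin) hp1 (K := 3 * n + 1) h3n he
    push_cast at this; exact this
  have hc3F : IsFloat p emin (1 - (3 * (n : ℚ) + 1) * u) := by
    have := isFloat_one_sub_natCast_mul_u (p := p) (emin := emin) hp1 (K := 3 * n + 1) h3n he
    push_cast at this; exact this
  have h11 : (11 * (n : ℚ) + 1) * u ≤ 1 := by
    have := natCast_mul_u_le_one (p := p) (K := 11 * n + 1) hn11
    push_cast at this; exact this
  have h4p : 4 ≤ 2 ^ p := by
    calc 4 = 2 ^ 2 := by norm_num
      _ ≤ 2 ^ p := Nat.pow_le_pow_right (by norm_num) hp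
  have hc3lt : (3 * (n : ℚ) + 1) * u < 1 := by
    have := natCast_mul_u_lt_one (p := p) (K := 3 * n + 1) (by omega)
    push_cast at this; exact this
  have hc3pos : 0 < 1 - (3 * (n : ℚ) + 1) * u := by linarith
  have h2TF : IsFloat p emin (2 * T') := isFloat_two_mul hT'F
  have hσeq : sigmaZero fl p n T' = fl (2 * T' / (1 - (3 * (n : ℚ) + 1) * u)) := by
    rw [sigmaZero, ← hu, fl_eq_self hfl hcF, fl_eq_self hfl hc3F, fl_eq_self hfl h2TF]
  have hσ0pos : 0 < σ0 := lt_trans (two_zpow_pos _) hNU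
  obtain ⟨k, hk⟩ := exists_ufp_eq_two_zpow hσ0pos.ne'
  have hk1 : emin + p - 1 ≤ k := by
    have h1 : (2 : ℚ) ^ (emin + p - 1) ≤ (2 : ℚ) ^ k :=
      hk ▸ two_zpow_le_ufp (by rw [abs_of_pos hσ0pos]; exact hNU.le)
    exact (zpow_le_zpow_iff_right₀ (by norm_num : (1 : ℚ) < 2)).mp h1
  have hhalf : ufp σ0 / 2 = (2 : ℚ) ^ (k - 1) := by
    rw [hk, zpow_sub_one₀ (by norm_num : (2 : ℚ) ≠ 0)]; ring
  have hhalfF : IsFloat p emin (ufp σ0 / 2) := by rw [hhalf]; exact isFloat_two_zpow hp1 (by omega)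
  rw [hσeq]
  refine fl_le_of_le hfl hhalfF ?_
  rw [div_le_iff₀ hc3pos]
  have hufp0 : 0 ≤ ufp σ0 := ufp_nonneg σ0
  have : 2 * T' ≤ 4 * (n : ℚ) * u * ufp σ0 := by linarith
  nlinarith [mul_nonneg (show 0 ≤ 1 - (11 * (n : ℚ) + 1) * u by linarith) hufp0]

/-! ### Algorithm 4.6 `FastAccSum` -/

/-- One pass of the `repeat` loop of Algorithm 4.6 in state `(t, T, p) = (t^(m−1), T^(m−1), p^(m−1))`,
followed by the final lines (`[τ₁, τ₂] = FastTwoSum(t^(m−1), τ^(m))`,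
`res = fl(τ₁ + fl(τ₂ + fl(Σ pᵢ^(m))))`, the inner sum by recursive summation) if the `until`
condition `|t^(m)| ≥ Φ^(m) or 4T^(m) ≤ eps⁻¹eta` holds, and by the next pass otherwise.
The loop terminates by (4.19); we realise it by structural recursion on a pass counter `fuel`
which `fastAccSum` initialises with a provably sufficient value (the value returned when the
counter is exhausted is never reached, see `fastAccSumAux_faithful`). `n` is the vector length.
[cite: Rump2009, Algorithm 4.6 `FastAccSum` (preliminary version with superindices)] -/
def fastAccSumAux (fl : ℚ → ℚ) (p : ℕ) (emin : ℤ) (n : ℕ) : ℕ → ℚ → ℚ → List ℚ → ℚ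
  | 0, t, _, _ => t
  | fuel + 1, t, T, xs =>
      let σ0 := sigmaZero fl p n T
      let e := extractVectorNew fl σ0 xs
      let τ := fl (e.1 - σ0)
      let t' := fl (t + τ)
      if phiBound fl p n σ0 ≤ |t'| ∨ 4 * tBound fl p n σ0 ≤ (2 : ℚ) ^ (emin + p) then
        fl ((fast2Sum fl t τ).1 + fl ((fast2Sum fl t τ).2 + flSum fl e.2))
      else fastAccSumAux fl p emin n fuel t' (tBound fl p n σ0) e.2

/-- **Algorithm 4.6 `FastAccSum`**: `T^(0) = fl(fl(Σ|pᵢ|)/(1 − n·eps))`, `t^(0) = 0`, then the loop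
(`fastAccSumAux`; the pass counter `⌊log₂ σ₀^(1)⌋ − (emin + p − 1) + 2` suffices since every further
pass halves `ufp(σ₀)` and keeps `σ₀ ∉ U`). [cite: Rump2009, Algorithm 4.6 `FastAccSum`] -/
def fastAccSum (fl : ℚ → ℚ) (p : ℕ) (emin : ℤ) (xs : List ℚ) : ℚ :=
  let n := xs.length
  let T0 := fl (flSum fl (xs.map abs) / fl (1 - fl ((n : ℚ) * unitRoundoff p)))
  fastAccSumAux fl p emin n ((Int.log 2 (sigmaZero fl p n T0) - (emin + p - 1)).toNat + 2) 0 T0 xs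

/-- Unfolding one pass of the loop. [cite: Rump2009, Algorithm 4.6] -/
theorem fastAccSumAux_succ (fl : ℚ → ℚ) (p : ℕ) (emin : ℤ) (n fuel : ℕ) (t T : ℚ) (xs : List ℚ) :
    fastAccSumAux fl p emin n (fuel + 1) t T xs =
      if phiBound fl p n (sigmaZero fl p n T) ≤
            |fl (t + fl ((extractVectorNew fl (sigmaZero fl p n T) xs).1 - sigmaZero fl p n T))| ∨
          4 * tBound fl p n (sigmaZero fl p n T) ≤ (2 : ℚ) ^ (emin + p) then
        fl ((fast2Sum fl t (fl ((extractVectorNew fl (sigmaZero fl p n T) xs).1 - sigmaZero fl p n T))).1 +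
          fl ((fast2Sum fl t (fl ((extractVectorNew fl (sigmaZero fl p n T) xs).1 -
              sigmaZero fl p n T))).2 + flSum fl (extractVectorNew fl (sigmaZero fl p n T) xs).2))
      else
        fastAccSumAux fl p emin n fuel
          (fl (t + fl ((extractVectorNew fl (sigmaZero fl p n T) xs).1 - sigmaZero fl p n T)))
          (tBound fl p n (sigmaZero fl p n T)) (extractVectorNew fl (sigmaZero fl p n T) xs).2 := rfl

/-- `fl(a + b)` as a two-term recursive sum. [cite: Rump2009, Algorithm 4.6 (last line)] -/
theorem flSum_pair (fl : ℚ → ℚ) (a b : ℚ) : flSum fl [a, b] = fl (a + b) := rfl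

/-! ### The analysis of Algorithm 4.6: Lemmas 4.9, 4.10 and Theorem 4.11 -/

/-- Numeric consequences of the assumptions `(2n² + 4n + 6)eps ≤ 1`, `eps ≤ 1/128`, `n ≥ 2` of
Theorem 4.11. [cite: Rump2009, Theorem 4.11 (assumptions) and Remark 3] -/
theorem format_facts (hp : 7 ≤ p) {n : ℕ} (hn2 : 2 ≤ n) (hN : 2 * n ^ 2 + 4 * n + 6 ≤ 2 ^ p) :
    unitRoundoff p ≤ 1 / 128 ∧ (2 * (n : ℚ) ^ 2 + 4 * n + 6) * unitRoundoff p ≤ 1 ∧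
      4 * n + 2 ≤ 2 ^ p ∧ n * (n + 2) ≤ 2 ^ p ∧ 11 * n + 1 ≤ 2 ^ p ∧ n ≤ 2 ^ p := by
  have h128 : 128 ≤ 2 ^ p := by
    calc (128 : ℕ) = 2 ^ 7 := by norm_num
      _ ≤ 2 ^ p := Nat.pow_le_pow_right (by norm_num) hp
  have hsq : n ≤ n ^ 2 := by nlinarith
  refine ⟨?_, ?_, by omega, ?_, ?_, by omega⟩
  · rw [unitRoundoff]
    have : (128 : ℚ) ≤ 2 ^ p := by exact_mod_cast h128
    exact one_div_le_one_div_of_le (by norm_num) this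
  · have := natCast_mul_u_le_one (p := p) (K := 2 * n ^ 2 + 4 * n + 6) hN
    push_cast at this; exact this
  · nlinarith [hN, Nat.zero_le (n ^ 2), Nat.zero_le n]
  · rcases (show n = 2 ∨ 3 ≤ n by omega) with rfl | h3
    · omega
    · nlinarith [hN, h3]

/-- Constant bookkeeping for Lemma 4.10 (the final `|τ₂| ≤ ¼·…·eps⁻¹eta < ½eps⁻¹eta` step, here with
the weaker inputs `Φ ≤ (1+eps)q`, `σ₀ ≥ 2T`, `T ≥ (1−eps)n·eps·σ₀ − ½eta`).
[cite: Rump2009, proof of Lemma 4.10 (eq. (4.33) and the bound on |τ₂|)] -/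
theorem poly410 {u n : ℚ} (hu : u ≤ 1 / 128) (hn : 2 ≤ n) :
    (2 / 3 * (1 + u) * (n + 2) + (1 - u) * (1 - 5 * u) / 2) * (1 / 4 + u / 2) ≤
      (1 - u) * n * ((1 - u) * (1 - 5 * u)) / 2 := by
  obtain ⟨d, rfl⟩ : ∃ d, n = 2 + d := ⟨n - 2, by ring⟩
  have hd : 0 ≤ d := by linarith
  have hc1 : 0 ≤ (1 - u) * ((1 - u) * (1 - 5 * u)) / 2 - 2 / 3 * (1 + u) * (1 / 4 + u / 2) := by
    nlinarith [sq_nonneg u, mul_nonneg (sq_nonneg u) (sub_nonneg.2 hu)]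
  have hc0 : 0 ≤ (1 - u) * 2 * ((1 - u) * (1 - 5 * u)) / 2 -
      (2 / 3 * (1 + u) * 4 + (1 - u) * (1 - 5 * u) / 2) * (1 / 4 + u / 2) := by
    nlinarith [sq_nonneg u, mul_nonneg (sq_nonneg u) (sub_nonneg.2 hu)]
  nlinarith [mul_nonneg hd hc1, hc0]

/-- Constant bookkeeping for (4.42): `2(1 − 5eps) + 1 ≤ (1 − 2eps)(1 − eps)(n + 2)` for `n ≥ 2`,
`4n·eps ≤ 1`. [cite: Rump2009, proof of Theorem 4.11 eq. (4.42)] -/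
theorem poly442 {u n : ℚ} (hn : 2 ≤ n) (h4 : 4 * n * u ≤ 1) :
    2 * (1 - 5 * u) + 1 ≤ (1 - 2 * u) * (1 - u) * (n + 2) := by
  nlinarith [mul_nonneg (sq_nonneg u) (show 0 ≤ n + 2 by linarith), sq_nonneg u]

/-- The loop invariant of Algorithm 4.6 in state `(t, T, p) = (t^(k), T^(k), p^(k))` (before pass
`k+1`): `pᵢ ∈ F` (length `n`), `T ∈ F` with `Σ|pᵢ| ≤ T` ((3.3) resp. (4.9)), `t ∈ F`,
`t ∈ eps·ufp(σ₀^(k+1))ℤ` ((4.23)), and the size bound `(1−eps)(1−5eps)|t| ≤ (4/3)(1+eps)(n+2)T`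
(our form of `|t^(k)| < Φ^(k) ≤ 4(n+2)/(3(1−6eps))·T^(k)`, eq. (4.33); trivially true for `t^(0) = 0`).
[cite: Rump2009, Lemma 4.9 eqs. (4.23)–(4.24) and proof of Lemma 4.10 eq. (4.33)] -/
structure LoopInv (p : ℕ) (emin : ℤ) (fl : ℚ → ℚ) (n : ℕ) (t T : ℚ) (xs : List ℚ) : Prop where
  floats : ∀ x ∈ xs, IsFloat p emin x
  len : xs.length = n
  boundF : IsFloat p emin T
  bound : (xs.map abs).sum ≤ T
  tF : IsFloat p emin t
  grid : OnGrid (unitRoundoff p * ufp (sigmaZero fl p n T)) t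
  size : (1 - unitRoundoff p) * (1 - 5 * unitRoundoff p) * |t| ≤
    4 / 3 * (1 + unitRoundoff p) * ((n : ℚ) + 2) * T

/-- The facts about one pass available under the invariant: Lemma 4.5 ((4.3)–(4.9)), Lemma 4.7
(`τ = fl(σₙ − σ₀) = σₙ − σ₀ ∈ eps·ufp(σ₀)ℤ`), (4.27) (`FastTwoSum` is applicable), and the bounds
on `T'`. [cite: Rump2009, Lemmas 4.5, 4.7 and eq. (4.27)] -/
theorem loop_facts (hp : 7 ≤ p) (he : emin + 2 * p ≤ 0) (hfl : IsRoundNearest p emin fl) {n : ℕ}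
    (hn2 : 2 ≤ n) (hN : 2 * n ^ 2 + 4 * n + 6 ≤ 2 ^ p) {t T : ℚ} {xs : List ℚ}
    (hinv : LoopInv p emin fl n t T xs) {σ0 : ℚ} (hσ0 : σ0 = sigmaZero fl p n T) :
    IsFloat p emin σ0 ∧ 0 ≤ σ0 ∧ 2 * T ≤ σ0 ∧
    (∀ y ∈ (extractVectorNew fl σ0 xs).2, IsFloat p emin y ∧ |y| ≤ 2 * unitRoundoff p * ufp σ0) ∧
    (extractVectorNew fl σ0 xs).2.length = n ∧
    fl ((extractVectorNew fl σ0 xs).1 - σ0) = (extractVectorNew fl σ0 xs).1 - σ0 ∧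
    IsFloat p emin ((extractVectorNew fl σ0 xs).1 - σ0) ∧
    |(extractVectorNew fl σ0 xs).1 - σ0| ≤ σ0 / 2 ∧
    OnGrid (unitRoundoff p * ufp σ0) ((extractVectorNew fl σ0 xs).1 - σ0) ∧
    xs.sum = (extractVectorNew fl σ0 xs).1 - σ0 + ((extractVectorNew fl σ0 xs).2).sum ∧
    ((extractVectorNew fl σ0 xs).1 - σ0 = 0 ∨
      OnGrid (2 * unitRoundoff p * ufp ((extractVectorNew fl σ0 xs).1 - σ0)) t) ∧
    IsFloat p emin (tBound fl p n σ0) ∧ 0 ≤ tBound fl p n σ0 ∧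
    (1 - unitRoundoff p) * ((n : ℚ) * unitRoundoff p) * σ0 -
        unitRoundoff p * (2 : ℚ) ^ (emin + p) / 2 ≤ tBound fl p n σ0 ∧
    (4 * tBound fl p n σ0 ≤ (2 : ℚ) ^ (emin + p) →
      (((extractVectorNew fl σ0 xs).2).map abs).sum ≤ (2 : ℚ) ^ (emin + p - 1) ∧
        flSum fl (extractVectorNew fl σ0 xs).2 = ((extractVectorNew fl σ0 xs).2).sum) ∧
    ((2 : ℚ) ^ (emin + p) < 4 * tBound fl p n σ0 →
      (2 : ℚ) ^ (emin + p - 1) < σ0 ∧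
        (((extractVectorNew fl σ0 xs).2).map abs).sum ≤ tBound fl p n σ0 ∧
        3 / 2 * (1 - unitRoundoff p) * ((n : ℚ) * unitRoundoff p) * ufp σ0 ≤ tBound fl p n σ0 ∧
        tBound fl p n σ0 ≤ 2 * (n : ℚ) * unitRoundoff p * ufp σ0) := by
  have hp2 : 2 ≤ p := by omega
  have hp3 : 3 ≤ p := by omega
  have he1 : emin + p ≤ 0 := by omega
  obtain ⟨hxsF, hlen, hTF, hT, -, hgrid, -⟩ := hinv
  subst hlen
  obtain ⟨-, -, h42, -, -, -⟩ := format_facts hp hn2 hN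
  have hn1 : 1 ≤ xs.length := by omega
  obtain ⟨hσ0F, -, h2T, -⟩ := lemma45_setup hp2 he1 hfl hxsF hTF hT h42
  rw [← hσ0] at hσ0F h2T
  have hT0 : 0 ≤ T := (sum_map_abs_nonneg xs).trans hT
  have hσ00 : 0 ≤ σ0 := by linarith
  obtain ⟨he1eq, hlen2, -, hsum⟩ := lemma45_sum hp2 he1 hfl hxsF hTF hT h42 hσ0
  obtain ⟨-, -, hsig⟩ := lemma45_sigma hp2 he1 hfl hxsF hTF hT h42 hσ0
  obtain ⟨hσnF, hτle, hτF, hflτ, -⟩ := hsig xs (List.prefix_refl xs)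
  rw [← he1eq] at hσnF hτle hτF hflτ
  have hparts := lemma45_parts hp2 he1 hfl hxsF hTF hT h42 hσ0
  obtain ⟨hT'F, hT'0, hNU', h48, h49⟩ := lemma45_tBound hp3 he hfl hxsF hTF hT hn1 h42 hσ0 rfl
  have hlow := tBound_lower hp3 he hfl hn1 h42 hσ0F hσ00
  have hgridτ := onGrid_u_ufp_sub hσ0F hσnF hτle
  refine ⟨hσ0F, hσ00, h2T, fun y hy => ⟨(hparts y hy).1, (hparts y hy).2.1⟩, hlen2, hflτ, hτF, hτle,
    hgridτ, hsum, ?_, hT'F, hT'0, hlow, fun h => ⟨(h48 h).1, (h48 h).2.1⟩,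
    fun h => ⟨(h49 h).1, (h49 h).2.1, (h49 h).2.2, (hNU' (h49 h).1).2⟩⟩
  by_cases hτ0 : (extractVectorNew fl σ0 xs).1 - σ0 = 0
  · exact Or.inl hτ0
  · right
    have hσ0pos : 0 < σ0 := by
      rcases hσ00.lt_or_eq with h | h
      · exact h
      · exact absurd (abs_nonpos_iff.mp (by linarith [hτle])) hτ0
    rw [← hσ0] at hgrid
    exact onGrid_two_u_ufp_of_onGrid_u_ufp hσ0pos hτ0 hτle hgrid

/-- **Lemma 4.10** (the exit `4T^(m) ≤ eps⁻¹eta`): then `fl(τ₂ + fl(Σ pᵢ^(m)))` and `fl(Σ pᵢ^(m))`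
are computed without rounding error, so that `res = fl(τ₁ + τ₂ + Σ pᵢ^(m)) = fl(t^(m−1) + τ^(m) +
Σ pᵢ^(m)) = fl(Σ pᵢ)` (here: `= fl(t + Σ pᵢ^(m−1))` for the loop state `(t, T, p^(m−1))`).
The paper's `T^(k) ≥ n·eps·σ₀` is replaced by the uniform `tBound_lower`.
[cite: Rump2009, Lemma 4.10 (eqs. (4.30)–(4.33))] -/
theorem loop_exit_small (hp : 7 ≤ p) (he : emin + 2 * p ≤ 0) (hfl : IsRoundNearest p emin fl)
    {n : ℕ} (hn2 : 2 ≤ n) (hN : 2 * n ^ 2 + 4 * n + 6 ≤ 2 ^ p) {t T : ℚ} {xs : List ℚ}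
    (hinv : LoopInv p emin fl n t T xs) {σ0 : ℚ} (hσ0 : σ0 = sigmaZero fl p n T)
    (h48 : 4 * tBound fl p n σ0 ≤ (2 : ℚ) ^ (emin + p)) :
    fl ((fast2Sum fl t (fl ((extractVectorNew fl σ0 xs).1 - σ0))).1 +
        fl ((fast2Sum fl t (fl ((extractVectorNew fl σ0 xs).1 - σ0))).2 +
          flSum fl (extractVectorNew fl σ0 xs).2)) = fl (t + xs.sum) := by
  have hp1 : 1 ≤ p := by omega
  obtain ⟨hu128, -, -, -, -, -⟩ := format_facts hp hn2 hN
  have hsize := hinv.size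
  have htF := hinv.tF
  obtain ⟨-, hσ00, h2T, hps, -, hflτ, hτF, hτle, -, hsum, hdisj, -, -, hlow, h48f, -⟩ :=
    loop_facts hp he hfl hn2 hN hinv hσ0
  obtain ⟨hS, hflS⟩ := h48f h48
  rw [hflτ]
  set u := unitRoundoff p with hu
  set τ := (extractVectorNew fl σ0 xs).1 - σ0 with hτ
  set ps := (extractVectorNew fl σ0 xs).2 with hps_def
  set Θ := (2 : ℚ) ^ (emin + p) with hΘ
  have hu0 : 0 < u := u_pos
  have hΘ0 : 0 < Θ := two_zpow_pos _
  have hhalf : (2 : ℚ) ^ (emin + p - 1) = Θ / 2 := by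
    rw [hΘ, zpow_sub_one₀ (two_ne_zero)]; ring
  obtain ⟨-, h12, hτ2a, -⟩ := fast2Sum_facts hp1 hfl htF hτF hdisj
  set τ1 := (fast2Sum fl t τ).1 with hτ1
  set τ2 := (fast2Sum fl t τ).2 with hτ2
  have hτ2F : IsFloat p emin τ2 := (hfl _).1
  -- |τ₂| ≤ eps(|t| + σ₀/2)
  have hτ2b : |τ2| ≤ u * |t| + u * σ0 / 2 := by
    calc |τ2| ≤ u * |t + τ| := hτ2a
      _ ≤ u * (|t| + |τ|) := mul_le_mul_of_nonneg_left (abs_add_le t τ) hu0.le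
      _ ≤ u * |t| + u * σ0 / 2 := by linarith [mul_le_mul_of_nonneg_left hτle hu0.le]
  -- the constant bookkeeping: |τ₂| ≤ ½eps⁻¹eta
  have hn0 : (2 : ℚ) ≤ n := by exact_mod_cast hn2
  have hnn : (0 : ℚ) ≤ n := by linarith
  have hA0 : 0 < (1 - u) * (1 - 5 * u) := mul_pos (by linarith) (by linarith)
  have s1 : (1 - u) * (1 - 5 * u) * |t| ≤ 2 / 3 * (1 + u) * ((n : ℚ) + 2) * σ0 := by
    have : 4 / 3 * (1 + u) * ((n : ℚ) + 2) * T ≤ 4 / 3 * (1 + u) * ((n : ℚ) + 2) * (σ0 / 2) :=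
      mul_le_mul_of_nonneg_left (by linarith) (by positivity)
    linarith [hsize]
  have s3 : (1 - u) * (n : ℚ) * (u * σ0) ≤ Θ * (1 / 4 + u / 2) := by
    have : (1 - u) * ((n : ℚ) * u) * σ0 - u * Θ / 2 ≤ Θ / 4 := hlow.trans (by linarith)
    linarith
  have hB0 : 0 ≤ 2 / 3 * (1 + u) * ((n : ℚ) + 2) + (1 - u) * (1 - 5 * u) / 2 := by
    have : 0 ≤ 2 / 3 * (1 + u) * ((n : ℚ) + 2) := by positivity
    linarith [hA0.le]
  have c0 : 0 ≤ (1 - u) * (n : ℚ) := mul_nonneg (by linarith) hnn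
  have key : (1 - u) * (n : ℚ) * ((1 - u) * (1 - 5 * u)) * |τ2| ≤
      (1 - u) * (n : ℚ) * ((1 - u) * (1 - 5 * u)) * (Θ / 2) := by
    have s4 : (1 - u) * (n : ℚ) * ((1 - u) * (1 - 5 * u)) * |τ2| ≤
        (1 - u) * (n : ℚ) * ((1 - u) * (1 - 5 * u)) * (u * |t| + u * σ0 / 2) :=
      mul_le_mul_of_nonneg_left hτ2b (mul_nonneg c0 hA0.le)
    have s5 : (1 - u) * (n : ℚ) * u * ((1 - u) * (1 - 5 * u) * |t|) ≤
        (1 - u) * (n : ℚ) * u * (2 / 3 * (1 + u) * ((n : ℚ) + 2) * σ0) :=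
      mul_le_mul_of_nonneg_left s1 (mul_nonneg c0 hu0.le)
    have s6 : (2 / 3 * (1 + u) * ((n : ℚ) + 2) + (1 - u) * (1 - 5 * u) / 2) *
          ((1 - u) * (n : ℚ) * (u * σ0)) ≤
        (2 / 3 * (1 + u) * ((n : ℚ) + 2) + (1 - u) * (1 - 5 * u) / 2) * (Θ * (1 / 4 + u / 2)) :=
      mul_le_mul_of_nonneg_left s3 hB0
    have s7 := mul_le_mul_of_nonneg_right (poly410 hu128 hn0) hΘ0.le
    linarith only [s4, s5, s6, s7]
  have hτ2Θ : |τ2| ≤ Θ / 2 :=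
    le_of_mul_le_mul_left key (mul_pos (mul_pos (by linarith) (by linarith)) hA0)
  -- `fl(τ₂ + S̃)` is exact, where `S̃ = fl(Σ pᵢ^(m)) = Σ pᵢ^(m)`
  have hSF : IsFloat p emin (flSum fl ps) := isFloat_flSum hfl (fun y hy => (hps y hy).1)
  have hSabs : |flSum fl ps| ≤ Θ / 2 := by
    rw [hflS, ← hhalf]; exact (abs_list_sum_le ps).trans hS
  have hex : fl (τ2 + flSum fl ps) = τ2 + flSum fl ps := by
    have h := flSum_eq_sum_of_sum_abs_le hp1 hfl (xs := [τ2, flSum fl ps])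
      (by
        intro x hx
        simp only [List.mem_cons, List.not_mem_nil, or_false] at hx
        rcases hx with rfl | rfl
        exacts [hτ2F, hSF])
      (by
        simp only [List.map_cons, List.map_nil, List.sum_cons, List.sum_nil, add_zero]
        rw [← hΘ]; linarith)
    rw [flSum_pair] at h
    simpa using h
  rw [hex]
  congr 1
  rw [hsum, hflS]
  linarith [h12]

/-- **Theorem 4.11, the main case** (exit with `|t^(m)| ≥ Φ` and `4T^(m) > eps⁻¹eta`, so `σ₀ ∉ U`):
`res = fl(τ₁ + fl(τ₂ + τ₃))` is a faithful rounding of `s`. The proof is (4.34)–(4.42):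
`τ₃ = fl(Σ pᵢ^(m))` with `|τ₃| ≤ 2^m·n·eps·σ₀`-type bounds by (2.17), `|τ₂| ≤ eps·ufp(τ₁)` by (4.26),
`|res| ≥ (1−2eps)|τ₁| − |τ₃| > ½eps⁻¹eta` and `|res| − 2eps⁻¹|δ| ≥ (1−4eps)|τ₁| − 2n(n+2)eps·ufp(σ₀) > 0`,
whence Lemma 3.2 (`isFaithfulRounding_fl_of_not_mem_U`) applies. For the loop state `(t, T, p)` the
exact sum is `t + Σ pᵢ`. [cite: Rump2009, Theorem 4.11 and its proof, eqs. (4.34)–(4.42)] -/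
theorem loop_exit_main (hp : 7 ≤ p) (he : emin + 2 * p ≤ 0) (hfl : IsRoundNearest p emin fl)
    {n : ℕ} (hn2 : 2 ≤ n) (hN : 2 * n ^ 2 + 4 * n + 6 ≤ 2 ^ p) {t T : ℚ} {xs : List ℚ}
    (hinv : LoopInv p emin fl n t T xs) {σ0 : ℚ} (hσ0 : σ0 = sigmaZero fl p n T)
    (h49 : (2 : ℚ) ^ (emin + p) < 4 * tBound fl p n σ0)
    (hΦ : phiBound fl p n σ0 ≤ |fl (t + fl ((extractVectorNew fl σ0 xs).1 - σ0))|) :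
    IsFaithfulRounding p emin
      (fl ((fast2Sum fl t (fl ((extractVectorNew fl σ0 xs).1 - σ0))).1 +
        fl ((fast2Sum fl t (fl ((extractVectorNew fl σ0 xs).1 - σ0))).2 +
          flSum fl (extractVectorNew fl σ0 xs).2)))
      (t + xs.sum) := by
  have hp1 : 1 ≤ p := by omega
  have hp3 : 3 ≤ p := by omega
  have he1 : emin + p ≤ 0 := by omega
  obtain ⟨-, hNu, -, hNN, -, hnle⟩ := format_facts hp hn2 hN
  have htF := hinv.tF
  obtain ⟨hσ0F, -, -, hps, hlen2, hflτ, hτF, -, -, hsum, hdisj, -, -, -, -, h49f⟩ :=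
    loop_facts hp he hfl hn2 hN hinv hσ0
  obtain ⟨hNU, -, -, hT'M2⟩ := h49f h49
  rw [hflτ] at hΦ
  rw [hflτ]
  set u := unitRoundoff p with hu
  set τ := (extractVectorNew fl σ0 xs).1 - σ0 with hτ
  set ps := (extractVectorNew fl σ0 xs).2 with hps_def
  set Θ := (2 : ℚ) ^ (emin + p) with hΘ
  have hu0 : 0 < u := u_pos
  have hΘ0 : 0 < Θ := two_zpow_pos _
  have hhalf : (2 : ℚ) ^ (emin + p - 1) = Θ / 2 := by
    rw [hΘ, zpow_sub_one₀ (two_ne_zero)]; ring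
  have hn0 : (2 : ℚ) ≤ n := by exact_mod_cast hn2
  have hnn : (0 : ℚ) ≤ n := by linarith
  obtain ⟨h1, h12, -, hτ2u⟩ := fast2Sum_facts hp1 hfl htF hτF hdisj
  set τ1 := (fast2Sum fl t τ).1 with hτ1
  set τ2 := (fast2Sum fl t τ).2 with hτ2
  rw [← h1] at hΦ
  have hτ1F : IsFloat p emin τ1 := by rw [h1]; exact (hfl _).1
  have hτ2F : IsFloat p emin τ2 := (hfl _).1
  -- `ufp(σ₀) = 2^k` with `k ≥ emin + p − 1`
  have hσ0pos : 0 < σ0 := lt_trans (two_zpow_pos _) hNU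
  obtain ⟨k, hk⟩ := exists_ufp_eq_two_zpow hσ0pos.ne'
  have hk1 : emin + p - 1 ≤ k := by
    have h1' : (2 : ℚ) ^ (emin + p - 1) ≤ ufp σ0 :=
      two_zpow_le_ufp (by rw [abs_of_pos hσ0pos]; exact hNU.le)
    rw [hk] at h1'
    exact (zpow_le_zpow_iff_right₀ (by norm_num : (1 : ℚ) < 2)).mp h1'
  have hufp0 : 0 < ufp σ0 := by rw [hk]; exact two_zpow_pos _
  have hM2Θ : Θ / 4 < 2 * (n : ℚ) * u * ufp σ0 := by linarith [hT'M2, h49]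
  -- `Φ = fl(q)` with `q(1 − 5eps) = 2n(n+2)eps·ufp(σ₀)`, `q ∉ U`, hence `|τ₁| ≥ Φ ≥ (1−eps)q`
  obtain ⟨q, -, hqM, hMq, -, hqb⟩ := phiBound_facts hp3 he1 hfl hNN hσ0F hNU
  have hM20 : 0 ≤ 2 * (n : ℚ) * u * ufp σ0 := by positivity
  have hqth : (2 : ℚ) ^ (emin + p - 1) ≤ q := by
    rw [hhalf]
    linarith [hMq, hM2Θ, mul_nonneg (sub_nonneg.2 hn0) hM20]
  obtain ⟨hΦlo, -⟩ := hqb hqth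
  have g5 : (1 - u) * q ≤ |τ1| := hΦlo.trans hΦ
  have hqpos : 0 < q := lt_of_lt_of_le (two_zpow_pos _) hqth
  -- `τ₃ = fl(Σ pᵢ^(m))` and `δ₃` by (2.17) with `|pᵢ^(m)| ≤ 2eps·ufp(σ₀) = 2^(k−p+1)`  ((4.36))
  have hj : emin ≤ k - p + 1 := by omega
  have h2j : (2 : ℚ) ^ (k - p + 1) = 2 * u * ufp σ0 := by rw [hk, two_mul_u_mul_two_zpow]
  have hps' : ∀ y ∈ ps, IsFloat p emin y ∧ |y| ≤ (2 : ℚ) ^ (k - p + 1) :=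
    fun y hy => ⟨(hps y hy).1, by rw [h2j]; exact (hps y hy).2⟩
  obtain ⟨hτ3a, hδ3a⟩ := flSum_bounds_of_abs_le hp1 hfl hj hps' (by rw [hlen2]; exact hnle)
  rw [hlen2, h2j] at hτ3a hδ3a
  set τ3 := flSum fl ps with hτ3
  have hτ3F : IsFloat p emin τ3 := isFloat_flSum hfl (fun y hy => (hps y hy).1)
  -- `τ₂' = fl(τ₂ + τ₃) = τ₂ + τ₃ − δ₂`  ((4.37), (4.38))
  set τ2' := fl (τ2 + τ3) with hτ2'
  have hτ2'F : IsFloat p emin τ2' := (hfl _).1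
  have g1 : |τ2| ≤ u * |τ1| := hτ2u.trans (mul_le_mul_of_nonneg_left (ufp_le_abs _) hu0.le)
  have hd2 : |τ2' - (τ2 + τ3)| ≤ u * (u * |τ1|) + u * |τ3| := by
    calc |τ2' - (τ2 + τ3)| ≤ u * ufp (τ2 + τ3) := abs_fl_add_sub_le_u_ufp hp1 hfl hτ2F hτ3F
      _ ≤ u * |τ2 + τ3| := mul_le_mul_of_nonneg_left (ufp_le_abs _) hu0.le
      _ ≤ u * (|τ2| + |τ3|) := mul_le_mul_of_nonneg_left (abs_add_le _ _) hu0.le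
      _ ≤ u * (u * |τ1|) + u * |τ3| := by linarith [mul_le_mul_of_nonneg_left g1 hu0.le]
  have g3 : |τ2'| ≤ (u + u * u) * |τ1| + (1 + u) * |τ3| := by
    have e : τ2' = (τ2 + τ3) + (τ2' - (τ2 + τ3)) := by ring
    have h' : |τ2'| ≤ |τ2 + τ3| + |τ2' - (τ2 + τ3)| := by
      conv_lhs => rw [e]
      exact abs_add_le _ _
    linarith [abs_add_le τ2 τ3]
  -- `res = fl(τ₁ + τ₂')` with `|res| ≥ (1−2eps)|τ₁| − |τ₃|`  ((4.40))
  have hres : (1 - u) * |τ1 + τ2'| ≤ |fl (τ1 + τ2')| := one_sub_u_mul_abs_add_le hp1 hfl hτ1F hτ2'F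
  have g4 : (1 - 2 * u) * |τ1| - |τ3| ≤ |fl (τ1 + τ2')| := by
    have htri : |τ1| - |τ2'| ≤ |τ1 + τ2'| := by
      have := abs_add_le (τ1 + τ2') (-τ2')
      rw [abs_neg, show τ1 + τ2' + -τ2' = τ1 by ring] at this
      linarith
    have m1 : (1 - u) * (|τ1| - |τ2'|) ≤ (1 - u) * |τ1 + τ2'| :=
      mul_le_mul_of_nonneg_left htri (by linarith [u_le_one (p := p)])
    have m2 : (1 - u) * |τ2'| ≤ (1 - u) * ((u + u * u) * |τ1| + (1 + u) * |τ3|) :=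
      mul_le_mul_of_nonneg_left g3 (by linarith [u_le_one (p := p)])
    have p1 : 0 ≤ u * u * u * |τ1| := by positivity
    have p2 : 0 ≤ u * u * |τ3| := by positivity
    linarith only [hres, m1, m2, p1, p2]
  -- `res ∉ U`  ((4.41), (4.42))
  have hn2u : 0 ≤ (n : ℚ) * (n : ℚ) * u := by positivity
  have hnu : 0 ≤ (n : ℚ) * u := by positivity
  have h15 : 0 < 1 - 5 * u := by linarith [hNu]
  have h4nu : 4 * (n : ℚ) * u ≤ 1 := by linarith [hNu]
  have p6 : 2 * (1 - 5 * u) + 1 ≤ (1 - 2 * u) * (1 - u) * ((n : ℚ) + 2) := poly442 hn0 h4nu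
  have hU : Θ / 2 < |fl (τ1 + τ2')| := by
    have p1 : (1 - 5 * u) * ((1 - 2 * u) * |τ1| - |τ3|) ≤ (1 - 5 * u) * |fl (τ1 + τ2')| :=
      mul_le_mul_of_nonneg_left g4 h15.le
    have p2 : (1 - 2 * u) * ((1 - u) * q) ≤ (1 - 2 * u) * |τ1| :=
      mul_le_mul_of_nonneg_left g5 (by linarith)
    have p2' : (1 - 5 * u) * ((1 - 2 * u) * ((1 - u) * q)) ≤ (1 - 5 * u) * ((1 - 2 * u) * |τ1|) :=
      mul_le_mul_of_nonneg_left p2 h15.le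
    have p3' : (1 - 5 * u) * ((1 - 2 * u) * ((1 - u) * q)) =
        (1 - 2 * u) * (1 - u) * (((n : ℚ) + 2) * (2 * (n : ℚ) * u * ufp σ0)) := by
      rw [show (1 - 5 * u) * ((1 - 2 * u) * ((1 - u) * q)) = (1 - 2 * u) * (1 - u) * (q * (1 - 5 * u))
        by ring, hqM]; ring
    have p6' : (2 * (1 - 5 * u) + 1) * (2 * (n : ℚ) * u * ufp σ0) ≤
        (1 - 2 * u) * (1 - u) * ((n : ℚ) + 2) * (2 * (n : ℚ) * u * ufp σ0) :=
      mul_le_mul_of_nonneg_right p6 (by positivity)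
    have p5' : 2 * (1 - 5 * u) * (Θ / 4) < 2 * (1 - 5 * u) * (2 * (n : ℚ) * u * ufp σ0) :=
      mul_lt_mul_of_pos_left hM2Θ (by linarith)
    have p7 : 0 ≤ 5 * u * |τ3| := by positivity
    have : (1 - 5 * u) * (Θ / 2) < (1 - 5 * u) * |fl (τ1 + τ2')| := by
      linarith only [p1, p2', p3', p6', p5', p7, hτ3a]
    exact lt_of_mul_lt_mul_left this h15.le
  -- `|res| − 2eps⁻¹|δ| > 0` where `δ = δ₂ + δ₃`, `s = τ₁ + τ₂' + δ`  ((4.39) and the final estimate)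
  have hδ : 2 * |(τ2 + τ3 - τ2') + (ps.sum - τ3)| < u * |fl (τ1 + τ2')| := by
    have q2 : |(τ2 + τ3 - τ2') + (ps.sum - τ3)| ≤ |τ2 + τ3 - τ2'| + |ps.sum - τ3| := abs_add_le _ _
    have hd2' : |τ2 + τ3 - τ2'| ≤ u * (u * |τ1|) + u * |τ3| := by rw [abs_sub_comm]; exact hd2
    have hd3' : |ps.sum - τ3| ≤ (n : ℚ) * ((n : ℚ) - 1) / 2 * u * (2 * u * ufp σ0) := by
      rw [abs_sub_comm]; exact hδ3a
    have q1 : u * ((1 - 2 * u) * |τ1| - |τ3|) ≤ u * |fl (τ1 + τ2')| :=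
      mul_le_mul_of_nonneg_left g4 hu0.le
    have q3 : (1 - 4 * u) * ((1 - u) * q) ≤ (1 - 4 * u) * |τ1| :=
      mul_le_mul_of_nonneg_left g5 (by linarith)
    have q3' : u * ((1 - 4 * u) * ((1 - u) * q)) ≤ u * ((1 - 4 * u) * |τ1|) :=
      mul_le_mul_of_nonneg_left q3 hu0.le
    have p3u : u * (q * (1 - 5 * u)) = u * (2 * (n : ℚ) * ((n : ℚ) + 2) * u * ufp σ0) := by rw [hqM]
    have q4 : 0 < u * (u * (u * q)) := by positivity
    have q5 : u * |τ3| ≤ u * ((n : ℚ) * (2 * u * ufp σ0)) := mul_le_mul_of_nonneg_left hτ3a hu0.le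
    linarith only [q2, hd2', hd3', q1, q3', p3u, q4, q5]
  -- Lemma 3.2
  have hfaith := isFaithfulRounding_fl_of_not_mem_U hp1 hfl (r := τ1 + τ2')
    (δ := (τ2 + τ3 - τ2') + (ps.sum - τ3)) (by rw [hhalf]; exact hU) hδ
  have heq : t + xs.sum = τ1 + τ2' + ((τ2 + τ3 - τ2') + (ps.sum - τ3)) := by
    rw [hsum]; linarith [h12]
  rw [heq]
  exact hfaith

/-- **Lemma 4.9** (one pass, the `continue` case `|t^(m)| < Φ^(m)` and `4T^(m) > eps⁻¹eta`):
`t^(m) = fl(t^(m−1) + τ^(m)) = t^(m−1) + τ^(m)` ((4.24), via (4.23) `t^(m−1), τ^(m) ∈ eps·σ₀'ℤ` and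
`|fl(t^(m−1) + τ^(m))| < Φ ≤ σ₀' = ufp(σ₀)`, (2.18)), the invariant is re-established for
`(t^(m), T^(m), p^(m))` (with (4.19): `σ₀^(m+1) ≤ ½ufp(σ₀^(m))`, so `t^(m) ∈ eps·ufp(σ₀^(m+1))ℤ`),
`s = t^(m) + Σ pᵢ^(m)` ((4.25)), and `σ₀^(m+1) ∉ U`, `σ₀^(m+1) ≤ σ₀^(m)/2` (termination).
[cite: Rump2009, Lemma 4.9 (eqs. (4.23)–(4.25)) and eq. (4.19)] -/
theorem loop_continue (hp : 7 ≤ p) (he : emin + 2 * p ≤ 0) (hfl : IsRoundNearest p emin fl)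
    {n : ℕ} (hn2 : 2 ≤ n) (hN : 2 * n ^ 2 + 4 * n + 6 ≤ 2 ^ p) {t T : ℚ} {xs : List ℚ}
    (hinv : LoopInv p emin fl n t T xs) {σ0 : ℚ} (hσ0 : σ0 = sigmaZero fl p n T)
    (h49 : (2 : ℚ) ^ (emin + p) < 4 * tBound fl p n σ0)
    (hlt : |fl (t + fl ((extractVectorNew fl σ0 xs).1 - σ0))| < phiBound fl p n σ0) :
    LoopInv p emin fl n (fl (t + fl ((extractVectorNew fl σ0 xs).1 - σ0))) (tBound fl p n σ0)
        (extractVectorNew fl σ0 xs).2 ∧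
      fl (t + fl ((extractVectorNew fl σ0 xs).1 - σ0)) + ((extractVectorNew fl σ0 xs).2).sum =
        t + xs.sum ∧
      sigmaZero fl p n (tBound fl p n σ0) ≤ σ0 / 2 ∧
      (2 : ℚ) ^ (emin + p - 1) < sigmaZero fl p n (tBound fl p n σ0) := by
  have hp1 : 1 ≤ p := by omega
  have hp2 : 2 ≤ p := by omega
  have hp3 : 3 ≤ p := by omega
  have he1 : emin + p ≤ 0 := by omega
  obtain ⟨-, hNu, h42, hNN, h11, -⟩ := format_facts hp hn2 hN
  have htF := hinv.tF
  have hgrid := hinv.grid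
  obtain ⟨hσ0F, -, -, hps, hlen2, hflτ, hτF, -, hgridτ, hsum, -, hT'F, -, -, -, h49f⟩ :=
    loop_facts hp he hfl hn2 hN hinv hσ0
  obtain ⟨hNU, hST', h32, hT'M2⟩ := h49f h49
  rw [hflτ] at hlt
  rw [hflτ]
  set u := unitRoundoff p with hu
  set τ := (extractVectorNew fl σ0 xs).1 - σ0 with hτ
  set ps := (extractVectorNew fl σ0 xs).2 with hps_def
  set Θ := (2 : ℚ) ^ (emin + p) with hΘ
  set T' := tBound fl p n σ0 with hT'
  have hu0 : 0 < u := u_pos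
  have hΘ0 : 0 < Θ := two_zpow_pos _
  have hhalf : (2 : ℚ) ^ (emin + p - 1) = Θ / 2 := by
    rw [hΘ, zpow_sub_one₀ (two_ne_zero)]; ring
  have hn0 : (2 : ℚ) ≤ n := by exact_mod_cast hn2
  have hnn : (0 : ℚ) ≤ n := by linarith
  -- `ufp(σ₀) = 2^k`, `k ≥ emin + p − 1`
  have hσ0pos : 0 < σ0 := lt_trans (two_zpow_pos _) hNU
  obtain ⟨k, hk⟩ := exists_ufp_eq_two_zpow hσ0pos.ne'
  have hufp0 : 0 < ufp σ0 := by rw [hk]; exact two_zpow_pos _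
  have hufpσ : ufp σ0 ≤ σ0 := by
    have := ufp_le_abs σ0; rwa [abs_of_pos hσ0pos] at this
  have hM2Θ : Θ / 4 < 2 * (n : ℚ) * u * ufp σ0 := by linarith [hT'M2, h49]
  -- `Φ ≤ (1+eps)q ≤ ufp(σ₀)`
  obtain ⟨q, -, hqM, hMq, -, hqb⟩ := phiBound_facts hp3 he1 hfl hNN hσ0F hNU
  have hM20 : 0 ≤ 2 * (n : ℚ) * u * ufp σ0 := by positivity
  have hqth : (2 : ℚ) ^ (emin + p - 1) ≤ q := by
    rw [hhalf]
    linarith [hMq, hM2Θ, mul_nonneg (sub_nonneg.2 hn0) hM20]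
  obtain ⟨-, hΦhi⟩ := hqb hqth
  have hn2u : 0 ≤ (n : ℚ) * (n : ℚ) * u := by positivity
  have hnu : 0 ≤ (n : ℚ) * u := by positivity
  have h15 : 0 < 1 - 5 * u := by linarith [hNu]
  have hq1 : (1 + u) * q ≤ ufp σ0 := by
    have e1 : (1 - 5 * u) * ((1 + u) * q) = (1 + u) * (2 * (n : ℚ) * ((n : ℚ) + 2) * u) * ufp σ0 := by
      rw [show (1 - 5 * u) * ((1 + u) * q) = (1 + u) * (q * (1 - 5 * u)) by ring, hqM]; ring
    have e2 : 2 * (n : ℚ) * ((n : ℚ) + 2) * u ≤ 1 - 6 * u := by linarith [hNu]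
    have e3 : (1 + u) * (2 * (n : ℚ) * ((n : ℚ) + 2) * u) * ufp σ0 ≤ (1 + u) * (1 - 6 * u) * ufp σ0 :=
      mul_le_mul_of_nonneg_right (mul_le_mul_of_nonneg_left e2 (by linarith)) hufp0.le
    have e4 : (1 + u) * (1 - 6 * u) * ufp σ0 ≤ (1 - 5 * u) * ufp σ0 :=
      mul_le_mul_of_nonneg_right (by nlinarith only [sq_nonneg u]) hufp0.le
    refine le_of_mul_le_mul_left ?_ h15
    rw [e1]; exact e3.trans e4
  -- (4.24): `t' = fl(t + τ) = t + τ`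
  have ht'lt : |fl (t + τ)| < (2 : ℚ) ^ k := by
    rw [← hk]; exact lt_of_lt_of_le hlt (hΦhi.trans hq1)
  have hgt : OnGrid (u * (2 : ℚ) ^ k) t := by rw [← hσ0, hk] at hgrid; exact hgrid
  have hgτ : OnGrid (u * (2 : ℚ) ^ k) τ := by rw [hk] at hgridτ; exact hgridτ
  have hexact : fl (t + τ) = t + τ := fl_add_eq_add_of_abs_fl_lt hp1 hfl htF hτF hgt hgτ ht'lt
  -- (4.19) for the next pass, and `σ₀^(m+1) ∉ U`
  have hσ'le : sigmaZero fl p n T' ≤ ufp σ0 / 2 := sigmaZero_le_half_ufp hp2 he1 hfl h11 hNU hT'F hT'M2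
  have h42' : 4 * ps.length + 2 ≤ 2 ^ p := by rw [hlen2]; exact h42
  obtain ⟨-, -, h2T', -⟩ := lemma45_setup hp2 he1 hfl (fun y hy => (hps y hy).1) hT'F hST' h42'
  rw [hlen2] at h2T'
  have hσ'pos : (2 : ℚ) ^ (emin + p - 1) < sigmaZero fl p n T' := by rw [hhalf]; linarith
  refine ⟨⟨fun y hy => (hps y hy).1, hlen2, hT'F, hST', (hfl _).1, ?_, ?_⟩,
    by rw [hexact, hsum]; ring, hσ'le.trans (by linarith), hσ'pos⟩
  · -- `t' ∈ eps·ufp(σ₀^(m+1))ℤ`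
    rw [hexact]
    have hσ'p : 0 < sigmaZero fl p n T' := lt_trans (two_zpow_pos _) hσ'pos
    obtain ⟨k', hk'⟩ := exists_ufp_eq_two_zpow hσ'p.ne'
    have hk'k : k' ≤ k - 1 := by
      have h1 : ufp (sigmaZero fl p n T') ≤ ufp ((2 : ℚ) ^ (k - 1)) := by
        apply ufp_mono
        rw [abs_of_pos hσ'p, abs_of_pos (two_zpow_pos _), zpow_sub_one₀ (two_ne_zero), ← hk]
        linarith
      rw [hk', ufp_two_zpow] at h1
      exact (zpow_le_zpow_iff_right₀ (by norm_num : (1 : ℚ) < 2)).mp h1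
    rw [hk', u_mul_two_zpow]
    have hg : OnGrid (u * (2 : ℚ) ^ k) (t + τ) := hgt.add hgτ
    rw [u_mul_two_zpow] at hg
    exact hg.of_le (by omega)
  · -- the size bound (4.33) for the next state
    have r1 : (1 - u) * (1 - 5 * u) * |fl (t + τ)| ≤ (1 - u) * (1 - 5 * u) * ((1 + u) * q) :=
      mul_le_mul_of_nonneg_left (hlt.le.trans hΦhi) (mul_nonneg (by linarith [u_le_one (p := p)]) h15.le)
    have r2 : (1 - u) * (1 - 5 * u) * ((1 + u) * q) =
        (1 - u) * (1 + u) * (((n : ℚ) + 2) * (2 * (n : ℚ) * u * ufp σ0)) := by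
      rw [show (1 - u) * (1 - 5 * u) * ((1 + u) * q) = (1 - u) * (1 + u) * (q * (1 - 5 * u)) by ring,
        hqM]; ring
    have r3 : (1 - u) * (2 * (n : ℚ) * u * ufp σ0) ≤ 4 / 3 * T' := by linarith [h32]
    have r3' : (1 + u) * ((n : ℚ) + 2) * ((1 - u) * (2 * (n : ℚ) * u * ufp σ0)) ≤
        (1 + u) * ((n : ℚ) + 2) * (4 / 3 * T') := mul_le_mul_of_nonneg_left r3 (by positivity)
    linarith only [r1, r2, r3']

/-- The exit of the loop produces a faithful rounding (Lemma 4.10 resp. the main case of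
Theorem 4.11). [cite: Rump2009, Lemma 4.10 and Theorem 4.11] -/
theorem loop_exit (hp : 7 ≤ p) (he : emin + 2 * p ≤ 0) (hfl : IsRoundNearest p emin fl)
    {n : ℕ} (hn2 : 2 ≤ n) (hN : 2 * n ^ 2 + 4 * n + 6 ≤ 2 ^ p) {t T : ℚ} {xs : List ℚ}
    (hinv : LoopInv p emin fl n t T xs) {σ0 : ℚ} (hσ0 : σ0 = sigmaZero fl p n T)
    (hcond : phiBound fl p n σ0 ≤ |fl (t + fl ((extractVectorNew fl σ0 xs).1 - σ0))| ∨
      4 * tBound fl p n σ0 ≤ (2 : ℚ) ^ (emin + p)) :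
    IsFaithfulRounding p emin
      (fl ((fast2Sum fl t (fl ((extractVectorNew fl σ0 xs).1 - σ0))).1 +
        fl ((fast2Sum fl t (fl ((extractVectorNew fl σ0 xs).1 - σ0))).2 +
          flSum fl (extractVectorNew fl σ0 xs).2)))
      (t + xs.sum) := by
  rcases le_or_gt (4 * tBound fl p n σ0) ((2 : ℚ) ^ (emin + p)) with h48 | h49
  · rw [loop_exit_small hp he hfl hn2 hN hinv hσ0 h48]; exact isFaithfulRounding_fl hfl _
  · exact loop_exit_main hp he hfl hn2 hN hinv hσ0 h49 (hcond.resolve_right (not_le.mpr h49))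

/-- **The loop of Algorithm 4.6 is correct** (induction on the pass counter): in a state satisfying
the invariant with `σ₀ < 2^(emin+p−1+fuel)`, `fuel + 1` passes return a faithful rounding of
`t + Σ pᵢ`. The `continue` case strictly halves `σ₀` and keeps it outside `U` ((4.19), Lemma 4.9),
so the counter is never exhausted. [cite: Rump2009, Lemma 4.9, Lemma 4.10 and Theorem 4.11] -/
theorem fastAccSumAux_faithful (hp : 7 ≤ p) (he : emin + 2 * p ≤ 0) (hfl : IsRoundNearest p emin fl)
    {n : ℕ} (hn2 : 2 ≤ n) (hN : 2 * n ^ 2 + 4 * n + 6 ≤ 2 ^ p) :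
    ∀ (fuel : ℕ) {t T : ℚ} {xs : List ℚ}, LoopInv p emin fl n t T xs →
      sigmaZero fl p n T < (2 : ℚ) ^ (emin + p - 1 + fuel) →
      IsFaithfulRounding p emin (fastAccSumAux fl p emin n (fuel + 1) t T xs) (t + xs.sum) := by
  intro fuel
  induction fuel with
  | zero =>
      intro t T xs hinv hσ
      rw [fastAccSumAux_succ]
      split_ifs with hcond
      · exact loop_exit hp he hfl hn2 hN hinv rfl hcond
      · exfalso
        obtain ⟨hlt, h49⟩ := not_or.mp hcond
        obtain ⟨-, -, hle, hgt⟩ :=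
          loop_continue hp he hfl hn2 hN hinv rfl (lt_of_not_ge h49) (lt_of_not_ge hlt)
        simp only [Nat.cast_zero, add_zero] at hσ
        linarith [two_zpow_pos (emin + p - 1)]
  | succ f ih =>
      intro t T xs hinv hσ
      rw [fastAccSumAux_succ]
      split_ifs with hcond
      · exact loop_exit hp he hfl hn2 hN hinv rfl hcond
      · obtain ⟨hlt, h49⟩ := not_or.mp hcond
        obtain ⟨hinv', hsum', hle, -⟩ :=
          loop_continue hp he hfl hn2 hN hinv rfl (lt_of_not_ge h49) (lt_of_not_ge hlt)
        have hσ' : sigmaZero fl p n (tBound fl p n (sigmaZero fl p n T)) <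
            (2 : ℚ) ^ (emin + p - 1 + f) := by
          have h2 : (2 : ℚ) ^ (emin + p - 1 + ↑(f + 1)) = 2 * (2 : ℚ) ^ (emin + p - 1 + f) := by
            rw [Nat.cast_succ, show emin + p - 1 + ((f : ℤ) + 1) = emin + p - 1 + f + 1 by ring,
              zpow_add_one₀ (two_ne_zero)]
            ring
          rw [h2] at hσ
          linarith
        rw [← hsum']
        exact ih hinv' hσ'

/-- **Theorem 4.11** (`FastAccSum` is faithful). Let `p = (p₁, …, pₙ) ∈ Fⁿ`, `n ≥ 2`,
`(2n² + 4n + 6)·eps ≤ 1` and `eps ≤ 1/128` (i.e. precision `≥ 7`); then `res = FastAccSum(p)` is a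
faithful rounding of `s = Σ pᵢ`. (Format side condition `emin + 2·prec ≤ 0`, true for every IEEE 754
format, makes the constants `2^m·eps`, `1 − 3n·eps`, … of Algorithms 3.5/4.6 normal floating-point
numbers, which the paper assumes tacitly, cf. Remark 1 after Lemma 3.6.)
[cite: Rump2009, Theorem 4.11] -/
theorem isFaithfulRounding_fastAccSum (hp : 7 ≤ p) (he : emin + 2 * p ≤ 0)
    (hfl : IsRoundNearest p emin fl) {xs : List ℚ} (hxs : ∀ x ∈ xs, IsFloat p emin x)
    (hn2 : 2 ≤ xs.length) (hN : 2 * xs.length ^ 2 + 4 * xs.length + 6 ≤ 2 ^ p) :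
    IsFaithfulRounding p emin (fastAccSum fl p emin xs) xs.sum := by
  have hp1 : 1 ≤ p := by omega
  have he1 : emin + p ≤ 0 := by omega
  have hlt : xs.length < 2 ^ p := by
    have : xs.length ≤ xs.length ^ 2 := by nlinarith
    omega
  set n := xs.length with hn_def
  set T0 := fl (flSum fl (xs.map abs) / fl (1 - fl ((n : ℚ) * unitRoundoff p))) with hT0
  have hT : (xs.map abs).sum ≤ T0 := sum_abs_le_tInit hp1 he1 hfl hxs hlt
  have hT00 : 0 ≤ T0 := (sum_map_abs_nonneg xs).trans hT
  have hu0 : 0 < unitRoundoff p := u_pos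
  have hinv : LoopInv p emin fl n 0 T0 xs :=
    ⟨hxs, hn_def.symm, (hfl _).1, hT, isFloat_zero p emin, onGrid_zero _, by
      rw [abs_zero, mul_zero]; positivity⟩
  have hfuel : sigmaZero fl p n T0 <
      (2 : ℚ) ^ (emin + p - 1 + ↑((Int.log 2 (sigmaZero fl p n T0) - (emin + p - 1)).toNat + 1)) := by
    set s := sigmaZero fl p n T0 with hs
    rcases le_or_gt s 0 with h0 | hpos
    · exact lt_of_le_of_lt h0 (two_zpow_pos _)
    · calc s < (2 : ℚ) ^ (Int.log 2 s + 1) := by exact_mod_cast Int.lt_zpow_succ_log_self one_lt_two s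
        _ ≤ _ := zpow_le_zpow_right₀ (by norm_num) (by
            have := Int.self_le_toNat (Int.log 2 s - (emin + p - 1))
            push_cast; omega)
  have h := fastAccSumAux_faithful hp he hfl hn2 hN _ hinv hfuel
  rw [zero_add] at h
  exact h

end Literature.ComputerArithmetic.Rump2009
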